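import Literature.AlgebraicGeometry.HodgeTheory.ComplexGysinCorrespondence
import Literature.AlgebraicGeometry.HodgeTheory.GysinBaseChange
import Literature.AlgebraicGeometry.Hyperkaehler.MarkmanRationalHodgeIsometries
import Literature.AlgebraicGeometry.Hyperkaehler.SymplecticInvolutionK3Square
import Literature.AlgebraicGeometry.Hyperkaehler.K3HilbertSquareIncidence
import Literature.AlgebraicGeometry.Surfaces.K3NikulinInvolution
import Summits.HodgeConjecture.HodgeConjecture.Theorems.NikulinTwinTransportTwinSimilitudeAlgebraic
import Summits.HodgeConjecture.HodgeConjecture.Theorems.NikulinTwinTransportTwinSimilitudeAlgebraicStubDivisorCorrections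
import Summits.HodgeConjecture.HodgeConjecture.Theorems.NikulinTwinTransportTwinSimilitudeAlgebraicStubWittCompletion
import Summits.HodgeConjecture.HodgeConjecture.Theorems.NikulinTwinTransportTwinSimilitudeAlgebraicStubOutAnchorOfSimilitude
import Summits.HodgeConjecture.HodgeConjecture.Theorems.NikulinTwinTransportTwinSimilitudeAlgebraicStubHodgeK3FactsAux
import Summits.HodgeConjecture.HodgeConjecture.Theorems.NikulinTwinTransportTwinSimilitudeAlgebraicHKDefs
import Summits.HodgeConjecture.HodgeConjecture.Theorems.NikulinTwinTransportTwinSimilitudeAlgebraicStubCorrCalculus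
import Summits.HodgeConjecture.HodgeConjecture.Theorems.NikulinTwinTransportTwinSimilitudeAlgebraicStubMarkingPeriodPt
import Summits.HodgeConjecture.HodgeConjecture.Theorems.NikulinTwinTransportTwinSimilitudeAlgebraicStubHkLatticeWitt
import Summits.HodgeConjecture.HodgeConjecture.Theorems.NikulinTwinTransportTwinSimilitudeAlgebraicStubHkTwinClassAssembly
import Summits.HodgeConjecture.HodgeConjecture.Theses.EndoscopicMiddleDegree
import Summits.HodgeConjecture.HodgeConjecture.Theorems.NikulinTwinTransportAlgebraicClassesOneOneK3Proof
import Summits.HodgeConjecture.HodgeConjecture.Theorems.NikulinTwinTransportTwinSimilitudeAlgebraicStubTopPushProportional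
import Summits.HodgeConjecture.HodgeConjecture.Theorems.NikulinTwinTransportTwinSimilitudeAlgebraicStubCorrTranspose
import Summits.HodgeConjecture.HodgeConjecture.Theorems.NikulinTwinTransportTwinSimilitudeAlgebraicStubInverseAnchorAlgebraic
import Summits.HodgeConjecture.HodgeConjecture.Theorems.NikulinTwinTransportTwinSimilitudeAlgebraicStubAnchorForward
import Summits.HodgeConjecture.HodgeConjecture.Theorems.EndoscopicMiddleDegreeCupProductAlgebraicOfChernCharacter
import Literature.AlgebraicGeometry.HodgeTheory.ComplexConjugationHolds
import Literature.AlgebraicGeometry.Surfaces.K3ComplexMultiplication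
import Summits.HodgeConjecture.HodgeConjecture.Theorems.NikulinTwinTransportTwinSimilitudeAlgebraicCMNormTwins
import Summits.HodgeConjecture.HodgeConjecture.Theorems.NikulinTwinTransportTwinSimilitudeAlgebraicStubCMCayleyDecomposition
import Summits.HodgeConjecture.HodgeConjecture.Theorems.NikulinTwinTransportTwinSimilitudeAlgebraicStubCMPolyComplexify
import Summits.HodgeConjecture.HodgeConjecture.Theorems.NikulinTwinTransportTwinSimilitudeAlgebraicStubCMRationalForm
import Summits.HodgeConjecture.HodgeConjecture.Theorems.NikulinTwinTransportTwinSimilitudeAlgebraicStubCMSelfSimilitudeFromIsometries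
import Summits.HodgeConjecture.HodgeConjecture.Theorems.NikulinTwinTransportLefschetzOneOneK3Closing

/-!
# Line `hyperkaehler-nikulin-anchors` — crux `NikulinTwinTransport.TwinSimilitudeAlgebraic`
# (stmt-HodgeConjecture-13674, X = Sim₂(K3), route HodgeConjecture/NikulinTwinTransport, rank 0)

Skeleton of the line (crux-plan, planner-cruxplan-stmt-HodgeConjecture-13674-hyperkaehler-nikulin-0,
2026-08-16) built from the crux idea `Cruxes/TwinSimilitudeAlgebraic/Ideas/hyperkaehler-nikulin-anchors.md`
(triage r2: 3/0 pass — TRIAGE-r2-1 §hyperkaehler + App. B, TRIAGE-r2-2 §hyperkaehler, TRIAGE-r2-3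
§hyperkaehler; sharpenings: restriction-doubling is a THEOREM IN PRINT (Camere–Garbagnati–Kapustka–
Kapustka arXiv:2607.00130 Thm 1.2 = Thm 3.3 = Thm 5.12), Markman arXiv:2204.00516 Thm 1.1 has no
proviso, state the deliverable as a SECTOR theorem landing under `--supports`, injectivity from
non-degeneracy not anisotropy, transpose trick `Ψᵗ = 2Ψ⁻¹` for the anchor).

## The crux and the tree's reduction

X = `TwinSimilitudeAlgebraic`: every rational, type-preserving `2`-similitude
`ψ : H²(S′(ℂ); ℂ) → H²(S(ℂ); ℂ)` between projective K3 surfaces is `fst_*(snd^* – ∪ γ)` for an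
algebraic `γ` on `S × S′`.  LANDED reductions used BY NAME: `Disproof.lean` §1 / the route support
`TwinAnchorGlue : HodgeIsometryAlgebraic → TwinTwistorTransport → TwinSimilitudeAlgebraic` (item
stmt-HodgeConjecture-14394; in the tree `twinSimilitudeAlgebraic_of_anchor` + `twinAnchorGlue_of_cup`):
ONE algebraic anchor `2`-similitude per TARGET surface `S` — a projective K3 `S″` and an algebraic
`Ψ : H²(S″) ≃ H²(S)` whose inverse is a rational, type-preserving `½`-similitude, i.e. the body of the
transport crux `TwinTwistorTransport` (stmt-HodgeConjecture-14393) at `S` — gives X for every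
`(S′, ψ)` with that target (`Ψ⁻¹ ∘ ψ` is a rational Hodge ISOMETRY, Buskin, compose).

## The line: hyperkähler Nikulin anchors (a SECTOR theorem) + the declared residual

LEVER (card, certified by the panel).  Let `(X, φ)` be a projective fourfold of `K3^{[2]}`-type with a
symplectic involution.  Then `Fix(φ) = 28 points ⊔ Σ`, `Σ` a K3 surface (Mongardi arXiv:1107.2854
Thm 4.1), `φ` has co-invariant lattice `E₈(−2)` and invariant lattice `N := U³ ⊕ E₈(−2) ⊕ ⟨−2⟩`
(ibid. Thm 5.2), and RESTRICTION `ν^* : H²(X, ℚ) → H²(Σ, ℚ)` maps `T(X)_ℚ` Hodge-isomorphically onto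
`T(Σ)_ℚ` MULTIPLYING THE BEAUVILLE FORM BY `2` (CGKK arXiv:2607.00130 Thm 5.12 and its proof, p. 14:
`B_Y(π_*x, π_*y) = ¼⟨ν^*π^*π_*x, ν^*π^*π_*y⟩_Σ`, i.e. `⟨ν^*x, ν^*y⟩_Σ = 2 B_X(x, y)` on `T(X)`).
Given a projective K3 surface `S` whose rational transcendental space embeds isometrically into
`N_ℚ` (the SECTOR, `InHKNikulinSector S` below), K3^{[2]} period surjectivity + `Mon² = O⁺` +
"`E₈(−2)` contains no wall class (squares `∈ −4ℤ` vs `−2`, `−10`)" + Markman's Hodge-theoretic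
Torelli realise a projective `(X, φ)` with `T(X)_ℚ ≅ T(S)_ℚ` Hodge-isometrically (TRIAGE-r2-1 App. B.3,
TRIAGE-r2-2 (e)); Witt extends `T(S)_ℚ ≅ T(X)_ℚ` to a rational Hodge isometry
`f : H²(S^{[2]}, ℚ) → H²(X, ℚ)`, ALGEBRAIC by Markman (arXiv:2204.00516 Thm 1.1, both sides projective);
composing the incidence correspondence `S ⊢ S^{[2]}`, Markman's class and the graph of `ν : Σ ↪ X`
gives an ALGEBRAIC class `γ′` on `Σ × S` whose action `Φ = ν^* ∘ f ∘ θ` maps `T(S)` onto `T(Σ)`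
doubling the cup form — a PARTIAL ALGEBRAIC TWIN CLASS (`IsPartialTwinClass`, stub
`HKNikulinTwinClass`).  Completing `Φ` on `NS` by a Witt `2`-similitude made of products of divisors
and transposing (`Ψ := Ψ₀ᵗ = 2Ψ₀⁻¹`) yields the anchor at `S` (stub `AnchorCompletion`, K3-intrinsic).
Hence anchors — and X — for every target `S` in the sector (`twinSimilitudeAlgebraic_onSector`, PROVED
below from the stubs, Buskin and the composition of correspondences; the line's DELIVERABLE, landable
under `--supports stmt-HodgeConjecture-13674`).  The sector strictly contains Varesco's Nikulin locus
`T_ℚ ↪ (U³ ⊕ E₈(−2))_ℚ` (rank `T ≤ 13`, Varesco arXiv:2304.02519 Prop 2.5): it contains every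
`T_ℚ` of rank `≤ 12` (complement of dimension `≥ 3`: Hasse–Minkowski) and rank-`14` types such as
`T_d = ⟨−2d⟩ ⊕ U² ⊕ ⟨−2⟩ ⊕ E₈(−1)` (`ρ = 8`, `E = ℚ` generically, two 12-dimensional families per `d`;
TRIAGE-r2-1 App. B.4, TRIAGE-r2-2 (f)) — the first cases of X off the Nikulin/Kummer/CM loci.

OFF THE SECTOR (rank `T ≥ 15`, i.e. `ρ ≤ 7`, and the Hasse-obstructed types of rank `13, 14`) the line
says NOTHING: the anchors there are the declared RESIDUAL stub `OffSectorAnchors` = the transport crux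
`TwinTwistorTransport` restricted to the complement of the sector (`offSectorAnchors_of_twinTwistorTransport`:
it is implied by route item stmt-HodgeConjecture-14393 and closes the day that item closes).  It is NOT
claimed by this line; it is the honest name of what remains of X after the sector theorem (ceiling of
every finite-symplectic-automorphism anchor on a known hyperkähler type: rank `T ≤ 14`, card (c),
TRIAGE-r2-1 App. B.3).

## Why the hyperkähler fourfold is not in the stub TYPES

The tree has no Hilbert scheme of points and no spelling of "`K3^{[2]}`-type" (cf. the module docstring
of `Literature.AlgebraicGeometry.Hyperkaehler.OGradySixType`: a deformation type is only expressible
relative to a reference variety, and quantifying a LEMMA over all references would assert Markman's and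
Mongardi's theorems for hypothetical exotic `b₂ = 23` fourfolds — an open question, not a theorem in
print).  So the heart stub `HKNikulinTwinClass` is stated at K3 LEVEL (its output is the class `γ′` on
`Σ × S`); the fourfold `(X, φ)`, Markman's class and the incidence correspondence live in its proof
(four named facts to vendor once `defn-IsOfK3HilbertSquareType` lands — filed by this seat; reshape menu
in `Lines/hyperkaehler-nikulin-anchors.md §Stubs`).  Every stub below is TRUE as stated (a theorem in
print assembled, or formal), except the residual, which is HC-implied and open.

## Stubs — RESHAPE r4/r5 (continuation lead prover-line-stmt-HodgeConjecture-13674-c1-0, 2026-08-16)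
## (statement `def`s below; sorried registered forms `stub_*`; name-keyed aliases `Registered.stub_*`)

* `HodgeK3Facts` — the NAMED Literature facts consumed: `Huybrechts_K3_marking_exists` (apex, open)
  and the four hyperkähler facts F1–F4 of the heart, LANDED under `Literature/AlgebraicGeometry/Hyperkaehler/`
  (p110724, p110769, p110771).  [literature debt; not worker-provable]
* THE HEART, cut at fourfold level (section "Reshape r2" below): `HKLatticeWitt` (sub-stub A, lattice
  algebra — wave 2 worker), `CorrCalculus` (sub-stub B — LANDED p111937), `MarkingPeriodPt` (sub-stub
  C — LANDED p111899), `HKTwinClassAssembly` (sub-stub D, the assembly — LANDED by the lead, p115518;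
  r3: registered spelled out; A LANDED p114596) ⟹ `HKNikulinTwinClass` (the r1 heart, now a THEOREM
  of the tree).  r4: every heart/completion stub is discharged by import; the sector theorem itself is
  landed under `Theorems/…TwinSimilitudeAlgebraicHKSectorTheorem.lean` (p118113).
* `DivisorCorrections`, `WittCompletion`, `OutAnchorOfSimilitude` — the K3-intrinsic completion,
  LANDED by the previous lead (p97661, p104519, p106118) and discharged here by import.
* `CupProductAlgebraicInput` — BY NAME the support item `CupProductAlgebraic` of route
  EndoscopicMiddleDegree (stmt-HodgeConjecture-14350, the moving lemma): the ONE formal debt behind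
  every composition of correspondences (`CompCorr` derived: `compCorr_of_cupProductAlgebraic`).
  [blocked: wave 2 worker D — the cone step `hstep` of `cupProduct_mem_algebraicClasses_of_coneStep`, XL]
* `OffSectorSources` — THE RESIDUAL (not claimed): X verbatim for sources NOT in the sector.
  [open sub-case of HC; implied by X, by 13676, and by 13675 + 14394 + 14393]

RESHAPE r8 (continuation lead prover-line-stmt-HodgeConjecture-13674-c3-0, 2026-08-16): the cup-product
input is no longer taken BY NAME from item 14350 (whose own seats assessed it "not provable-now as filed" —
Chow's moving lemma on the tree's carriers — and recommend RESTATING it to the divisor case `k = 1`, which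
would strand this line's `(l,k) = (2,2)` instances on sixfolds and eightfolds).  Instead the registered
stub `stub_cupProductFacts` is the ONE named Literature fact behind it, Voisin I Thm. 11.32 ⊗ ℂ
(`span_holomorphicBundleChernCharacter_eq_algebraicClasses`: on a smooth projective `X` the `ℂ`-span of
the Chern characters of holomorphic bundles is `Nᵖ H²ᵖ`), from which the tree PROVES
`CupProductAlgebraic` (`cupProductAlgebraic_of_span_chernCharacter`, landed p83634 by the 14350 seat:
exterior products are algebraic unconditionally, the diagonal pull-back preserves Chern-character spans
by naturality of Chern–Weil forms; the Hodge-model input `nonempty_hodgeModel` is DISCHARGED in the tree,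
`nonempty_hodgeModel_holds`).  So `stub_cupProductAlgebraic` is now a theorem of this file
(`cupProductAlgebraicInput_of_facts`), every non-residual hypothesis of `TwinSimilitudeAlgebraic_of` is a
NAMED PUBLISHED FACT (marking existence, F1–F4, Voisin I 11.32) or an open route item entering by name
(Buskin 13675, Lefschetz `(1,1)` 13678), and the residual `OffSectorPairs` is the only stub that is
mathematics not in print.

RESHAPE r9/r10 (continuation lead prover-line-stmt-HodgeConjecture-13674-c5-0, 2026-08-16): COMPLEX MULTIPLICATION —
the one anchor mechanism not bounded by the rank of `T`, overlooked by lead c4's mechanism census.  A projective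
K3 surface `S` is CM-norm-2 (`CMNorm2[S, p]`: `H²(S)` carries a rational `2`-self-similitude `e` acting on a
non-zero `(2,0)`-class by a NON-REAL scalar ⇔ `End_Hdg(T(S)_ℚ)` is a CM field with an element of relative norm
`2`, e.g. any CM field containing `i`; Kondō's order-44 surface has rank `T = 20`) is ITS OWN algebraic
`2`-anchor: `e = [γ_e]_*` by Buskin's CM corollary (tree fact `Buskin2019_hodgeConjectureFor_square_of_CM`, the
landed anchor theorem `CmNormAnchors.stub_cmSelfSimilitude_algebraic` of the 13676 chain), `e⁻¹` is rational,
type-preserving and halving (`stub_anchorForward` on `½e`), so the landed glue `simAlg_at_of_outAnchor(_target)`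
gives X at EVERY pair with a CM-norm-2 source or target, at any rank of `T`.  The residual `OffSectorPairs` (r6)
is SPLIT into the registered stub `stub_cmNormTwins` (that theorem; proved by the lead in
`Theorems/NikulinTwinTransportTwinSimilitudeAlgebraicCMNormTwins.lean`), the literature-debt stub
`stub_cmSquareFact` (Buskin's CM corollary by name) and the strictly smaller residual `stub_offSectorNonCMPairs`
(both twins off the sector AND neither CM-norm-2: `End_Hdg(T)` totally real, or CM with `2 ∉ N_{E/E₀}(E^×)`) —
exactly the locus where no published mechanism applies.

`TwinSimilitudeAlgebraic_of` (no `sorry`; r5 hypotheses = ONLY the three open stubs `stub_hodgeK3Facts`,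
`stub_cupProductAlgebraic`, `stub_offSectorSources` + the two OPEN route items 13675, 13678): by cases on
`InHKNikulinSector S′` (the SOURCE): on the sector the heart gives a partial twin class `S′ ⊢ Σ′`, the three completion stubs turn it into an
algebraic OUT-anchor `Ψ : H²(S′) ⥲ H²(Σ′)` (`outAnchor_onSector`), and Buskin on the rational Hodge
ISOMETRY `ψ ∘ Ψ⁻¹` plus `CompCorr` give X (`simAlg_at_of_outAnchor`); off the sector the residual is X.
Route items used as admissible hypotheses: `HodgeIsometryAlgebraic` (13675), `LefschetzOneOneK3`
(13678); `AlgebraicClassesOneOneK3` (15041) is closed in the tree and discharged (r5).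

## Disproof / negatives honoured (`Cruxes/TwinSimilitudeAlgebraic/Disproof.lean` v2, NO KILL; see the landed
## `Theorems/TwinSimilitudeAlgebraic/Negative/{FalseWithoutHtype,NonCMPeriod,HypothesesInhabited,FalseWithoutHrat}` — not
## imported here (r3: import cone kept minimal), none of their statements is an instance of a stub)

* §1 `crux_iff_simAlgAt_two` / `twinSimilitudeAlgebraic_of_anchor`: the glue used is exactly "one
  algebraic anchor per target `S`" (via the route item `TwinAnchorGlue`).
* §3 `twinSimilitudeAlgebraic_false_without_htype` (H = `htype`) and §3b
  `twinSimilitudeAlgebraic_false_without_hrat` (H = `hrat`): honoured — the similitudes this line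
  PRODUCES are rational and type-preserving by construction (`IsPartialTwinClass` clauses (1)–(2), used at
  stub `AnchorCompletion` to make `Ψ⁻¹ = Ψ₀/2` rational and type-preserving), and the `ψ` of X is
  consumed only through Buskin on the isometry `Ψ⁻¹ ∘ ψ`, which uses both `hrat` and `htype` of `ψ`.
* §5 "`γ` EFFECTIVE of degree 1 over `S` is false off the Nikulin locus": respected — `γ′` is a composite
  of correspondences through a fourfold (incidence ∘ Markman ∘ graph), never a prime cycle of degree 1.
* §5 known-cases list (r = 1, CM, Nikulin locus rank ≤ 13, KS-conditional): the sector theorem is OUTSIDE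
  it at rank 14 (signature `(2,12)` does not embed in the `(3,11)` host).
* §2 sign branches: the generator of `H⁴(Σ)` is quantified `∀ p ∃ pg`, absorbing signs.
* Negatives index (`ledger negatives`: 2 entries, DerivedTorelliFermat exhaustion / ELine connectivity):
  unrelated, untouched.  No stub is an instance of a landed Negative lemma (both negatives concern X with a
  hypothesis DROPPED; every statement here keeps `hrat`, `htype`).
-/

noncomputable section

set_option linter.dupNamespace false

open CategoryTheory MonoidalCategory
open scoped Manifold Matrix
open Literature.AlgebraicGeometry.Motives Literature.AlgebraicGeometry.HodgeTheory
open Literature.AlgebraicGeometry.Surfaces Literature.Geometry.Kaehler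
open Literature.AlgebraicGeometry.Hyperkaehler
open Literature.AlgebraicTopology.SingularHomology
open Literature.NumberTheory.Transcendental (exists_deRhamIsoFamily)
open Summit.HodgeConjecture.HodgeConjecture.Theses.NikulinTwinTransport
open Summit.HodgeConjecture.HodgeConjecture.Theorems
open Summit.HodgeConjecture.HodgeConjecture.Theorems.NikulinTwinTransport

namespace Summit.HodgeConjecture.HodgeConjecture.Cruxes.TwinSimilitudeAlgebraic.HyperkaehlerNikulinAnchors

/-! ## Local notations (verbatim those of the route's Theorems files) -/

/-- `MarkedK3[S, η, p, x]`: a marked K3 surface with period `x` — the six marking clauses of the named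
facts `Huybrechts_K3_marking_exists` / `Huybrechts_K3_periodSurjective_projective`. Local notation only,
verbatim from `NikulinTwinTransportHodgeSimilitudeAlgebraicAnchors`. -/
local notation3 (prettyPrint := false) "MarkedK3[" S ", " η ", " p ", " x "]" =>
  (IsIntegralClass p ∧
    (∀ q : complexBetti S (2 * 2), IsIntegralClass q → ∃ n : ℤ, q = n • p) ∧
    (∀ c : complexBetti S (2 * 1), IsIntegralClass c ↔ ∃ v : K3Index → ℤ, η c = fun i => (v i : ℂ)) ∧
    (∀ a b : complexBetti S (2 * 1),
        cupProduct (rfl : 2 * 1 + 2 * 1 = 2 * 2) a b = k3Form (η a) (η b) • p) ∧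
    IsOfHodgeType 2 S (2 * 1) 2 0 (LinearEquiv.symm η x) ∧
    (∀ τ : complexBetti S (2 * 1), IsOfHodgeType 2 S (2 * 1) 2 0 τ → ∃ t : ℂ, τ = t • LinearEquiv.symm η x))

/-- `Gen[S, p]`: `p` is an integral generator of `H⁴(S(ℂ); ℂ)` (the generator clause of X). Local notation
only. -/
local notation3 (prettyPrint := false) "Gen[" S ", " p "]" =>
  (IsIntegralClass p ∧ ∀ q : complexBetti S (2 * 2), IsIntegralClass q → ∃ n : ℤ, q = n • p)

/-- `Corr[μ, S, S', hS, hS' ; γ, y] = [γ]_* y = fst_*(snd^* y ∪ γ)`, the action of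
`γ ∈ H⁴((S ⊗ S′)(ℂ); ℂ)` as a correspondence `H²(S′) → H²(S)` (the FIRST factor receives). Local notation
only, verbatim from the route's Theorems files; for `hS hS'` the K3 witnesses it is definitionally the
inline term of the route items. -/
local notation3 (prettyPrint := false) "Corr[" μ ", " S ", " S' ", " hS ", " hS' " ; " γ ", " y "]" =>
  complexGysin μ
    (IsSmoothProjective.tensor_holds (IsK3Surface.isSmoothProjective hS)
      (IsK3Surface.isSmoothProjective hS'))
    (IsK3Surface.isSmoothProjective hS) (SemiCartesianMonoidalCategory.fst S S')
    (rfl : 2 * 1 + 2 * 2 + 2 * 2 = 2 * 1 + 2 * (2 + 2))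
    (cupProduct (rfl : 2 * 1 + 2 * 2 = 2 * 1 + 2 * 2)
      (complexBetti.map (SemiCartesianMonoidalCategory.snd S S') (2 * 1) y) γ)

/-- `AnchorData[μ, S, hS, p]`: AN ALGEBRAIC ANCHOR `2`-SIMILITUDE AT `S` — the body of the route item
`TwinTwistorTransport` (= `AnchorAt[2]` of the Theorems files) after its `∀ μ S hS p, Gen →` prefix:
a projective K3 `S″`, a generator `p″`, and an algebraic `ℂ`-linear equivalence `Ψ : H²(S″) ≃ H²(S)`
whose inverse is rational, type-preserving and halves the cup form. Local notation only. -/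
local notation3 (prettyPrint := false) "AnchorData[" μ ", " S ", " hS ", " p "]" =>
  ∃ (S'' : SchemeOver ℂ) (hS'' : IsK3Surface S'') (p'' : complexBetti S'' (2 * 2)),
    Gen[S'', p''] ∧
    ∃ Ψ : complexBetti S'' (2 * 1) ≃ₗ[ℂ] complexBetti S (2 * 1),
      (∀ y, IsRationalClass y → IsRationalClass (Ψ.symm y)) ∧
      (∀ (i j : ℕ) y, IsOfHodgeType 2 S (2 * 1) i j y →
        IsOfHodgeType 2 S'' (2 * 1) i j (Ψ.symm y)) ∧
      (∀ (u v : complexBetti S (2 * 1)) (b : ℂ),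
        cupProduct (rfl : 2 * 1 + 2 * 1 = 2 * 2) u v = ((2 : ℂ) * b) • p →
          cupProduct (rfl : 2 * 1 + 2 * 1 = 2 * 2) (Ψ.symm u) (Ψ.symm v) = b • p'') ∧
      ∃ γ ∈ algebraicClasses (MonoidalCategoryStruct.tensorObj S S'') 2,
        ∀ x : complexBetti S'' (2 * 1), Ψ x = Corr[μ, S, S'', hS, hS'' ; γ, x]

/-- `CompCorr`: composition of algebraic degree-`2` correspondences between smooth projective surfaces
acts as an algebraic correspondence — hypothesis (C) of `twinSimilitudeAlgebraic_of_anchor`, verbatim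
(the tree proves it from the multiplicativity `N² ∪ N² ⊆ N⁴`: `corrComp_surfaces_of_cup'`; route item
`TwinAnchorGlue` is its packaged use). Local notation only. -/
local notation3 (prettyPrint := false) "CompCorr" =>
  ∀ (μ : OrientationFamily), μ.HasPoincareDuality →
    ∀ (A B C : SchemeOver ℂ) (hA : IsSmoothProjective 2 A) (hB : IsSmoothProjective 2 B)
      (hC : IsSmoothProjective 2 C),
      ∀ γ ∈ algebraicClasses (MonoidalCategoryStruct.tensorObj A B) 2,
        ∀ γ₁ ∈ algebraicClasses (MonoidalCategoryStruct.tensorObj B C) 2,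
          ∃ γ₂ ∈ algebraicClasses (MonoidalCategoryStruct.tensorObj A C) 2,
            ∀ x : complexBetti C (2 * 1),
              complexGysin μ (IsSmoothProjective.tensor_holds hA hC) hA
                  (SemiCartesianMonoidalCategory.fst A C)
                  (rfl : 2 * 1 + 2 * 2 + 2 * 2 = 2 * 1 + 2 * (2 + 2))
                  (cupProduct (rfl : 2 * 1 + 2 * 2 = 2 * 1 + 2 * 2)
                    (complexBetti.map (SemiCartesianMonoidalCategory.snd A C) (2 * 1) x) γ₂) =
                complexGysin μ (IsSmoothProjective.tensor_holds hA hB) hA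
                  (SemiCartesianMonoidalCategory.fst A B)
                  (rfl : 2 * 1 + 2 * 2 + 2 * 2 = 2 * 1 + 2 * (2 + 2))
                  (cupProduct (rfl : 2 * 1 + 2 * 2 = 2 * 1 + 2 * 2)
                    (complexBetti.map (SemiCartesianMonoidalCategory.snd A B) (2 * 1)
                      (complexGysin μ (IsSmoothProjective.tensor_holds hB hC) hB
                        (SemiCartesianMonoidalCategory.fst B C)
                        (rfl : 2 * 1 + 2 * 2 + 2 * 2 = 2 * 1 + 2 * (2 + 2))
                        (cupProduct (rfl : 2 * 1 + 2 * 2 = 2 * 1 + 2 * 2)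
                          (complexBetti.map (SemiCartesianMonoidalCategory.snd B C) (2 * 1) x)
                          γ₁)))
                    γ)

/-! ## The host lattice `N = U³ ⊕ E₈(−2) ⊕ ⟨−2⟩`, the sector and partial twin classes

LANDED (p110850, `Theorems/NikulinTwinTransportTwinSimilitudeAlgebraicHKDefs.lean`, namespace
`…Theorems.NikulinTwinTransport`, opened above): `HostIndex`, `hostGram`, `hostGram_transpose`,
`hostFormRat`, `castVec`, `castVec_apply`, `nsRat`, `mem_nsRat`, `trRat`, `mem_trRat`, `InHKNikulinSector`,
`IsPartialTwinClass` — verbatim the planner's definitions that lived here in r0/r1. -/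

/-- `Perp[S ; x]`: `x ∈ H²(S(ℂ); ℂ)` is TRANSCENDENTAL — cup-orthogonal to every divisor class
`d ∈ NS(S) ⊗ ℂ = algebraicClasses S 1 = N¹H²` (for a projective K3 surface: `x ∈ T(S)_ℚ ⊗ ℂ`), spelled
exactly as in the route items (`TwinTransportRMPicardTwo`). Local notation only.
[cite: Huybrechts2016K3, Ch. 3 Def. 2.5] -/
local notation3 (prettyPrint := false) "Perp[" S " ; " x "]" =>
  ∀ d ∈ algebraicClasses S 1, cupProduct (rfl : 2 * 1 + 2 * 1 = 2 * 2) x d = 0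

/-! ## Out-anchors (reshape r1 by the line lead, 2026-08-16)

The planner's completion stub produced an IN-anchor at `S` (an algebraic doubling map INTO `H²(S)`)
from the partial twin class `γ′ : S ⊢ Σ` by the TRANSPOSE `Ψ := Ψ₀ᵗ = 2Ψ₀⁻¹`, which needs the
adjunction `([γ]_* x . y)_Σ = (x . [γᵗ]_* y)_S` on the tree's real carriers (projection formula for
both projections, Gysin of the braiding, fibre integrals on both sides) — an `M`-sized calculus the
tree does not have.  It is NOT needed: the completed class `Ψ₀ = [γ′ + Σ γᵢ]_* : H²(S) ⥲ H²(Σ)` is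
ITSELF an anchor — an OUT-anchor at `S` = an in-anchor at `Σ` whose partner is `S`
(`OutAnchor[μ, S, Σ, …]` below is literally the body of `AnchorData[μ, Σ, hΣ, pΣ]` with `S″ := S`) — and
X at a pair `(S, S′)` follows from an out-anchor at the SOURCE `S′` exactly as it follows from an
in-anchor at the target: `ψ ∘ Ψ⁻¹ : H²(Σ′) → H²(S)` is a rational Hodge ISOMETRY (½-similitude after a
`2`-similitude), algebraic by Buskin (`HodgeIsometryAlgebraic` at `(S, Σ′)`), and `ψ = (ψ ∘ Ψ⁻¹) ∘ Ψ`
is a composition of algebraic correspondences `S′ ⊢ Σ′ ⊢ S` (`simAlg_at_of_outAnchor`).  So the sector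
hypothesis moves from the target `S` to the source `S′`, the transpose disappears, and the completion
splits into three independent, individually TRUE stubs (two of them provable in the tree today):
`DivisorCorrections` (unconditional), `WittCompletion` (linear algebra, modulo the K3 facts + the two
`(1,1)` route items), `OutAnchorOfSimilitude` (modulo the K3 facts).  The price: the composition of
degree-`2` correspondences between surfaces (`CompCorr`, Fulton 16.1.1 / Buskin Lemma 6.3) enters
`_of` explicitly as the registered stub `stub_compCorr` instead of through the route item
`TwinAnchorGlue` (14394) — the SAME formal debt (both are `corrComp_surfaces_of_cupPullback` away from
the multiplicativity `N² ∪ N² ⊆ N⁴` on triple products of surfaces, i.e. the moving lemma, which the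
tree deliberately keeps as a hypothesis to be CONSTRUCTED, `AlgebraicClassesCup` "What is NOT here").
The residual becomes `OffSectorSources` = X verbatim for sources OFF the sector (implied by X, by
`HodgeSimilitudeAlgebraic` 13676, and by 13675 + 14394 + 14393: `offSectorSources_of_twinTwistorTransport`).
-/

/-- `OutAnchor[μ, S, Sg, hS, hSg, p, pg]`: AN ALGEBRAIC OUT-ANCHOR `2`-SIMILITUDE AT `S` WITH PARTNER
`Sg` — a `ℂ`-linear equivalence `Ψ : H²(S) ≃ H²(Sg)` which is algebraic (the action of an algebraic
class on `Sg ⊗ S`) and whose inverse is rational, type-preserving and HALVES the cup form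
(`(u.v) = 2b·pg ⟹ (Ψ⁻¹u.Ψ⁻¹v) = b·p`).  Symbol for symbol the body of `AnchorData[μ, Sg, hSg, pg]`
(= the body of the route crux `TwinTwistorTransport` at `Sg`) with the partner `S″ := S`, `p″ := p`.
Local notation only. -/
local notation3 (prettyPrint := false)
    "OutAnchor[" μ ", " S ", " Sg ", " hS ", " hSg ", " p ", " pg "]" =>
  ∃ Ψ : complexBetti S (2 * 1) ≃ₗ[ℂ] complexBetti Sg (2 * 1),
    (∀ y, IsRationalClass y → IsRationalClass (Ψ.symm y)) ∧
    (∀ (i j : ℕ) y, IsOfHodgeType 2 Sg (2 * 1) i j y →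
      IsOfHodgeType 2 S (2 * 1) i j (Ψ.symm y)) ∧
    (∀ (u v : complexBetti Sg (2 * 1)) (b : ℂ),
      cupProduct (rfl : 2 * 1 + 2 * 1 = 2 * 2) u v = ((2 : ℂ) * b) • pg →
        cupProduct (rfl : 2 * 1 + 2 * 1 = 2 * 2) (Ψ.symm u) (Ψ.symm v) = b • p) ∧
    ∃ γ ∈ algebraicClasses (MonoidalCategoryStruct.tensorObj Sg S) 2,
      ∀ x : complexBetti S (2 * 1), Ψ x = Corr[μ, Sg, S, hSg, hS ; γ, x]

/-! ## Reshape r2 (continuation lead c1, 2026-08-16): the heart at FOURFOLD LEVEL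

Since r1 the tree gained the vocabulary the heart was formally blocked on
(`Hyperkaehler.IsOfK3HilbertSquareType`, the `K3^{[2]}` lattice `K3HilbertIndex`, `k3HilbertGram 2`,
`k3HilbertForm 2` = `Λ_{K3} ⊕ ⟨−2⟩`; definition item `defn-IsOfK3HilbertSquareType` DONE).  So the
heart's theorem-in-print is now cut into NAMED FACTS (each a published statement, rendered on the
tree's carriers through a Beauville–Bogomolov MARKING `MarkedK3Sq[X, φ, P, z]`, the `K3^{[2]}` analogue
of `MarkedK3[S, η, p, x]`, and the lattice-side transcendental spaces `Tr₂[· ; z]`, `Tr[· ; x]`) plus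
three FORMAL sub-stubs and one ASSEMBLY stub:

* facts (join `HodgeK3Facts`; LANDED as Literature named facts under
  `Literature/AlgebraicGeometry/Hyperkaehler/` — p110724 `SymplecticInvolutionK3Square` (F1, F2), p110769
  `MarkmanRationalHodgeIsometries` (F3), p110771 `K3HilbertSquareIncidence` (F4), 2026-08-16T15:12Z):
  F1 `CamereEtAl2026_symplecticInvolution_periodSurjective`
  (REALISATION: at every projective period `z` of the invariant lattice `N = (Λ_{K3} ⊕ ⟨−2⟩)^I`,
  `I` = swap of the two `E₈(−1)` blocks, there is a smooth projective `K3^{[2]}`-type `X` with a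
  symplectic involution acting by `I` in a BBF-marking of period `z` — CGKK 2026 §2.3 and proof of
  Thm. 3.1, Mongardi 2012 Cor. 5.3, Mongardi 2016 Thm. 4.1, Markman's Hodge-theoretic Torelli);
  F2 `CamereEtAl2023_fixedK3_restriction` (FIXED K3 + DOUBLING: the fixed K3 `ν : F ↪ X` exists and
  `ν^*` maps `T(X)_ℚ ⊗ ℂ` onto `T(F)_ℚ ⊗ ℂ` multiplying the BBF form by `2` — Mongardi 2012 Thm. 4.1,
  CGKK 2023 Prop. 3.16 and Lemma 4.3, CGKK 2026 Lemma 5.5 / Thm. 5.12);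
  F3 `Markman2024_rationalHodgeIsometry_algebraic_marked` (MARKMAN Thm. 1.1 in marked form: a
  bijective rational type-preserving `f : H²(X) → H²(Y)` isometric for the BBF-markings is `[Z]_*` for
  an algebraic `Z` on `Y ⊗ X`, at every orientation family with Poincaré duality — the orientation-free
  rendering parallel to `Buskin2019_hodgeIsometry_algebraic`; the tree's `beauvilleForm` rendering needs
  the complex orientation family, which the tree does not construct);
  F4 `Beauville1983_hilbertSquare_markedIncidence` (INCIDENCE: the Hilbert square `H = S^{[2]}` of a
  marked projective K3 `(S, η, p, x)` is smooth projective of `K3^{[2]}`-type with a BBF-marking of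
  period `(x, 0)` in which the incidence correspondence `[Ξ]_* : H²(S) → H²(H)` — an ALGEBRAIC class
  on `H ⊗ S` — reads `a ↦ (η a, 0)`; Beauville 1983 §6 Prop. 6 and Remarque, §9 Lemme 1 and Rem. 1).
* `HKLatticeWitt` (PURE LATTICE ALGEBRA, provable now from `Witt_isometry_extension_holds`): from the
  sector datum `J : T_x ↪ N_ℚ` build a rational isometry `g ∈ O((Λ_{K3} ⊕ ⟨−2⟩)_ℚ)` carrying the
  Hilbert-square period `(x, 0)` to an `I`-invariant projective period `z`.
* `CorrCalculus` (FORMAL, provable now from the tree's `corr_comp_of_baseChange`, `gysin_baseChange`,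
  `corrCompClass_mem_algebraicClasses`, `corrAction_gysinGraph_one` pattern): composition of algebraic
  correspondences in all dimensions GRANTED `CupProductAlgebraic`, and "the graph class of `ν : F ⟶ X`
  is algebraic and acts as `ν^*`".
* `MarkingPeriodPt` (K3 LINEAR ALGEBRA, provable now: two markings of a K3 differ by an integral
  isometry — `not_antiIsometry_k3Form` kills the sign — so the period clauses of
  `Huybrechts_K3_marking_exists` hold for EVERY marking, in particular for the sector's).
* `HKTwinClassAssembly` (THE NEW HEART, lead): the three sub-stubs ⟹ `HKNikulinTwinClass`, i.e. with
  the facts: mark `S` (sector), `MarkingPeriodPt`, `HKLatticeWitt` ⟹ `(g, z)`; F1 ⟹ `(X, ι, φ, P)`;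
  F2 ⟹ `(F, ν)`; F4 ⟹ `(H, φ_H, θ)`; `f := φ⁻¹ ∘ g_ℂ ∘ φ_H` is bijective, rational, type-preserving
  and marked-isometric ⟹ F3 ⟹ `Z`; `CorrCalculus` ⟹ ONE algebraic `γ` on `F ⊗ S` with
  `[γ]_* = ν^* ∘ [Z]_* ∘ [θ]_*`; then the five clauses of `IsPartialTwinClass` (rationality; Hodge types
  through the markings; `Φ(T(S)) = T(F)` and doubling from F2 with `g` an isometry — the K3 sides
  converted between `Perp[· ; ·]` and `Tr[· ; ·]` by the route items `LefschetzOneOneK3`,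
  `AlgebraicClassesOneOneK3` and the markings).
-/

/-- `MarkedK3Sq[X, φ, P, z]`: a BEAUVILLE–BOGOMOLOV MARKING of a smooth projective fourfold `X` of
`K3^{[2]}`-type with period `z ∈ (Λ_{K3} ⊕ ⟨−2⟩) ⊗ ℂ` (the `K3^{[2]}` analogue of `MarkedK3[S, η, p, x]`):
(m1) `P` is an integral generator of `H⁸(X(ℂ); ℂ)`; (m2) `φ : H²(X(ℂ); ℂ) ≅ ℂ²³` identifies the integral
classes with `ℤ²³`; (m3) the FUJIKI RELATION `a⁴ = 3 · q(φ a)² · P` for `q = k3HilbertForm 2` (Fujiki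
constant `3` of `K3^{[2]}`; with (m2) it pins `q ∘ φ` to the Beauville–Bogomolov form — up to the sign
fixed by the signature `(3, 20)` — and `P` to the complex orientation class); (m4) `φ⁻¹ z` spans the
`(2,0)`-classes; (m5) the `(1,1)`-classes are the `q`-orthogonal of `z` and `z̄` (Beauville's
`q`-orthogonality of the Hodge decomposition); (m6) `q(z) = 0 < q(z̄, z)`.  Local notation only.
[cite: Beauville1983, §8 Thm. 5 and §9 Rem. 1] [cite: Huybrechts1999, §1.9 and §1.11] -/
local notation3 (prettyPrint := false) "MarkedK3Sq[" X ", " φ ", " P ", " z "]" =>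
  ((IsIntegralClass P ∧ ∀ Q : complexBetti X (2 * 4), IsIntegralClass Q → ∃ n : ℤ, Q = n • P) ∧
    (∀ c : complexBetti X 2, IsIntegralClass c ↔ ∃ v : K3HilbertIndex → ℤ, φ c = fun i => (v i : ℂ)) ∧
    (∀ a : complexBetti X 2, cupPowTwo a 4 = ((3 : ℂ) * (k3HilbertForm 2 (φ a) (φ a)) ^ 2) • P) ∧
    (IsOfHodgeType 4 X 2 2 0 (LinearEquiv.symm φ z) ∧
      ∀ τ : complexBetti X 2, IsOfHodgeType 4 X 2 2 0 τ → ∃ t : ℂ, τ = t • LinearEquiv.symm φ z) ∧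
    (∀ c : complexBetti X 2, IsOfHodgeType 4 X 2 1 1 c ↔
        (k3HilbertForm 2 (φ c) z = 0 ∧ k3HilbertForm 2 (φ c) (star z) = 0)) ∧
    (k3HilbertForm 2 z z = 0 ∧ 0 < (k3HilbertForm 2 (star z) z).re))

/-- `Tr₂[w ; z]`: `w ∈ ℂ²³` lies in the complexified RATIONAL TRANSCENDENTAL SPACE `T(z)_ℚ ⊗ ℂ` of the
period `z`, `T(z)_ℚ := (z^⊥ ∩ ℚ²³)^⊥` (under a BBF-marking of `X`: `T(X)_ℚ`, the smallest rational
Hodge substructure containing `H^{2,0}`). Local notation only. [cite: Huybrechts2016K3, Ch. 3 Def. 2.5 and Lemma 3.1] -/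
local notation3 (prettyPrint := false) "Tr₂[" w " ; " z "]" =>
  (∀ v : K3HilbertIndex → ℚ, k3HilbertForm 2 (fun i => ((v i : ℚ) : ℂ)) z = 0 →
    k3HilbertForm 2 (fun i => ((v i : ℚ) : ℂ)) w = 0)

/-- `Tr[w ; x]`: the same for the K3 lattice `Λ_{K3} ⊗ ℂ` and a K3 period `x` (`= (trRat x) ⊗ ℂ`).
Local notation only. [cite: Huybrechts2016K3, Ch. 3 Def. 2.5 and Lemma 3.1] -/
local notation3 (prettyPrint := false) "Tr[" w " ; " x "]" =>
  (∀ v : K3Index → ℚ, k3Form (fun i => ((v i : ℚ) : ℂ)) x = 0 → k3Form (fun i => ((v i : ℚ) : ℂ)) w = 0)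

/-- **Sub-stub A — `HKLatticeWitt` (PURE LATTICE ALGEBRA).**  From a projective K3 period `x ∈ Λ_ℂ`
(`(x.x) = 0`, `(x̄.x) > 0`, a positive integral vector orthogonal to `x`) and the SECTOR DATUM
`J : T_x = trRat x → N_ℚ` (isometric and injective on `T_x`): a RATIONAL ISOMETRY `g` of
`(Λ_{K3} ⊕ ⟨−2⟩)_ℚ` carrying the Hilbert-square period `(x, 0)` to a period `z := g_ℂ(x, 0)` which is
INVARIANT under the block swap `I` and PROJECTIVE.  Proof: embed the host `N = U³ ⊕ E₈(−2) ⊕ ⟨−2⟩`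
isometrically onto the `I`-invariant sublattice (`E₈(−2) ∋ e ↦ (e, e)` diagonally in `E₈(−1)²`, `U³`,
`⟨−2⟩ ↦ δ`); Witt (`Witt_isometry_extension_holds`, no non-degeneracy of `T_x` needed) extends the
isometric injection `inl(T_x) → N_ℚ ⊂ Λ_ℚ²³` to `g`; `x ∈ T_x ⊗ ℂ` (double orthogonal), so `z` lies in
`N_ℂ`; `g` is real, so `q(z) = q(x) = 0`, `q(z̄, z) = (x̄.x) > 0`; the positive integral `u ⊥ x` gives the
rational `g(u, 0) ⊥ z` — clear denominators. [cite: Huybrechts2019, §1 (Witt over ℚ)]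
[cite: Mongardi2011, Thm. 5.2 and Cor. 5.3] -/
def HKLatticeWitt : Prop :=
  ∀ (x : K3Index → ℂ), k3Form x x = 0 → 0 < (k3Form (star x) x).re →
    (∃ u : K3Index → ℤ, k3Form (fun i => (u i : ℂ)) x = 0 ∧ 0 < ∑ i, ∑ j, u i * k3Gram i j * u j) →
    ∀ J : (K3Index → ℚ) →ₗ[ℚ] (HostIndex → ℚ),
      (∀ v ∈ trRat x, ∀ w ∈ trRat x, hostFormRat (J v) (J w) = k3FormRat v w) →
      (∀ v ∈ trRat x, J v = 0 → v = 0) →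
      ∃ (g : (K3HilbertIndex → ℚ) ≃ₗ[ℚ] (K3HilbertIndex → ℚ)) (z : K3HilbertIndex → ℂ),
        (∀ v w : K3HilbertIndex → ℚ,
            k3HilbertForm 2 (fun i => ((g v i : ℚ) : ℂ)) (fun i => ((g w i : ℚ) : ℂ)) =
              k3HilbertForm 2 (fun i => ((v i : ℚ) : ℂ)) (fun i => ((w i : ℚ) : ℂ))) ∧
        (LinearMap.toMatrix' g.toLinearMap).map (fun q : ℚ => (q : ℂ)) *ᵥ Sum.elim x 0 = z ∧
        (∀ i, z (Sum.map k3BlockSwap id i) = z i) ∧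
        k3HilbertForm 2 z z = 0 ∧ 0 < (k3HilbertForm 2 (star z) z).re ∧
        ∃ u : K3HilbertIndex → ℤ, k3HilbertForm 2 (fun i => (u i : ℂ)) z = 0 ∧
          0 < ∑ i, ∑ j, u i * k3HilbertGram 2 i j * u j

/-- **Sub-stub B — `CorrCalculus` (FORMAL correspondence calculus).**  (i) `CorrCompOfCup`: GRANTED
`CupProductAlgebraic` (item 14350), algebraic correspondences compose in all dimensions — for smooth
projective `A, B, C` of dimensions `l, m, n`, `γ ∈ Nᵐ H²ᵐ((A ⊗ B)(ℂ))` (degree `0` from `B` to `A`) and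
`γ′ ∈ Nⁿ H²ⁿ((B ⊗ C)(ℂ))`, some algebraic `γ″ ∈ Nⁿ((A ⊗ C)(ℂ))` acts on `Hᵏ(C)` as `[γ]_* ∘ [γ′]_*`
(Fulton Prop. 16.1.1: `γ″ = c • p₁₃₊(p₁₂^* γ ∪ p₂₃^* γ′)`; in the tree `corr_comp_of_baseChange` with the
PROVED `gysin_baseChange`, and `corrCompClass_mem_algebraicClasses` with `hCUP :=` the item on the
triple product).  (ii) `GraphClassPullback`: for `ν : F ⟶ X` between smooth projective varieties, the
graph class `(𝟙, ν)₊ 1 ∈ Nⁿ((F ⊗ X)(ℂ))` is algebraic and acts on `Hᵏ(X)` as `ν^*` (Fulton Def. 16.1.2;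
pattern of `corrAction_gysinGraph_one`). [cite: Fulton1998, §16.1 Prop. 16.1.1 and Def. 16.1.2]
[cite: VoisinHodgeII2003, §9.2.4 Prop. 9.20] -/
def CorrCompOfCup : Prop :=
  Summit.HodgeConjecture.HodgeConjecture.Theses.EndoscopicMiddleDegree.CupProductAlgebraic →
  ∀ (μ : OrientationFamily), μ.HasPoincareDuality →
    ∀ (A B C : SchemeOver ℂ) (l m n k : ℕ) (hA : IsSmoothProjective l A) (hB : IsSmoothProjective m B)
      (hC : IsSmoothProjective n C),
      ∀ γ ∈ algebraicClasses (A ⊗ B) m, ∀ γ' ∈ algebraicClasses (B ⊗ C) n,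
        ∃ γ'' ∈ algebraicClasses (A ⊗ C) n, ∀ y : complexBetti C k,
          corrAction μ hA hC (rfl : k + 2 * n = k + 2 * n) γ'' y =
            corrAction μ hA hB (rfl : k + 2 * m = k + 2 * m) γ
              (corrAction μ hB hC (rfl : k + 2 * n = k + 2 * n) γ' y)

/-- (ii) of `CorrCalculus`: the graph class of `ν : F ⟶ X` is algebraic and acts as `ν^*`.
[cite: Fulton1998, §16.1 Def. 16.1.2 and Prop. 16.1.1] -/
def GraphClassPullback : Prop :=
  ∀ (μ : OrientationFamily), μ.HasPoincareDuality →
    ∀ (F X : SchemeOver ℂ) (d n k : ℕ) (hF : IsSmoothProjective d F) (hX : IsSmoothProjective n X)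
      (ν : F ⟶ X),
      ∃ γ ∈ algebraicClasses (F ⊗ X) n, ∀ b : complexBetti X k,
        corrAction μ hF hX (rfl : k + 2 * n = k + 2 * n) γ b = complexBetti.map ν k b

/-- `CorrCalculus := CorrCompOfCup ∧ GraphClassPullback` (one registered stub, one worker).
[cite: Fulton1998, §16.1] -/
def CorrCalculus : Prop := CorrCompOfCup ∧ GraphClassPullback

/-- **Sub-stub C — `MarkingPeriodPt` (K3 LINEAR ALGEBRA): the projective period clauses hold for EVERY
marking of a projective K3 surface** (not only for the one provided by `Huybrechts_K3_marking_exists`):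
two markings `η, η₀` with generators `p, p₀` differ by `γ = η ∘ η₀⁻¹` preserving `ℤ²²`; `p = ±p₀`, and
`p = −p₀` would make `γ` an integral ANTI-isometry of `Λ_{K3}` (`not_antiIsometry_k3Form`: impossible by
the signature), so `γ ∈ O(Λ_{K3})`, `x = t · γ x₀` (`h^{2,0} = 1`), whence `(x.x) = 0`,
`(x̄.x) = |t|²(x̄₀.x₀) > 0` and `γ u₀` is a positive integral vector orthogonal to `x`.
[cite: Huybrechts2016K3, Ch. 6 §3.2 and Ch. 1 Prop. 3.5] -/
def MarkingPeriodPt : Prop :=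
  Huybrechts_K3_marking_exists →
  ∀ (S : SchemeOver ℂ), IsK3Surface S →
    ∀ (η : complexBetti S (2 * 1) ≃ₗ[ℂ] (K3Index → ℂ)) (p : complexBetti S (2 * 2)) (x : K3Index → ℂ),
      MarkedK3[S, η, p, x] →
      k3Form x x = 0 ∧ 0 < (k3Form (star x) x).re ∧
        ∃ u : K3Index → ℤ, k3Form (fun i => (u i : ℂ)) x = 0 ∧ 0 < ∑ i, ∑ j, u i * k3Gram i j * u j

/-! ## The seven stub statements (reshape r1) -/

/-- STUB 0 — `HodgeK3Facts` (reshaped r2 by the continuation lead, 2026-08-16): the NAMED Literature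
facts the stubs consume, as one conjunction.  r1 listed six K3/Hodge facts of which four are now
DISCHARGED in the tree (`Huybrechts_K3_hodgeTypes_H2_holds`, `hodgePQ_independent_of_hodgeModel_holds`,
`exists_deRhamIsoFamily_holds`; the Hodge index theorem for K3 surfaces is DERIVED from markings +
Lefschetz `(1,1)`: `hodgeIndex_K3_of_marking`, landed `…StubHodgeK3FactsAux`) and one
(`Grothendieck1969_supportedClasses_le_hodgeConiveau`) is not consumed by any stub of this line; they
are dropped.  What remains NAMED: (i) markings of K3 surfaces exist (Huybrechts Ch. 1 Prop. 3.5; OPEN,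
XL-apex — the K3-intrinsic stubs and the heart consume it); and the HYPERKÄHLER facts of the heart now
vendored in `Literature/AlgebraicGeometry/Hyperkaehler/`: (ii) Mongardi 2012 Thm. 4.1/5.2 (fixed locus
of a symplectic involution on a projective `K3^{[2]}`-type fourfold = `28` points ⊔ one K3 surface,
invariant rank `15`; `Mongardi2011_symplecticInvolution_fixedLocus`), (iii) Markman 2024 Thm. 1.1
(rational Hodge isometries of `H²` between projective `K3^{[n]}`-type manifolds are algebraic;
`Markman2024_rationalHodgeIsometry_algebraic`).  The remaining hyperkähler inputs of the heart
(realisation of `(X, ι)` at every projective period of the invariant lattice — CGKK 2026 §2.3 / §4 with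
Mongardi 2016 Thm. 4.1 and Markman's Hodge-theoretic Torelli; the restriction-doubling `T(Σ)_ℚ ≅
T(X)_ℚ(2)` — CGKK 2026 Thm. 5.12, CGKK 2023 Prop. 3.16; Beauville's incidence `H²(S) ↪ H²(S^{[2]})` —
Beauville 1983 §6 Prop. 6, §9) are stated INLINE in the heart's stub files as cited `def X : Prop`
facts (gate-relocated to Literature) and join this conjunction at the next reshape.  All are theorems
in print. [cite: Huybrechts2016K3, Ch. 1 Prop. 3.5 and Ch. 6 Prop. 1.2] [cite: Mongardi2011, Thm. 4.1 and Thm. 5.2]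
[cite: Markman2024, Thm. 1.1] [cite: CamereEtAl2026, §2.3, Thm. 5.12] -/
def HodgeK3Facts : Prop :=
  Huybrechts_K3_marking_exists ∧
    CamereEtAl2026_symplecticInvolution_periodSurjective ∧ CamereEtAl2023_fixedK3_restriction ∧
    Markman2024_rationalHodgeIsometry_algebraic_marked ∧ Beauville1983_hilbertSquare_markedIncidence

/-- STUB 1 — `HKNikulinTwinClass`, THE HEART (hardest stub, unchanged by the reshape): **every
projective K3 surface in the HK-Nikulin sector has a PARTIAL ALGEBRAIC TWIN CLASS into some projective
K3 surface `Σ`** — granted the K3/Hodge facts, Lefschetz `(1,1)` for K3 (route item 13678) and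
"divisor classes are `(1,1)`" (route item 15041): for `S` with `IsK3Surface S`, any integral generator
`p` of `H⁴(S)`, and `InHKNikulinSector S`, there are a projective K3 `Σ = Sg`, a generator `pg` of
`H⁴(Σ)` and `γ ∈ algebraicClasses (Σ ⊗ S) 2` with `IsPartialTwinClass μ S Σ hS hΣ p pg γ`.  PROOF IN
PRINT (the hyperkähler Nikulin anchor): (i) REALISATION — `T_x := trRat x ↪ N_ℚ ⊂ (Λ_{K3} ⊕ ⟨−2⟩)_ℚ`;
surjectivity of the period map for `K3^{[2]}`-type (Huybrechts), `ι_Λ := (−1 on E₈(−2)) ⊕ (+1 on N)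
∈ O⁺ = Mon²` (Markman), `E₈(−2)` has no wall class (squares `∈ −4ℤ`; walls have square `−2`, or `−10`
and divisibility `2`: Bayer–Macrì, Mongardi), Hodge-theoretic Torelli ⟹ a PROJECTIVE `(X, φ)` of
`K3^{[2]}`-type with a symplectic involution and `T(X)_ℚ ≅ T(S)_ℚ` Hodge-isometrically (TRIAGE-r2-1
App. B.3); (ii) FIXED K3 — `Fix(φ) = 28 pts ⊔ Σ` (Mongardi Thm 4.1, co-invariant `E₈(−2)`, invariant
`N`, Thm 5.2) and restriction `ν^* : T(X)_ℚ → T(Σ)_ℚ` is a Hodge isomorphism multiplying the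
Beauville form by `2` (CGKK Lemma 5.5 (2) and the proof of Thm 5.12, p. 14:
`B_Y(α, β) = ¼⟨f(α), f(β)⟩_F`, `f = ν^*π^*ρ_*`, `π^*ρ_*` doubling); (iii) MARKMAN — Witt-extend
`T(S)_ℚ ≅ T(X)_ℚ` to a rational Hodge isometry `f : H²(S^{[2]}, ℚ) → H²(X, ℚ)` (both
`≅ (Λ ⊕ ⟨−2⟩)_ℚ`, complements `(1,1)`), algebraic by Markman Thm 1.1 (both projective); (iv) COMPOSE
the Hilbert incidence `θ = [Ξ]_* : H²(S) ↪ H²(S^{[2]})` (algebraic, isometric onto `δ^⊥`; `Ξ` FINITE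
flat over `S^{[2]}`, so `p₁₂^*[Ξ] ∪ p₂₃^*[Z]` is a PROPER intersection for every support `Z` of
Markman's class — `cupPullback_mem_algebraicClasses_of_inter`, no moving lemma there), Markman's
class, and the graph class of `ν : Σ ↪ X` (`corrClassAction_graph`; the pull-back of an algebraic
class along the closed immersion `S × Σ ↪ S × X` is where a moving lemma IS needed): `γ′` on
`Σ × S` with `[γ′]_* = ν^* ∘ f ∘ θ =: Φ`, which on `T(S)` is `θ` (isometric) then `f` (isometric)
then `ν^*` (doubling, onto `T(Σ)`); rationality and Hodge types are automatic.  FORMAL STATUS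
(lead, cycle 1): blocked on the definition item `defn-IsOfK3HilbertSquareType` (claimed by a
literature-prover since 2026-08-16T09:51Z) — without "`K3^{[2]}`-type" none of Mongardi 4.1/5.2,
CGKK 5.12, Markman 1.1, `K3^{[2]}` Torelli can be STATED as named facts — and, for step (iv), on the
moving-lemma input of `cupProduct_mem_algebraicClasses_of_moving` for `S ⊗ (X ⊗ Σ)`.
[cite: CamereEtAl2026, Thm. 1.2, Lemma 5.5 (2), Thm. 5.12 and Cor. 5.10]
[cite: Mongardi2011, Thm. 1.3, Thm. 4.1 and Thm. 5.2] [cite: Markman2024, Thm. 1.1]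
[cite: Huybrechts2016K3, Ch. 7 Thm. 4.1] [cite: Varesco2023, §2 (proof of Thm. 2.1) and Prop. 2.5] -/
def HKNikulinTwinClass : Prop :=
  HodgeK3Facts → Summit.HodgeConjecture.HodgeConjecture.Theses.EndoscopicMiddleDegree.CupProductAlgebraic →
  LefschetzOneOneK3 → AlgebraicClassesOneOneK3 →
  ∀ (μ : OrientationFamily), μ.HasPoincareDuality →
    ∀ (S : SchemeOver ℂ) (hS : IsK3Surface S) (p : complexBetti S (2 * 2)), Gen[S, p] →
      InHKNikulinSector S →
      ∃ (Sg : SchemeOver ℂ) (hSg : IsK3Surface Sg) (pg : complexBetti Sg (2 * 2)), Gen[Sg, pg] ∧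
        ∃ γ ∈ algebraicClasses (MonoidalCategoryStruct.tensorObj Sg S) 2,
          IsPartialTwinClass μ S Sg hS hSg p pg γ

/-- STUB 2 — `DivisorCorrections` (UNCONDITIONAL; two-surface form of the landed
`divisorCorrespondence_of_fibreIntegral`): **products of divisors act as rank-one maps.**  For
projective K3 surfaces `S, Sg`, a non-zero `p ∈ H⁴(S(ℂ))`, and algebraic divisor classes
`a ∈ N¹H²(S)`, `b ∈ N¹H²(Sg)`, some algebraic `γ ∈ N²H⁴((Sg ⊗ S)(ℂ))` (namely
`c⁻¹ · pr_{Sg}^* b ∪ pr_S^* a`) acts as `x ↦ (x.a) b`: `[γ]_* x = t · b` whenever `x ∪ a = t · p`.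
Proof in the tree's terms: `cupProduct_map_fst_map_snd_mem_algebraicClasses` (exterior products of
divisor classes are algebraic), projection formula `complexGysin_cup`, and FIBRE INTEGRATION
`pr_{Sg*}(pr_S^* p) = c · 1_{Sg}`, `c ≠ 0`, from the Künneth spanning THEOREM
`kunnethSpan_complexBetti` via `fibreIntegral_of_kunnethTop μ hSg hS _ (p ≠ 0)`. Size S–M.
[cite: Fulton1998, §16.1 Prop. 16.1.1] [cite: FultonYoungTableaux1997, Appendix B §B.1 (3), (6)]
[cite: HatcherAT2002, §3.2 Thm. 3.15] -/
def DivisorCorrections : Prop :=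
  ∀ (μ : OrientationFamily), μ.HasPoincareDuality →
    ∀ (S Sg : SchemeOver ℂ) (hS : IsK3Surface S) (hSg : IsK3Surface Sg)
      (p : complexBetti S (2 * 2)), p ≠ 0 →
      ∀ a ∈ algebraicClasses S 1, ∀ b ∈ algebraicClasses Sg 1,
        ∃ γ ∈ algebraicClasses (MonoidalCategoryStruct.tensorObj Sg S) 2,
          ∀ (x : complexBetti S (2 * 1)) (t : ℂ),
            cupProduct (rfl : 2 * 1 + 2 * 1 = 2 * 2) x a = t • p →
              Corr[μ, Sg, S, hSg, hS ; γ, x] = t • b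

/-- STUB 3 — `WittCompletion` (K3-INTRINSIC LINEAR ALGEBRA; the two-surface form of the landed
`exists_wittCorrection` / `exists_ratCorrection`): **a partial algebraic twin class completes, by
products of divisors, to a rational type-preserving `2`-similitude on all of `H²(S)`.**  For a partial
twin class `γ : S ⊢ Sg` (action `Φ = [γ]_*`: rational, type-preserving, `Φ(T(S)) = T(Sg)`, doubling on
`T(S)`) there are algebraic divisor classes `aᵢ ∈ N¹H²(S)`, `bᵢ ∈ N¹H²(Sg)` (`i < m`) such that for
ANY linear `Φ` agreeing with `[γ]_*` and ANY linear `νᵢ` acting as `x ↦ (x.aᵢ) bᵢ`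
(`x ∪ aᵢ = t · p ⟹ νᵢ x = t · bᵢ`), the sum `Ψ₀ := Φ + Σᵢ νᵢ` preserves rational classes, preserves
every Hodge type, and DOUBLES the cup form on all of `H²(S)` (`(x.y) = c·p ⟹ (Ψ₀x.Ψ₀y) = 2c·pg`).
Proof in print / in the tree's terms: markings `η, η′` of `S, Sg` (`HodgeK3Facts.1`); over `ℚ`,
`N_ℚ :=` rational points of `N = algebraicClasses S 1` (spanned by rational classes:
`span_isRationalClass_eq_top_of_isSmoothProjective_holds.supportedClasses_eq_span`), `T_ℚ := N_ℚ^⊥`,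
`Λ_ℚ = N_ℚ ⊕ T_ℚ` by Hodge index (`HodgeK3Facts.2.2.2.2.2`, as in `exists_mem_add_mem_of_isRationalClass`
/ `exists_nsProjection`); `M : Λ_ℚ ⥲ Λ_ℚ` a fixed `2`-similitude (`exists_twoSimilitude_k3FormRat`);
`σ := M⁻¹ ∘ Φ_ℚ|_{T_ℚ}` is an injective ISOMETRIC embedding (`Φ` doubles on `T`, injective there since
`ker ⊆ T_ℚ ∩ T_ℚ^⊥ = T_ℚ ∩ N_ℚ = 0`), so Witt (`Witt_isometry_extension_holds`, no non-degeneracy of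
`T_ℚ` needed) extends it to an isometry `τ` of `Λ_ℚ`; `Ψ₀ := M ∘ τ` is a bijective rational
`2`-similitude equal to `Φ` on `T`; `g := Ψ₀ − Φ` kills `T` and maps `N` into `N′ = algebraicClasses Sg 1`
(`Ψ₀(N) = Ψ₀(T^⊥) = T′^⊥ = N′`; `Φ(N) ⊆ N′` because `N` is spanned by rational `(1,1)`-classes
(`AlgebraicClassesOneOneK3`) whose images are rational `(1,1)` hence algebraic (`LefschetzOneOneK3`),
cf. `map_mem_algebraicClasses_of_hodgeEndo`), so `g = Σᵢ (·.aᵢ) bᵢ` (`exists_eq_sum_rankOne`, two-space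
form); Hodge types: `g` kills `(2,0)`/`(0,2)` (they lie in `T`) and lands in `N′ ⊆ H^{1,1}`
(`isOfHodgeType_add_correction'` pattern); every cup product `x ∪ aᵢ` is a multiple of `p` (marking +
generator), so the hypotheses on `Φ, νᵢ` pin `Ψ₀`. Size M–L.
[cite: Huybrechts2019, §1 (Witt over ℚ)] [cite: Varesco2023, Thm. 2.1 and Rem. 2.2]
[cite: Iversen1992, Ch. I §2 Thm. 2.4] [cite: Huybrechts2016K3, Ch. 3 §2.2 and Lemma 3.3.1] -/
def WittCompletion : Prop :=
  Huybrechts_K3_marking_exists → (∀ (S : SchemeOver ℂ), IsK3Surface S → hodgeIndex_surface S) →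
  LefschetzOneOneK3 → AlgebraicClassesOneOneK3 →
    ∀ (S Sg : SchemeOver ℂ) (hS : IsK3Surface S) (hSg : IsK3Surface Sg)
      (p : complexBetti S (2 * 2)) (pg : complexBetti Sg (2 * 2)), Gen[S, p] → Gen[Sg, pg] →
      ∀ (Φ : complexBetti S (2 * 1) →ₗ[ℂ] complexBetti Sg (2 * 1)),
        (∀ x, IsRationalClass x → IsRationalClass (Φ x)) →
        (∀ (i j : ℕ) x, IsOfHodgeType 2 S (2 * 1) i j x → IsOfHodgeType 2 Sg (2 * 1) i j (Φ x)) →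
        (∀ x, Perp[S ; x] → Perp[Sg ; Φ x]) →
        (∀ y, Perp[Sg ; y] → ∃ x, Perp[S ; x] ∧ Φ x = y) →
        (∀ x, Perp[S ; x] → ∀ y, Perp[S ; y] → ∀ a : ℂ,
          cupProduct (rfl : 2 * 1 + 2 * 1 = 2 * 2) x y = a • p →
            cupProduct (rfl : 2 * 1 + 2 * 1 = 2 * 2) (Φ x) (Φ y) = ((2 : ℂ) * a) • pg) →
        ∃ (m : ℕ) (a : Fin m → complexBetti S (2 * 1)) (b : Fin m → complexBetti Sg (2 * 1)),
          (∀ i, a i ∈ algebraicClasses S 1) ∧ (∀ i, b i ∈ algebraicClasses Sg 1) ∧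
          ∀ (ν : Fin m → (complexBetti S (2 * 1) →ₗ[ℂ] complexBetti Sg (2 * 1))),
            (∀ i (x : complexBetti S (2 * 1)) (t : ℂ),
              cupProduct (rfl : 2 * 1 + 2 * 1 = 2 * 2) x (a i) = t • p → ν i x = t • b i) →
            (∀ x, IsRationalClass x → IsRationalClass ((Φ + ∑ i, ν i) x)) ∧
            (∀ (i j : ℕ) x, IsOfHodgeType 2 S (2 * 1) i j x →
              IsOfHodgeType 2 Sg (2 * 1) i j ((Φ + ∑ i, ν i) x)) ∧
            (∀ (x y : complexBetti S (2 * 1)) (c : ℂ),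
              cupProduct (rfl : 2 * 1 + 2 * 1 = 2 * 2) x y = c • p →
                cupProduct (rfl : 2 * 1 + 2 * 1 = 2 * 2) ((Φ + ∑ i, ν i) x) ((Φ + ∑ i, ν i) y) =
                  ((2 : ℂ) * c) • pg)

/-- STUB 4 — `OutAnchorOfSimilitude` (K3-INTRINSIC; two-surface form of the first half of the landed
`rmAnchor_at_of_realMultiplication_algebraic_at`): **an algebraic, rational, type-preserving
`2`-similitude `Ψ₀ : H²(S) → H²(Sg)` between projective K3 surfaces is an out-anchor at `S`.**  `Ψ₀` is
injective (a `2`-similitude of the non-degenerate cup form: `Ψ₀ x = 0 ⟹ (x.y) = 0 ∀ y`, markings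
`HodgeK3Facts.1`, `pg ≠ 0`), hence bijective (`dim H²(S) = dim H²(Sg) = 22`); its inverse is rational
(`Ψ₀` maps the rational lattice `ℚ²²` injectively, hence onto, `isRationalClass_iff_of_marking`),
type-preserving (`Ψ₀` maps the lines `H^{2,0} = ℂσ`, `H^{0,2} = ℂσ̄` onto the corresponding lines of
`Sg` with non-zero scalars and `H^{1,1} = {c | c ∪ σ = 0 = c ∪ σ̄}` onto `H^{1,1}` by the similitude
identity — `Huybrechts_K3_hodgeTypes_H2` = `HodgeK3Facts.2.1`; classes of type `(i,j)`, `i + j ≠ 2`,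
vanish: `isOfHodgeType_eq_zero_of_add_ne`), and halves cup products (`(u.v) = 2b·pg`, `u = Ψ₀x`,
`v = Ψ₀y`, `(x.y) = c·p ⟹ 2c = 2b`); algebraicity passes to `Ψ := LinearEquiv.ofBijective Ψ₀`
unchanged. Size M. [cite: Varesco2023, §2 and Rem. 2.2] [cite: Huybrechts2016K3, Ch. 6 Prop. 1.2] -/
def OutAnchorOfSimilitude : Prop :=
  Huybrechts_K3_marking_exists →
  ∀ (μ : OrientationFamily), μ.HasPoincareDuality →
    ∀ (S Sg : SchemeOver ℂ) (hS : IsK3Surface S) (hSg : IsK3Surface Sg)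
      (p : complexBetti S (2 * 2)) (pg : complexBetti Sg (2 * 2)), Gen[S, p] → Gen[Sg, pg] →
      ∀ (Ψ₀ : complexBetti S (2 * 1) →ₗ[ℂ] complexBetti Sg (2 * 1)),
        (∀ x, IsRationalClass x → IsRationalClass (Ψ₀ x)) →
        (∀ (i j : ℕ) x, IsOfHodgeType 2 S (2 * 1) i j x → IsOfHodgeType 2 Sg (2 * 1) i j (Ψ₀ x)) →
        (∀ (x y : complexBetti S (2 * 1)) (c : ℂ),
          cupProduct (rfl : 2 * 1 + 2 * 1 = 2 * 2) x y = c • p →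
            cupProduct (rfl : 2 * 1 + 2 * 1 = 2 * 2) (Ψ₀ x) (Ψ₀ y) = ((2 : ℂ) * c) • pg) →
        (∃ γ ∈ algebraicClasses (MonoidalCategoryStruct.tensorObj Sg S) 2,
          ∀ x : complexBetti S (2 * 1), Ψ₀ x = Corr[μ, Sg, S, hSg, hS ; γ, x]) →
        OutAnchor[μ, S, Sg, hS, hSg, p, pg]

/-- STUB 5 — `CupProductAlgebraicInput` (reshaped r2 from `CorrComposition = CompCorr`): **cup products
of algebraic classes on a smooth projective complex variety are algebraic**
(`Nˡ H²ˡ ∪ Nᵏ H²ᵏ ⊆ Nˡ⁺ᵏ H²⁽ˡ⁺ᵏ⁾`, Voisin II Prop. 9.20 / Fulton §19.2 + the moving lemma §11.4) —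
BY NAME the support item `CupProductAlgebraic` of route HodgeConjecture/EndoscopicMiddleDegree
(stmt-HodgeConjecture-14350, "provable-now": the tree has `cupProduct_mem_algebraicClasses_of_coneStep`,
only the cone step of the moving lemma is left, `HodgeTheory/MovingLemmaExcessInduction`).  This ONE
statement is the whole formal debt behind every composition of correspondences the line uses:
(a) r1's `CompCorr` (degree-`2` correspondences between surfaces, Buskin Lemma 6.3) follows from it
by the tree's `corrComp_surfaces_of_cup'` (Gysin base change PROVED) — `compCorr_of_cupProductAlgebraic`
below; (b) the heart's compositions through the fourfolds `S ⊢ S^{[2]} ⊢ X ⊢ Σ` (dimensions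
`2, 4, 4, 2`) follow from it by `corr_comp_of_baseChange` + `gysin_baseChange` +
`corrCompClass_mem_algebraicClasses` in all dimensions.  So the stub closes the day item 14350 closes
(`exact` its `_holds`), and nothing of the moving lemma is restated here.
[cite: VoisinHodgeII2003, §9.2.4 Prop. 9.20] [cite: Fulton1998, §16.1 Prop. 16.1.1 and §19.2]
[cite: Buskin2019, Lemma 6.3] -/
def CupProductAlgebraicInput : Prop :=
  Summit.HodgeConjecture.HodgeConjecture.Theses.EndoscopicMiddleDegree.CupProductAlgebraic

/-- STUB 5′ — `CupProductFacts` (RESHAPE r8 by the continuation lead c3, 2026-08-16): **the ONE named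
Literature fact behind the cup-product input**, Voisin I Thm. 11.32 tensored with `ℂ` (Deligne, Clay §2
(ii)): on a smooth projective complex variety the `ℂ`-span of the Chern characters `ch_p(E)` of the
holomorphic vector bundles equals `Nᵖ H²ᵖ(X(ℂ); ℂ)`, the span of the classes of algebraic cycles — BY
NAME the tree's `span_holomorphicBundleChernCharacter_eq_algebraicClasses`
(`Literature/AlgebraicGeometry/HodgeTheory/HolomorphicBundleChernCharacter`).  The tree PROVES
`CupProductAlgebraic` (item 14350) from it (`cupProductAlgebraic_of_span_chernCharacter`, p83634: cup
product = diagonal pull-back of the unconditionally algebraic exterior product; pull-backs preserve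
Chern-character spans by the naturality of Chern–Weil forms; Hodge models exist,
`nonempty_hodgeModel_holds`), so with this stub `CupProductAlgebraicInput` — and every composition of
correspondences the line uses — is a theorem (`cupProductAlgebraicInput_of_facts`).  It replaces the
r2 stub "item 14350 by name", which that item's seats propose to restate to the divisor case `k = 1`
(this line needs `(l,k) = (2,2)`).  Literature debt, not worker-provable (GAGA + `ch : K(X)_ℚ ≅ A(X)_ℚ`
+ resolution of `𝒪_Z` by vector bundles on the tree's carriers).
[cite: VoisinHodgeI2002, Thm. 11.32] [cite: Deligne2000, §2 Remark (ii)] [cite: Fulton1998, Ex. 15.2.16 and Cor. 19.2] -/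
def CupProductFacts : Prop :=
  span_holomorphicBundleChernCharacter_eq_algebraicClasses

/-- STUB 6 — `OffSectorSources`, THE DECLARED RESIDUAL (NOT claimed by this line; reshaped r1 from
targets to sources): **X verbatim for pairs whose SOURCE `S′` lies OFF the HK-Nikulin sector** (rank
`T(S′) ≥ 15`, i.e. `ρ(S′) ≤ 7` — the very general twin pair included — and the Hasse-obstructed rational
types of rank `13, 14`).  It is the honest name of what this line leaves of X: implied by X itself
(`offSectorSources_of_twinSimilitudeAlgebraic`), by the all-multipliers crux `HodgeSimilitudeAlgebraic`
(13676), and by Buskin + `TwinAnchorGlue` + the transport crux `TwinTwistorTransport` (13675 + 14394 +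
14393: `offSectorSources_of_twinTwistorTransport`), so it closes the day those close; no
finite-symplectic-automorphism anchor on a known hyperkähler deformation type reaches it (co-invariant
rank `≥ 8` forces rank `T ≤ 14`, card (c)).  An open sub-case of the Hodge conjecture for `S × S′`.
[cite: Varesco2023, Thm. 2.1 and Prop. 2.5] [cite: VanGeemenSchuett2023, Rem. 4.9] [cite: Buskin2019, §6.2] -/
def OffSectorSources : Prop :=
  ∀ (μ : OrientationFamily), μ.HasPoincareDuality →
    ∀ (S S' : SchemeOver ℂ) (hS : IsK3Surface S) (hS' : IsK3Surface S')
      (p : complexBetti S (2 * 2)) (p' : complexBetti S' (2 * 2)), Gen[S, p] → Gen[S', p'] →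
      ∀ (ψ : complexBetti S' (2 * 1) →ₗ[ℂ] complexBetti S (2 * 1)),
        (∀ x, IsRationalClass x → IsRationalClass (ψ x)) →
        (∀ (i j : ℕ) x, IsOfHodgeType 2 S' (2 * 1) i j x → IsOfHodgeType 2 S (2 * 1) i j (ψ x)) →
        (∀ (x y : complexBetti S' (2 * 1)) (a : ℂ),
          cupProduct (rfl : 2 * 1 + 2 * 1 = 2 * 2) x y = a • p' →
            cupProduct (rfl : 2 * 1 + 2 * 1 = 2 * 2) (ψ x) (ψ y) = ((2 : ℂ) * a) • p) →
        ¬ InHKNikulinSector S' →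
        ∃ γ ∈ algebraicClasses (MonoidalCategoryStruct.tensorObj S S') 2,
          ∀ x : complexBetti S' (2 * 1), ψ x = Corr[μ, S, S', hS, hS' ; γ, x]

/-- **Sub-stub D — `HKTwinClassAssembly`, THE HEART AFTER r2/r3 (lead): the lattice datum implies
`HKNikulinTwinClass`** (whose own hypotheses carry the facts `HodgeK3Facts` ⊇ F1–F4,
`CupProductAlgebraic` and the two `(1,1)` route items; the LANDED sub-stubs B `stub_corrCalculus`
(p111937) and C `stub_markingPeriodPt` (p111899) are consumed inside its proof as theorems).  r3: the
registered form of the stub is spelled WITHOUT the statement names (so that the landed theorem needs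
no statements file — a parameterless cited `def : Prop` under `Theorems/` is relocated as a fact by
the gate).  Proof plan in the module docstring ("Reshape r2"). [cite: CamereEtAl2026, Thm. 5.12] [cite: Markman2024, Thm. 1.1]
[cite: Beauville1983, §6 Prop. 6] -/
def HKTwinClassAssembly : Prop :=
  HKLatticeWitt → HKNikulinTwinClass

/-! ## Reshape r6 (continuation lead c2, 2026-08-16): TARGET coverage by the transpose of the anchor

The sector theorem (r5) covers the pairs whose SOURCE `S′` is in the sector.  The planner's original
claim concerned TARGETS `S` in the sector; lead 0 moved the hypothesis to sources because an out-anchor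
`Ψ : H²(S) ⥲ H²(Σ)` at the target is only useful through its INVERSE `Ψ⁻¹ = ½Ψᵗ`, whose algebraicity
needs the cup-ADJUNCTION of correspondences on the tree's carriers.  That calculus now exists for
self-correspondences (`Theorems/EndoscopicMiddleDegreeAlgebraicOrEnvelopedStubCorrActionAdjoint`:
`cupProduct_corrAction_eq`, `complexGysin_braiding_mem_algebraicClasses`, `complexGysin_apply_eq_of_top`,
over `complexGysin_cup` / `complexGysin_comp` / `exists_eq_smul_of_top` / `mem_algebraicClasses_map_iff_of_iso`),
and its two-surface form is cut here into three FORMAL stubs and one K3 stub: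

* `TopPushProportional` (T1, topology): on the fourfold `Σ ⊗ S` the two top-degree push-forwards
  `fst₊ , snd₊ : H⁸((Σ ⊗ S)(ℂ)) → H⁴(Σ(ℂ)), H⁴(S(ℂ))` are proportional with a NON-ZERO universal constant
  read in the generators `pΣ, p` (`H⁸` is a line, `exists_eq_smul_of_top`; neither push-forward kills the
  cross product `fst^* pΣ ∪ snd^* p`, `complexGysin_fst_map_snd_ne_zero_of_ne_zero` and its mirror).
* `CorrTranspose` (T2, formal): the transpose `σ₊ γ` (`σ : Σ ⊗ S ≅ S ⊗ Σ` the braiding) of an algebraic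
  class is algebraic and acts as `u ↦ snd₊(fst^* u ∪ γ)` (projection formula for `σ`, `σ ≫ snd′ = fst`,
  `fst′₊ ∘ σ₊ = snd₊`; verbatim the `e1–e3` steps of `cupProduct_corrAction_eq`).
* `InverseAnchorAlgebraic` (T3, K3 linear algebra, granted T1, T2 and markings): if `Ψ = [γ]_* :
  H²(S) ⥲ H²(Σ)` with `γ` algebraic and `Ψ⁻¹` halving the cup form, then `Ψ⁻¹ = [γ′]_*` for an algebraic
  `γ′` on `S ⊗ Σ`: by the projection formula `(Ψx . u)_Σ = fst₊ W`, `(x . snd₊(fst^*u ∪ γ))_S = snd₊ W` for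
  the same top class `W = fst^*u ∪ snd^*x ∪ γ`, so T1 gives `(x . [σ₊γ]_* u) = κ (Ψx . u)`, while halving
  gives `(x . Ψ⁻¹u) = ½ (Ψx . u)`; non-degeneracy of the cup form on `H²(S)` (marking) yields
  `Ψ⁻¹ = (2κ)⁻¹ [σ₊γ]_*`, algebraic (`induced_smul`).
* `AnchorForward` (T4, K3 linear algebra, markings): the forward map `Ψ` of an out-anchor is rational,
  type-preserving and DOUBLES the cup form (its inverse is rational, type-preserving and halves; both
  `H²` are marked `22`-dimensional lattices with Hodge types read on the period line — the mirror image
  of the landed `stub_outAnchorOfSimilitude`).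

TARGET THEOREM (`simAlg_at_of_outAnchor_target`, proved below from T3, T4, Buskin and `CompCorr`): for
`S` in the sector with out-anchor `Ψ : H²(S) ⥲ H²(Σ)` and ANY source `(S′, ψ)`, `½ · Ψ ∘ ψ : H²(S′) → H²(Σ)`
is a rational Hodge ISOMETRY (a `4 = 2²`-similitude divided by `2`), algebraic by Buskin at `(Σ, S′)`;
hence `ψ = Ψ⁻¹ ∘ (Ψ ∘ ψ)` is a composition of algebraic correspondences `S′ ⊢ Σ ⊢ S`.  So X holds
whenever EITHER twin lies in the sector (`twinSimilitudeAlgebraic_onSectorTargets`), and the declared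
residual SHRINKS to `OffSectorPairs` (both `S′` and `S` off the sector).  The sector is not
twin-symmetric — `T(S)_ℚ ≅ T(S′)_ℚ(2)` and `N(2)_ℚ ≅ U³ ⊕ E₈(−1) ⊕ ⟨−1⟩ ≇ N_ℚ` (discriminants `1` vs
`2`) — so the Hasse-obstructed source types of rank `13, 14` whose twin type embeds in `N_ℚ` are newly
covered; rank `T ≥ 15` (both twins off every rank-`15` host) remains the open sub-case of HC.
-/

/-- **T1 — `TopPushProportional` (TOPOLOGY of the fourfold `Σ ⊗ S`).**  For projective K3 surfaces
`S, Σ = Sg` and non-zero `p ∈ H⁴(S(ℂ))`, `pg ∈ H⁴(Σ(ℂ))` there is `κ ≠ 0` with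
`fst₊ W = a · pg ⟹ snd₊ W = κ a · p` for every top class `W ∈ H⁸((Σ ⊗ S)(ℂ); ℂ)`.  Proof: `H⁸` is a line
(`exists_eq_smul_of_top`) spanned by `W₁ = fst^* pg ∪ snd^* p`, and `fst₊ W₁ = ε · pg`, `snd₊ W₁ = ε′ · p`
with `ε, ε′ ≠ 0` (projection formula + `complexGysin_fst_map_snd_ne_zero_of_ne_zero` /
`complexGysin_snd_map_fst_ne_zero`, `exists_eq_smul_one`); `κ := ε′/ε`.
[cite: FultonYoungTableaux1997, Appendix B §B.1 (5)–(7)] [cite: HatcherAT2002, §3.3 Thm. 3.26 and Thm. 3.30] -/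
def TopPushProportional : Prop :=
  ∀ (μ : OrientationFamily), μ.HasPoincareDuality →
    ∀ (S Sg : SchemeOver ℂ) (hS : IsK3Surface S) (hSg : IsK3Surface Sg)
      (p : complexBetti S (2 * 2)) (pg : complexBetti Sg (2 * 2)), p ≠ 0 → pg ≠ 0 →
      ∃ κ : ℂ, κ ≠ 0 ∧
        ∀ (W : complexBetti (MonoidalCategoryStruct.tensorObj Sg S) (2 * (2 + 2))) (a : ℂ),
          complexGysin μ
              (IsSmoothProjective.tensor_holds (IsK3Surface.isSmoothProjective hSg)
                (IsK3Surface.isSmoothProjective hS))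
              (IsK3Surface.isSmoothProjective hSg) (SemiCartesianMonoidalCategory.fst Sg S)
              (rfl : 2 * (2 + 2) + 2 * 2 = 2 * 2 + 2 * (2 + 2)) W = a • pg →
            complexGysin μ
              (IsSmoothProjective.tensor_holds (IsK3Surface.isSmoothProjective hSg)
                (IsK3Surface.isSmoothProjective hS))
              (IsK3Surface.isSmoothProjective hS) (SemiCartesianMonoidalCategory.snd Sg S)
              (rfl : 2 * (2 + 2) + 2 * 2 = 2 * 2 + 2 * (2 + 2)) W = (κ * a) • p

/-- **T2 — `CorrTranspose` (FORMAL: the transpose of an algebraic correspondence).**  For projective K3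
surfaces `S, Σ = Sg` and `γ ∈ N²H⁴((Σ ⊗ S)(ℂ))` there is `γ′ ∈ N²H⁴((S ⊗ Σ)(ℂ))` (namely `σ₊ γ`,
`σ = β_ Σ S` the braiding; `σ₊ γ = t · (σ⁻¹)^* γ` is algebraic, `mem_algebraicClasses_map_iff_of_iso`) whose
action `[γ′]_* u = fst′₊(snd′^* u ∪ γ′)` is `snd₊(fst^* u ∪ γ)`: projection formula for `σ`
(`σ^* snd′^* = fst^*`), then `fst′₊ ∘ σ₊ = (σ ≫ fst′)₊ = snd₊` (`complexGysin_comp`, `braiding_hom_fst/snd`).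
[cite: FultonYoungTableaux1997, Appendix B §B.1 (5)–(6)] [cite: Fulton1998, §16.1] -/
def CorrTranspose : Prop :=
  ∀ (μ : OrientationFamily), μ.HasPoincareDuality →
    ∀ (S Sg : SchemeOver ℂ) (hS : IsK3Surface S) (hSg : IsK3Surface Sg),
      ∀ γ ∈ algebraicClasses (MonoidalCategoryStruct.tensorObj Sg S) 2,
        ∃ γ' ∈ algebraicClasses (MonoidalCategoryStruct.tensorObj S Sg) 2,
          ∀ u : complexBetti Sg (2 * 1),
            Corr[μ, S, Sg, hS, hSg ; γ', u] =
              complexGysin μ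
                (IsSmoothProjective.tensor_holds (IsK3Surface.isSmoothProjective hSg)
                  (IsK3Surface.isSmoothProjective hS))
                (IsK3Surface.isSmoothProjective hS) (SemiCartesianMonoidalCategory.snd Sg S)
                (rfl : 2 * 1 + 2 * 2 + 2 * 2 = 2 * 1 + 2 * (2 + 2))
                (cupProduct (rfl : 2 * 1 + 2 * 2 = 2 * 1 + 2 * 2)
                  (complexBetti.map (SemiCartesianMonoidalCategory.fst Sg S) (2 * 1) u) γ)

/-- **T3 — `InverseAnchorAlgebraic` (K3 LINEAR ALGEBRA, granted T1, T2 and markings): the inverse of an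
algebraic out-anchor is algebraic.**  For projective K3 surfaces `S, Σ = Sg` with integral generators
`p, pg`, a `ℂ`-linear equivalence `Ψ : H²(S) ⥲ H²(Σ)` which is the action of an algebraic class `γ` on
`Σ ⊗ S` and whose inverse HALVES the cup form (`(u.v) = 2b·pg ⟹ (Ψ⁻¹u.Ψ⁻¹v) = b·p`) has an algebraic
inverse: `Ψ⁻¹ = [γ′]_*` with `γ′ ∈ N²H⁴((S ⊗ Σ)(ℂ))`.  Proof: with `Φ u := snd₊(fst^* u ∪ γ)` (`= [σ₊γ]_* u`,
T2) and `W := fst^* u ∪ snd^* x ∪ γ`, the projection formula gives `Ψx ∪ u = fst₊ W` and `x ∪ Φu = snd₊ W`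
(graded commutativity in even degrees), so `x ∪ Φu = κ(…)` by T1 while `x ∪ Ψ⁻¹u = ½(…)` by halving
(every `u ∪ v` on `Σ` is a multiple of `pg` through a marking); the cup form on `H²(S)` is non-degenerate
(marking, `k3FormC_nondegenerate`), whence `Ψ⁻¹ = (2κ)⁻¹ Φ`, algebraic by `induced_smul`.
[cite: Varesco2023, §2 (transpose of a similitude)] [cite: FultonYoungTableaux1997, Appendix B §B.1 (5)–(6)]
[cite: Huybrechts2016K3, Ch. 1 Prop. 3.5] -/
def InverseAnchorAlgebraic : Prop :=
  TopPushProportional → CorrTranspose → Huybrechts_K3_marking_exists →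
  ∀ (μ : OrientationFamily), μ.HasPoincareDuality →
    ∀ (S Sg : SchemeOver ℂ) (hS : IsK3Surface S) (hSg : IsK3Surface Sg)
      (p : complexBetti S (2 * 2)) (pg : complexBetti Sg (2 * 2)), Gen[S, p] → Gen[Sg, pg] →
      ∀ (Ψ : complexBetti S (2 * 1) ≃ₗ[ℂ] complexBetti Sg (2 * 1)),
        (∀ (u v : complexBetti Sg (2 * 1)) (b : ℂ),
          cupProduct (rfl : 2 * 1 + 2 * 1 = 2 * 2) u v = ((2 : ℂ) * b) • pg →
            cupProduct (rfl : 2 * 1 + 2 * 1 = 2 * 2) (Ψ.symm u) (Ψ.symm v) = b • p) →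
        (∃ γ ∈ algebraicClasses (MonoidalCategoryStruct.tensorObj Sg S) 2,
          ∀ x : complexBetti S (2 * 1), Ψ x = Corr[μ, Sg, S, hSg, hS ; γ, x]) →
        ∃ γ' ∈ algebraicClasses (MonoidalCategoryStruct.tensorObj S Sg) 2,
          ∀ u : complexBetti Sg (2 * 1), Ψ.symm u = Corr[μ, S, Sg, hS, hSg ; γ', u]

/-- **T4 — `AnchorForward` (K3 LINEAR ALGEBRA, markings): the forward map of an out-anchor is a rational,
type-preserving `2`-similitude.**  For projective K3 surfaces `S, Σ = Sg` with integral generators `p, pg`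
and a `ℂ`-linear equivalence `Ψ : H²(S) ⥲ H²(Σ)` whose INVERSE is rational, type-preserving and halves
the cup form, `Ψ` itself is rational (through markings `Ψ⁻¹` is the complexification of an injective,
hence bijective, `ℚ`-linear map `ℚ²² → ℚ²²`), type-preserving (`Ψ⁻¹` carries the period lines
`H^{2,0}, H^{0,2}` of `Σ` onto those of `S` by non-zero scalars and `H^{1,1} = ⟨σ, σ̄⟩^⊥`; classes of
type `(i, j)`, `i + j ≠ 2`, vanish) and doubles (`(x.y) = c·p`, `(Ψx.Ψy) = 2b·pg` for some `b` through the
marking of `Σ`, and halving gives `b = c`).  Mirror image of the landed `stub_outAnchorOfSimilitude`.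
[cite: Huybrechts2016K3, Ch. 1 Prop. 3.5 and Ch. 6 Prop. 1.2] [cite: Buskin2019, §6.2] -/
def AnchorForward : Prop :=
  Huybrechts_K3_marking_exists →
    ∀ (S Sg : SchemeOver ℂ) (hS : IsK3Surface S) (hSg : IsK3Surface Sg)
      (p : complexBetti S (2 * 2)) (pg : complexBetti Sg (2 * 2)), Gen[S, p] → Gen[Sg, pg] →
      ∀ (Ψ : complexBetti S (2 * 1) ≃ₗ[ℂ] complexBetti Sg (2 * 1)),
        (∀ y, IsRationalClass y → IsRationalClass (Ψ.symm y)) →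
        (∀ (i j : ℕ) y, IsOfHodgeType 2 Sg (2 * 1) i j y →
          IsOfHodgeType 2 S (2 * 1) i j (Ψ.symm y)) →
        (∀ (u v : complexBetti Sg (2 * 1)) (b : ℂ),
          cupProduct (rfl : 2 * 1 + 2 * 1 = 2 * 2) u v = ((2 : ℂ) * b) • pg →
            cupProduct (rfl : 2 * 1 + 2 * 1 = 2 * 2) (Ψ.symm u) (Ψ.symm v) = b • p) →
        (∀ x, IsRationalClass x → IsRationalClass (Ψ x)) ∧
        (∀ (i j : ℕ) x, IsOfHodgeType 2 S (2 * 1) i j x →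
          IsOfHodgeType 2 Sg (2 * 1) i j (Ψ x)) ∧
        (∀ (x y : complexBetti S (2 * 1)) (c : ℂ),
          cupProduct (rfl : 2 * 1 + 2 * 1 = 2 * 2) x y = c • p →
            cupProduct (rfl : 2 * 1 + 2 * 1 = 2 * 2) (Ψ x) (Ψ y) = ((2 : ℂ) * c) • pg)

/-- **`OffSectorPairs`, THE DECLARED RESIDUAL AFTER r6 (NOT claimed by this line): X verbatim for pairs
with BOTH twins off the HK-Nikulin sector** (`¬ InHKNikulinSector S′ ∧ ¬ InHKNikulinSector S`; contains
every pair with rank `T ≥ 15`, i.e. `ρ ≤ 7`).  Implied by X (`offSectorPairs_of_twinSimilitudeAlgebraic`),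
by `HodgeSimilitudeAlgebraic` (13676) and by 13675 + 14394 + 14393; an open sub-case of the Hodge
conjecture for `S × S′` — no symplectic-automorphism anchor on a known hyperkähler deformation type
reaches rank `T ≥ 15` (co-invariant rank `≥ 8`). [cite: Varesco2023, Thm. 2.1 and Prop. 2.5]
[cite: VanGeemenSchuett2023, Rem. 4.9] [cite: Buskin2019, §6.2] -/
def OffSectorPairs : Prop :=
  ∀ (μ : OrientationFamily), μ.HasPoincareDuality →
    ∀ (S S' : SchemeOver ℂ) (hS : IsK3Surface S) (hS' : IsK3Surface S')
      (p : complexBetti S (2 * 2)) (p' : complexBetti S' (2 * 2)), Gen[S, p] → Gen[S', p'] →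
      ∀ (ψ : complexBetti S' (2 * 1) →ₗ[ℂ] complexBetti S (2 * 1)),
        (∀ x, IsRationalClass x → IsRationalClass (ψ x)) →
        (∀ (i j : ℕ) x, IsOfHodgeType 2 S' (2 * 1) i j x → IsOfHodgeType 2 S (2 * 1) i j (ψ x)) →
        (∀ (x y : complexBetti S' (2 * 1)) (a : ℂ),
          cupProduct (rfl : 2 * 1 + 2 * 1 = 2 * 2) x y = a • p' →
            cupProduct (rfl : 2 * 1 + 2 * 1 = 2 * 2) (ψ x) (ψ y) = ((2 : ℂ) * a) • p) →
        ¬ InHKNikulinSector S' → ¬ InHKNikulinSector S →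
        ∃ γ ∈ algebraicClasses (MonoidalCategoryStruct.tensorObj S S') 2,
          ∀ x : complexBetti S' (2 * 1), ψ x = Corr[μ, S, S', hS, hS' ; γ, x]

/-! ## Reshape r9 (continuation lead c5, 2026-08-16): CM-norm-2 twins are their own anchors

A projective K3 surface whose `H²` carries a rational `2`-self-similitude `e` acting on `H^{2,0}` by a non-real
scalar (`CMNorm2[S, p]`) is CM (Zarhin: `End_Hdg(T_ℚ)` is totally real or CM; a non-real eigenvalue on
`H^{2,0}` forces CM) and `e` is ALGEBRAIC by Buskin's CM corollary (`HC(S × S)` for CM K3 surfaces; in the tree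
the landed anchor theorem `CmNormAnchors.stub_cmSelfSimilitude_algebraic` reads `e` through a marking as a
rational `2`-similitude `J` of `Λ_ℂ` with the period as eigenvector and produces `γ_e ∈ N²H⁴(S × S)` with
`[γ_e]_* = e`).  Its inverse `e⁻¹ = ½ eᵗ`-like map is rational, type-preserving and HALVES the form (the landed
`stub_anchorForward` applied to the equivalence with inverse `½e`), so `OutAnchor[μ, S, S, hS, hS, p, p]` holds
and the landed glue theorems give X at the pair: `simAlg_at_of_outAnchor` when the SOURCE is CM-norm-2
(`ψ ∘ e⁻¹` is a rational Hodge isometry — Buskin — then compose with `e`), `simAlg_at_of_outAnchor_target` when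
the TARGET is (`½ e ∘ ψ` is a rational Hodge isometry; `e⁻¹` algebraic by the transpose calculus T1–T3).  No
sector hypothesis: the mechanism works at every rank of `T` (CM-norm-2 surfaces exist at every even rank
`≤ 20`, e.g. `E = ℚ(ζ₄₄) ∋ i`, `(1+i)(1-i) = 2`, rank `T = 20`).  On a twin pair the two conditions coincide
(`ψ` transports `End_Hdg(T)`), but the residual negates both. -/

/-- `CMNorm2[S, p]`: **`S` is CM-norm-2** — `H²(S(ℂ); ℂ)` carries a rational `2`-self-similitude `e`
(`(x.y) = a·p ⟹ (ex.ey) = 2a·p`) acting on a non-zero `(2,0)`-class by a non-real scalar (⇔ `End_Hdg(T(S)_ℚ)`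
is a CM field containing an element of relative norm `2`; a `2`-similitude of `T_ℚ` extends to `H²_ℚ` by Witt
cancellation, `Λ_ℚ(2) ≅ Λ_ℚ`).  Local notation only, verbatim that of
`Theorems/NikulinTwinTransportTwinSimilitudeAlgebraicCMNormTwins.lean`.
[cite: Huybrechts2016K3, Ch. 3 Thm. 3.7 and Rem. 3.10] [cite: Zarhin1983HodgeGroupsK3, Thm. 1.5.1] -/
local notation3 (prettyPrint := false) "CMNorm2[" S ", " p "]" =>
  ∃ e : complexBetti S (2 * 1) →ₗ[ℂ] complexBetti S (2 * 1),
    (∀ x, IsRationalClass x → IsRationalClass (e x)) ∧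
    (∀ (x y : complexBetti S (2 * 1)) (a : ℂ),
      cupProduct (rfl : 2 * 1 + 2 * 1 = 2 * 2) x y = a • p →
        cupProduct (rfl : 2 * 1 + 2 * 1 = 2 * 2) (e x) (e y) = ((2 : ℂ) * a) • p) ∧
    ∃ (σ : complexBetti S (2 * 1)) (t : ℂ), IsOfHodgeType 2 S (2 * 1) 2 0 σ ∧ σ ≠ 0 ∧ t.im ≠ 0 ∧ e σ = t • σ

/- STUB 7 (r9) — `CMSquareFact` (Buskin's CM corollary `Buskin2019_hodgeConjectureFor_square_of_CM` BY NAME):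
RETIRED at reshape r11 (lead c6) — its one use, the algebraicity of the CM-norm-2 self-similitude, is now the
registered stub `CMSelfSimilitudeFromIsometries` (from Buskin's THEOREM 13675), see "Reshape r11" below. -/

/-- STUB 8 (r9) — `CMNormTwins`: **X at every pair of projective K3 surfaces with a CM-norm-2 SOURCE OR TARGET**,
granted K3 markings, Buskin's CM corollary, `CupProductAlgebraic` (composition of correspondences, item 14350)
and Buskin's theorem (`HodgeIsometryAlgebraic`, 13675).  PROVED by the lead
(`Theorems/NikulinTwinTransportTwinSimilitudeAlgebraicCMNormTwins.cmNormTwins_anchor`: the CM-norm-2 twin is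
its own out-anchor, `outAnchor_self_of_cmNorm`, then `simAlg_at_of_outAnchor(_target)`).  No sector hypothesis.
[cite: Buskin2019, Thm. 1.1 and Corollary] [cite: Huybrechts2019, Cor. 0.4 (ii)] [cite: Varesco2023, §0.1] -/
def CMNormTwins : Prop :=
  Huybrechts_K3_marking_exists → Buskin2019_hodgeConjectureFor_square_of_CM →
    Summit.HodgeConjecture.HodgeConjecture.Theses.EndoscopicMiddleDegree.CupProductAlgebraic →
    HodgeIsometryAlgebraic →
    ∀ (μ : OrientationFamily), μ.HasPoincareDuality →
      ∀ (S S' : SchemeOver ℂ) (hS : IsK3Surface S) (hS' : IsK3Surface S')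
        (p : complexBetti S (2 * 2)) (p' : complexBetti S' (2 * 2)), Gen[S, p] → Gen[S', p'] →
        (CMNorm2[S', p'] ∨ CMNorm2[S, p]) →
        ∀ (ψ : complexBetti S' (2 * 1) →ₗ[ℂ] complexBetti S (2 * 1)),
          (∀ x, IsRationalClass x → IsRationalClass (ψ x)) →
          (∀ (i j : ℕ) x, IsOfHodgeType 2 S' (2 * 1) i j x → IsOfHodgeType 2 S (2 * 1) i j (ψ x)) →
          (∀ (x y : complexBetti S' (2 * 1)) (a : ℂ),
            cupProduct (rfl : 2 * 1 + 2 * 1 = 2 * 2) x y = a • p' →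
              cupProduct (rfl : 2 * 1 + 2 * 1 = 2 * 2) (ψ x) (ψ y) = ((2 : ℂ) * a) • p) →
          ∃ γ ∈ algebraicClasses (MonoidalCategoryStruct.tensorObj S S') 2,
            ∀ x : complexBetti S' (2 * 1), ψ x = Corr[μ, S, S', hS, hS' ; γ, x]

/-- STUB 9 (r9) — `OffSectorNonCMPairs`, **THE DECLARED RESIDUAL AFTER r9 (NOT claimed by this line): X verbatim
for pairs with BOTH twins off the HK-Nikulin sector AND NEITHER twin CM-norm-2** — `End_Hdg(T)` totally real,
or CM without an element of relative norm `2`, at rank `T ≥ 15` (`ρ ≤ 7`) or a doubly Hasse-obstructed type of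
rank 13/14: the locus where no published mechanism applies.  Implied by X
(`offSectorNonCMPairs_of_twinSimilitudeAlgebraic`), by `HodgeSimilitudeAlgebraic` (13676) and by
13675 + 14394 + 14393; an open sub-case of the Hodge conjecture for `S × S′`.
[cite: Varesco2023, §0.1, Thm. 2.1 and Prop. 2.5] [cite: VanGeemenSchuett2023, Thm. 3.10 and Rem. 4.9] -/
def OffSectorNonCMPairs : Prop :=
  ∀ (μ : OrientationFamily), μ.HasPoincareDuality →
    ∀ (S S' : SchemeOver ℂ) (hS : IsK3Surface S) (hS' : IsK3Surface S')
      (p : complexBetti S (2 * 2)) (p' : complexBetti S' (2 * 2)), Gen[S, p] → Gen[S', p'] →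
      ∀ (ψ : complexBetti S' (2 * 1) →ₗ[ℂ] complexBetti S (2 * 1)),
        (∀ x, IsRationalClass x → IsRationalClass (ψ x)) →
        (∀ (i j : ℕ) x, IsOfHodgeType 2 S' (2 * 1) i j x → IsOfHodgeType 2 S (2 * 1) i j (ψ x)) →
        (∀ (x y : complexBetti S' (2 * 1)) (a : ℂ),
          cupProduct (rfl : 2 * 1 + 2 * 1 = 2 * 2) x y = a • p' →
            cupProduct (rfl : 2 * 1 + 2 * 1 = 2 * 2) (ψ x) (ψ y) = ((2 : ℂ) * a) • p) →
        ¬ InHKNikulinSector S' → ¬ InHKNikulinSector S → ¬ CMNorm2[S', p'] → ¬ CMNorm2[S, p] →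
        ∃ γ ∈ algebraicClasses (MonoidalCategoryStruct.tensorObj S S') 2,
          ∀ x : complexBetti S' (2 * 1), ψ x = Corr[μ, S, S', hS, hS' ; γ, x]

/-! ## Reshape r11 (continuation lead c6, 2026-08-16): Buskin's CM corollary discharged from his THEOREM

The r9 stub `stub_cmSquareFact` (the named fact `Buskin2019_hodgeConjectureFor_square_of_CM`, HC for `S × S`
of a CM K3 surface) is consumed by the line at ONE place: the algebraicity of the CM-norm-2 self-similitude `e`
in `outAnchor_self_of_cmNorm`.  That algebraicity follows from Buskin's THEOREM (route item 13675,
`HodgeIsometryAlgebraic`, already a hypothesis of `_of`), Lefschetz `(1,1)` (13678, closed) and the landed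
`stub_divisorCorrections` by a CAYLEY-TRANSFORM DECOMPOSITION.  Write `ē := 2e⁻¹` (the cup-adjoint of `e`:
`(ex.y) = (x.ēy)`), `u₀ := ½e²`, `u_a := (e + a)(ē + a)⁻¹` (`a ∈ ℚ` off the finite spectrum of `−ē`).  Then
`u₀`, `u_a` are RATIONAL HODGE ISOMETRIES of `H²(S)` (polynomials in `e`, so they fix the period line) and
`a·e·(u_a − 1) = 2(u₀ − u_a)`; `u_a − 1 = e⁻¹(e² − 2)(ē + a)⁻¹` is injective on `T_ℚ = NS_ℚ^⊥`, because a
rational `v ⊥ NS` with `e²v = 2v` pairs to zero with the period (`(e²v.x₀) = 2(v.x₀) = (4/t²)(v.x₀)`, `t² ≠ 2`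
for the non-real eigenvalue `t` on `H^{2,0}`) and with its conjugate, hence is a rational `(1,1)`-class, i.e.
`v ∈ NS ∩ T = 0` (Lefschetz + Hodge index).  By the minimal polynomial of `u_a − 1` (its `X`-primary part
lives on `NS_ℚ`) `e|_T = P(u₀, u_a)|_T` for a ℚ-polynomial `P`; so `e = Σᵢ cᵢ uᵢ + D` with `uᵢ` monomials in
`u₀, u_a` (rational Hodge isometries of `H²(S)`, ALGEBRAIC by 13675 at the pair `(S, S)`) and `D := e − Σ cᵢuᵢ`
killing `T` with values in `NS` — a finite sum of rank-one divisor correspondences `x ↦ (x.aₗ) bₗ`,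
`aₗ, bₗ ∈ NS(S)`, ALGEBRAIC by `stub_divisorCorrections`; sums and scalar multiples of algebraic
correspondences are algebraic (`induced_add/_smul/_sum`, landed).  No Zarhin, no irreducibility of `T`, no CM
corollary.  Four registered stubs replace `stub_cmSquareFact`:

* `CMCayleyDecomposition` (STUB 10, PURE LINEAR ALGEBRA over `ℚ`, worker): the decomposition
  `J = Σᵢ cᵢ qᵢ(J) + Σₗ B(·, aₗ) bₗ` for a `2`-similitude `J` of a non-degenerate symmetric `ℚ`-space with a
  `J`-stable non-degenerate subspace `N` (`aₗ, bₗ ∈ N`) such that `J² − 2` is injective on `N^⊥`, every `qᵢ(J)`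
  a `B`-isometry.
* `CMPolyComplexify` (STUB 11, worker): a polynomial in a `ℚ`-rational endomorphism of `Λ_ℂ` is the
  complexification of the polynomial in its `ℚ`-form, and isometry passes from `Λ_ℚ` to `Λ_ℂ`.
* `CMRationalForm` (STUB 12, worker): the `ℚ`-form of a CM-norm-2 structure under a marking — `e` descends to
  a `2`-similitude `Jq` of `(Λ_ℚ, k3FormRat)` preserving the rational Néron–Severi points `N_ℚ` (non-degenerate,
  Hodge index) with `Jq² − 2` injective on `N_ℚ^⊥`.
* `CMSelfSimilitudeFromIsometries` (STUB 13, THE ASSEMBLY, lead): granted stubs 10–12, K3 markings, Buskin's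
  theorem `HodgeIsometryAlgebraic`, the two `(1,1)` items, Hodge index and `DivisorCorrections`, a CM-norm-2
  self-similitude `e` is `[γ]_*` for an algebraic `γ` on `S × S`.

With stub 13 the CM-norm theorems of r9/r10 are re-derived WITHOUT the corollary (`outAnchor_self_of_cmNorm'`,
`twinSimilitudeAlgebraic_at_of_cmNorm_either'`, `offSectorPairs_of_cmNorm'` below), `_of` no longer takes
`stub_cmSquareFact`, and the named fact `Buskin2019_hodgeConjectureFor_square_of_CM` leaves the cone of X. -/

/-- `PeriodPt[x]`: `(x.x) = 0`, `(x̄.x) > 0`, a positive lattice vector in `x^⊥` (the period clauses of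
`Huybrechts_K3_marking_exists`). Local notation only, verbatim from the route's Theorems files. -/
local notation3 (prettyPrint := false) "PeriodPt[" x "]" =>
  (k3Form x x = 0 ∧ 0 < (k3Form (star x) x).re ∧
    ∃ u : K3Index → ℤ, k3Form (fun i => (u i : ℂ)) x = 0 ∧ 0 < ∑ i, ∑ j, u i * k3Gram i j * u j)

/-- STUB 10 (r11) — `CMCayleyDecomposition` (PURE LINEAR ALGEBRA over `ℚ`; TRUE as stated).  Let `(V, B)` be a
finite-dimensional non-degenerate symmetric `ℚ`-space, `J` a `2`-similitude of it (`B(Jx, Jy) = 2B(x, y)`, a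
linear equivalence), `N ≤ V` a `J`-stable subspace on which `B` is non-degenerate, and suppose `J² − 2` is
injective on `T := N^⊥`.  Then `J = Σᵢ cᵢ qᵢ(J) + Σₗ B(·, aₗ) bₗ` for rationals `cᵢ`, polynomials `qᵢ ∈ ℚ[X]`
such that every `qᵢ(J)` is a `B`-ISOMETRY, and vectors `aₗ, bₗ ∈ N`.  Proof (Cayley transform): `V = N ⊕ T`
(`isCompl_orthogonal_of_restrict_nondegenerate`), `T` is `J`-stable (`J(N) = N`); `J⁻¹`, hence `J̄ := 2J⁻¹`
(the `B`-adjoint of `J`), is a polynomial in `J` (minimal polynomial with non-zero constant term); pick `a ∈ ℚ`,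
`a ≠ 0`, with `J̄ + a` invertible (finitely many eigenvalues, `Module.End.finite_hasEigenvalue`), again with a
polynomial inverse; `u₀ := ½J²` and `u_a := (J + a)(J̄ + a)⁻¹` are isometries and `a·J·(u_a − 1) = 2(u₀ − u_a)`;
`g := u_a − 1 = J⁻¹(J² − 2)(J̄ + a)⁻¹` is injective on `T`, so if `μ = X^k·h`, `h(0) ≠ 0`, is the minimal
polynomial of `g` then `h(g)` kills `T` (`g^k` is injective on the `g`-stable `T`), whence
`g⁻¹|_T = −h(0)⁻¹·(h.divX)(g)|_T` and `J|_T = (2/a)(u₀ − u_a)·(−h(0)⁻¹)(h.divX)(g)|_T =: P(J)|_T` with `P(J)` a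
ℚ-combination of the isometries `u₀u_aʲ`, `u_aʲ⁺¹`; finally `D := J − P(J)` kills `T` and maps `V` into `N`
(both summands preserve `N`), so `D = Σₗ B(·, aₗ) bₗ` with `aₗ, bₗ ∈ N` (`exists_eq_sum_rankOne₂`).
[cite: Huybrechts2019, §1 and Rem. 3.3] [cite: Buskin2019, Corollary (Introduction)] -/
def CMCayleyDecomposition : Prop :=
  ∀ (V : Type) [AddCommGroup V] [Module ℚ V] [FiniteDimensional ℚ V]
    (B : LinearMap.BilinForm ℚ V), B.IsSymm → B.Nondegenerate →
    ∀ (J : V ≃ₗ[ℚ] V), (∀ x y, B (J x) (J y) = 2 * B x y) →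
    ∀ (N : Submodule ℚ V), (B.restrict N).Nondegenerate → (∀ u ∈ N, J u ∈ N) →
    (∀ w ∈ B.orthogonal N, J (J w) = (2 : ℚ) • w → w = 0) →
    ∃ (m : ℕ) (c : Fin m → ℚ) (q : Fin m → Polynomial ℚ) (k : ℕ) (a b : Fin k → V),
      (∀ i x y, B (Polynomial.aeval J.toLinearMap (q i) x) (Polynomial.aeval J.toLinearMap (q i) y) = B x y) ∧
      (∀ l, a l ∈ N) ∧ (∀ l, b l ∈ N) ∧
      ∀ x, J x = ∑ i, c i • Polynomial.aeval J.toLinearMap (q i) x + ∑ l, B x (a l) • b l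

/-- STUB 11 (r11) — `CMPolyComplexify` (FORMAL; TRUE as stated).  If the endomorphism `J` of `Λ_ℂ` is the
complexification of the endomorphism `Jq` of `Λ_ℚ` (`J ∘ ι = ι ∘ Jq`, `ι : Λ_ℚ ⊂ Λ_ℂ`), then for every
`q ∈ ℚ[X]` the endomorphism `q(J)` (the polynomial mapped to `ℂ[X]`) is the complexification of `q(Jq)`
(induction on `q` / `Polynomial.aeval_algHom_apply`), and if `q(Jq)` is an isometry of `(Λ_ℚ, k3FormRat)` then
`q(J)` is an isometry of `(Λ_ℂ, k3Form)` (both sides are `ℂ`-bilinear and agree on the rational basis vectors,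
`k3Form_ratCast`). [folklore] -/
def CMPolyComplexify : Prop :=
  ∀ (J : Module.End ℂ (K3Index → ℂ)) (Jq : Module.End ℚ (K3Index → ℚ)),
    (∀ u : K3Index → ℚ, J (fun i => (u i : ℂ)) = fun i => (Jq u i : ℂ)) →
    ∀ q : Polynomial ℚ,
      (∀ u : K3Index → ℚ,
        Polynomial.aeval J (q.map (algebraMap ℚ ℂ)) (fun i => (u i : ℂ)) =
          fun i => (Polynomial.aeval Jq q u i : ℂ)) ∧
      ((∀ v w, k3FormRat (Polynomial.aeval Jq q v) (Polynomial.aeval Jq q w) = k3FormRat v w) →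
        ∀ a b, k3Form (Polynomial.aeval J (q.map (algebraMap ℚ ℂ)) a)
          (Polynomial.aeval J (q.map (algebraMap ℚ ℂ)) b) = k3Form a b)

/-- STUB 12 (r11) — `CMRationalForm` (K3 LINEAR ALGEBRA; TRUE as stated, provable now).  For a projective K3
surface `S` with generator `p` of `H⁴`, a rational `2`-self-similitude `e` of `H²(S)` (`(x.y) = a·p ⟹
(ex.ey) = 2a·p`) with `e σ = t σ` on a non-zero `(2,0)`-class, `t ∉ ℝ`, and a marking `(η, p₀, x₀)`: the
conjugate `η e η⁻¹` descends to a linear EQUIVALENCE `Jq` of `Λ_ℚ` (`exists_ratEnd_of_forall_intCast`,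
`markingConj_intCast`; injective as a similitude of the non-degenerate K3 form) multiplying `k3FormRat` by `2`
(`cmNorm_markingConj`, `k3Form_ratCast`); the rational Néron–Severi points `N_ℚ` (`exists_nsRat`: `u ∈ N_ℚ ⟺
η⁻¹u ∈ algebraicClasses S 1`; non-degenerate by Hodge index) are `Jq`-stable (`e` is type-preserving,
`cmNorm_typePreserving`, so it maps `NS` into `NS`: `map_mem_algebraicClasses_of_hodgeMap`, Lefschetz `(1,1)` +
`AlgebraicClassesOneOneK3`); and `Jq² − 2` is injective on `N_ℚ^⊥`: for `w ⊥ N_ℚ` rational with `Jq²w = 2w`,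
`(J²w.x₀) = 2(w.x₀) = (4/t²)(w.x₀)` and `t² ≠ 2` give `(w.x₀) = 0`, likewise `(w.x̄₀) = 0` (`J`, `w` real:
`ratEnd_star`), so `η⁻¹w` is a rational `(1,1)`-class (`Huybrechts_K3_hodgeTypes_H2_holds`), algebraic by
Lefschetz, i.e. `w ∈ N_ℚ ∩ N_ℚ^⊥ = 0`. [cite: Huybrechts2016K3, Ch. 3 Lemma 3.1 and §3.2] [cite: Buskin2019, §6.2] -/
def CMRationalForm : Prop :=
  Huybrechts_K3_marking_exists → LefschetzOneOneK3 → AlgebraicClassesOneOneK3 →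
  (∀ (S : SchemeOver ℂ), IsK3Surface S → hodgeIndex_surface S) →
    ∀ (S : SchemeOver ℂ) (hS : IsK3Surface S) (p : complexBetti S (2 * 2)), Gen[S, p] →
    ∀ (e : complexBetti S (2 * 1) →ₗ[ℂ] complexBetti S (2 * 1)),
      (∀ x, IsRationalClass x → IsRationalClass (e x)) →
      (∀ (x y : complexBetti S (2 * 1)) (a : ℂ),
        cupProduct (rfl : 2 * 1 + 2 * 1 = 2 * 2) x y = a • p →
          cupProduct (rfl : 2 * 1 + 2 * 1 = 2 * 2) (e x) (e y) = ((2 : ℂ) * a) • p) →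
      ∀ (σ : complexBetti S (2 * 1)) (t : ℂ), IsOfHodgeType 2 S (2 * 1) 2 0 σ → σ ≠ 0 → t.im ≠ 0 →
        e σ = t • σ →
      ∀ (η : complexBetti S (2 * 1) ≃ₗ[ℂ] (K3Index → ℂ)) (p₀ : complexBetti S (2 * 2)) (x₀ : K3Index → ℂ),
        MarkedK3[S, η, p₀, x₀] →
        ∃ (Jq : (K3Index → ℚ) ≃ₗ[ℚ] (K3Index → ℚ)) (NQ : Submodule ℚ (K3Index → ℚ)),
          (∀ u : K3Index → ℚ, η (e (η.symm fun i => (u i : ℂ))) = fun i => (Jq u i : ℂ)) ∧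
          (∀ v w, k3FormRat (Jq v) (Jq w) = 2 * k3FormRat v w) ∧
          (∀ u, u ∈ NQ ↔ η.symm (fun j => (u j : ℂ)) ∈ algebraicClasses S 1) ∧
          (k3FormRat.restrict NQ).Nondegenerate ∧
          (∀ u ∈ NQ, Jq u ∈ NQ) ∧
          (∀ w ∈ k3FormRat.orthogonal NQ, Jq (Jq w) = (2 : ℚ) • w → w = 0)

/-- STUB 13 (r11) — `CMSelfSimilitudeFromIsometries`, THE ASSEMBLY (lead): **a CM-norm-2 self-similitude is
algebraic, from Buskin's THEOREM.**  Granted stubs 10–12, K3 markings, `HodgeIsometryAlgebraic` (13675), the two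
`(1,1)` items, the Hodge index theorem for K3 surfaces and `DivisorCorrections` (landed): for a projective K3
surface `S`, a generator `p` of `H⁴` and a rational `2`-self-similitude `e` of `H²(S)` with a non-real eigenvalue
on a non-zero `(2,0)`-class, `e = [γ]_*` for an algebraic `γ` on `S × S`.  Proof: mark `S`; stub 12 gives the
`ℚ`-form `(Jq, N_ℚ)`; stub 10 gives `Jq = Σᵢ cᵢ qᵢ(Jq) + Σₗ B(·, aₗ) bₗ`; stub 11 complexifies each `qᵢ` to an
isometry `Uᵢ = qᵢ(J)` of `Λ_ℂ` defined over `ℚ` and fixing the period line (`aeval_apply_of_hasEigenvector`), so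
`η⁻¹Uᵢη` is a rational Hodge ISOMETRY of `H²(S)` (`isRationalClass_markingConj`, `isOfHodgeType_markingConj`,
the marking's cup formula), ALGEBRAIC by 13675; each `x ↦ (ηx.aₗ) η⁻¹bₗ` is a rank-one divisor correspondence
(`η⁻¹aₗ, η⁻¹bₗ ∈ NS(S)`), ALGEBRAIC by `DivisorCorrections`; the identity `J = Σ cᵢUᵢ + Σₗ (·.aₗ)bₗ` holds on
the rational basis vectors hence on `Λ_ℂ`, and conjugating by `η` gives `e`; conclude with
`induced_smul/_add/_sum`. [cite: Buskin2019, Thm. 1.1 and Corollary (Introduction)] [cite: Huybrechts2019, Cor. 0.4 (ii) and Rem. 3.3] -/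
def CMSelfSimilitudeFromIsometries : Prop :=
  CMCayleyDecomposition → CMPolyComplexify → CMRationalForm →
  Huybrechts_K3_marking_exists → HodgeIsometryAlgebraic → LefschetzOneOneK3 → AlgebraicClassesOneOneK3 →
  (∀ (S : SchemeOver ℂ), IsK3Surface S → hodgeIndex_surface S) → DivisorCorrections →
  ∀ (μ : OrientationFamily), μ.HasPoincareDuality →
    ∀ (S : SchemeOver ℂ) (hS : IsK3Surface S) (p : complexBetti S (2 * 2)), Gen[S, p] →
    ∀ (e : complexBetti S (2 * 1) →ₗ[ℂ] complexBetti S (2 * 1)),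
      (∀ x, IsRationalClass x → IsRationalClass (e x)) →
      (∀ (x y : complexBetti S (2 * 1)) (a : ℂ),
        cupProduct (rfl : 2 * 1 + 2 * 1 = 2 * 2) x y = a • p →
          cupProduct (rfl : 2 * 1 + 2 * 1 = 2 * 2) (e x) (e y) = ((2 : ℂ) * a) • p) →
      ∀ (σ : complexBetti S (2 * 1)) (t : ℂ), IsOfHodgeType 2 S (2 * 1) 2 0 σ → σ ≠ 0 → t.im ≠ 0 →
        e σ = t • σ →
      ∃ γ ∈ algebraicClasses (MonoidalCategoryStruct.tensorObj S S) 2,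
        ∀ x : complexBetti S (2 * 1), e x = Corr[μ, S, S, hS, hS ; γ, x]

/-! ## Registered stubs (`sorry` lives ONLY here; statements = the `def`s above, inlined verbatim) -/

/-- Stub 0 (registered, reshaped r2): see `HodgeK3Facts`. -/
theorem stub_hodgeK3Facts :
    Huybrechts_K3_marking_exists ∧
      CamereEtAl2026_symplecticInvolution_periodSurjective ∧ CamereEtAl2023_fixedK3_restriction ∧
      Markman2024_rationalHodgeIsometry_algebraic_marked ∧ Beauville1983_hilbertSquare_markedIncidence := by
  sorry

/-- Sub-stub A (registered r2; LANDED p114596): see `HKLatticeWitt`. -/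
theorem stub_hkLatticeWitt :
    ∀ (x : K3Index → ℂ), k3Form x x = 0 → 0 < (k3Form (star x) x).re →
      (∃ u : K3Index → ℤ, k3Form (fun i => (u i : ℂ)) x = 0 ∧ 0 < ∑ i, ∑ j, u i * k3Gram i j * u j) →
      ∀ J : (K3Index → ℚ) →ₗ[ℚ] (HostIndex → ℚ),
        (∀ v ∈ trRat x, ∀ w ∈ trRat x, hostFormRat (J v) (J w) = k3FormRat v w) →
        (∀ v ∈ trRat x, J v = 0 → v = 0) →
        ∃ (g : (K3HilbertIndex → ℚ) ≃ₗ[ℚ] (K3HilbertIndex → ℚ)) (z : K3HilbertIndex → ℂ),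
          (∀ v w : K3HilbertIndex → ℚ,
              k3HilbertForm 2 (fun i => ((g v i : ℚ) : ℂ)) (fun i => ((g w i : ℚ) : ℂ)) =
                k3HilbertForm 2 (fun i => ((v i : ℚ) : ℂ)) (fun i => ((w i : ℚ) : ℂ))) ∧
          (LinearMap.toMatrix' g.toLinearMap).map (fun q : ℚ => (q : ℂ)) *ᵥ Sum.elim x 0 = z ∧
          (∀ i, z (Sum.map k3BlockSwap id i) = z i) ∧
          k3HilbertForm 2 z z = 0 ∧ 0 < (k3HilbertForm 2 (star z) z).re ∧
          ∃ u : K3HilbertIndex → ℤ, k3HilbertForm 2 (fun i => (u i : ℂ)) z = 0 ∧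
            0 < ∑ i, ∑ j, u i * k3HilbertGram 2 i j * u j :=
  -- LANDED (p114596, wave 2 worker A, `…Theorems.NikulinTwinTransportTwinSimilitudeAlgebraicStubHkLatticeWitt`)
  Summit.HodgeConjecture.HodgeConjecture.Theorems.NikulinTwinTransport.stub_hkLatticeWitt

/-- Sub-stub B (registered r2; LANDED p111937): see `CorrCalculus` (= `CorrCompOfCup ∧ GraphClassPullback`). -/
theorem stub_corrCalculus :
    (Summit.HodgeConjecture.HodgeConjecture.Theses.EndoscopicMiddleDegree.CupProductAlgebraic →
      ∀ (μ : OrientationFamily), μ.HasPoincareDuality →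
        ∀ (A B C : SchemeOver ℂ) (l m n k : ℕ) (hA : IsSmoothProjective l A)
          (hB : IsSmoothProjective m B) (hC : IsSmoothProjective n C),
          ∀ γ ∈ algebraicClasses (A ⊗ B) m, ∀ γ' ∈ algebraicClasses (B ⊗ C) n,
            ∃ γ'' ∈ algebraicClasses (A ⊗ C) n, ∀ y : complexBetti C k,
              corrAction μ hA hC (rfl : k + 2 * n = k + 2 * n) γ'' y =
                corrAction μ hA hB (rfl : k + 2 * m = k + 2 * m) γ
                  (corrAction μ hB hC (rfl : k + 2 * n = k + 2 * n) γ' y)) ∧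
    (∀ (μ : OrientationFamily), μ.HasPoincareDuality →
      ∀ (F X : SchemeOver ℂ) (d n k : ℕ) (hF : IsSmoothProjective d F) (hX : IsSmoothProjective n X)
        (ν : F ⟶ X),
        ∃ γ ∈ algebraicClasses (F ⊗ X) n, ∀ b : complexBetti X k,
          corrAction μ hF hX (rfl : k + 2 * n = k + 2 * n) γ b = complexBetti.map ν k b) :=
  -- LANDED (p111937, wave 2 worker B, `…Theorems.NikulinTwinTransportTwinSimilitudeAlgebraicStubCorrCalculus`)
  Summit.HodgeConjecture.HodgeConjecture.Theorems.NikulinTwinTransport.stub_corrCalculus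

/-- Sub-stub C (registered r2; LANDED p111899): see `MarkingPeriodPt`. -/
theorem stub_markingPeriodPt :
    Huybrechts_K3_marking_exists →
    ∀ (S : SchemeOver ℂ), IsK3Surface S →
      ∀ (η : complexBetti S (2 * 1) ≃ₗ[ℂ] (K3Index → ℂ)) (p : complexBetti S (2 * 2)) (x : K3Index → ℂ),
        MarkedK3[S, η, p, x] →
        k3Form x x = 0 ∧ 0 < (k3Form (star x) x).re ∧
          ∃ u : K3Index → ℤ, k3Form (fun i => (u i : ℂ)) x = 0 ∧ 0 < ∑ i, ∑ j, u i * k3Gram i j * u j :=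
  -- LANDED (p111899, wave 2 worker C, `…Theorems.NikulinTwinTransportTwinSimilitudeAlgebraicStubMarkingPeriodPt`)
  Summit.HodgeConjecture.HodgeConjecture.Theorems.NikulinTwinTransport.stub_markingPeriodPt

/-- Sub-stub D (registered r2/r3, THE HEART; PROVED p113196): see `HKTwinClassAssembly`. -/
theorem stub_hkTwinClassAssembly :
    (∀ (x : K3Index → ℂ), k3Form x x = 0 → 0 < (k3Form (star x) x).re →
      (∃ u : K3Index → ℤ, k3Form (fun i => (u i : ℂ)) x = 0 ∧ 0 < ∑ i, ∑ j, u i * k3Gram i j * u j) →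
      ∀ J : (K3Index → ℚ) →ₗ[ℚ] (HostIndex → ℚ),
        (∀ v ∈ trRat x, ∀ w ∈ trRat x, hostFormRat (J v) (J w) = k3FormRat v w) →
        (∀ v ∈ trRat x, J v = 0 → v = 0) →
        ∃ (g : (K3HilbertIndex → ℚ) ≃ₗ[ℚ] (K3HilbertIndex → ℚ)) (z : K3HilbertIndex → ℂ),
          (∀ v w : K3HilbertIndex → ℚ,
              k3HilbertForm 2 (fun i => ((g v i : ℚ) : ℂ)) (fun i => ((g w i : ℚ) : ℂ)) =
                k3HilbertForm 2 (fun i => ((v i : ℚ) : ℂ)) (fun i => ((w i : ℚ) : ℂ))) ∧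
          (LinearMap.toMatrix' g.toLinearMap).map (fun q : ℚ => (q : ℂ)) *ᵥ Sum.elim x 0 = z ∧
          (∀ i, z (Sum.map k3BlockSwap id i) = z i) ∧
          k3HilbertForm 2 z z = 0 ∧ 0 < (k3HilbertForm 2 (star z) z).re ∧
          ∃ u : K3HilbertIndex → ℤ, k3HilbertForm 2 (fun i => (u i : ℂ)) z = 0 ∧
            0 < ∑ i, ∑ j, u i * k3HilbertGram 2 i j * u j) →
    (Huybrechts_K3_marking_exists ∧ CamereEtAl2026_symplecticInvolution_periodSurjective ∧
        CamereEtAl2023_fixedK3_restriction ∧ Markman2024_rationalHodgeIsometry_algebraic_marked ∧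
        Beauville1983_hilbertSquare_markedIncidence) →
    Summit.HodgeConjecture.HodgeConjecture.Theses.EndoscopicMiddleDegree.CupProductAlgebraic →
    LefschetzOneOneK3 → AlgebraicClassesOneOneK3 →
    ∀ (μ : OrientationFamily), μ.HasPoincareDuality →
      ∀ (S : SchemeOver ℂ) (hS : IsK3Surface S) (p : complexBetti S (2 * 2)), Gen[S, p] →
        InHKNikulinSector S →
        ∃ (Sg : SchemeOver ℂ) (hSg : IsK3Surface Sg) (pg : complexBetti Sg (2 * 2)), Gen[Sg, pg] ∧
          ∃ γ ∈ algebraicClasses (MonoidalCategoryStruct.tensorObj Sg S) 2,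
            IsPartialTwinClass μ S Sg hS hSg p pg γ :=
  -- PROVED by the lead (p113196, `…Theorems.NikulinTwinTransportTwinSimilitudeAlgebraicStubHkTwinClassAssembly`)
  Summit.HodgeConjecture.HodgeConjecture.Theorems.NikulinTwinTransport.stub_hkTwinClassAssembly

/-- Stub 1 (r1 heart; after r2 NO LONGER A STUB but the composition of sub-stubs A–D — kept under its
registered name so that the r1 signature stays visible): see `HKNikulinTwinClass`. -/
theorem stub_hkNikulinTwinClass :
    HodgeK3Facts → Summit.HodgeConjecture.HodgeConjecture.Theses.EndoscopicMiddleDegree.CupProductAlgebraic →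
    LefschetzOneOneK3 → AlgebraicClassesOneOneK3 →
    ∀ (μ : OrientationFamily), μ.HasPoincareDuality →
      ∀ (S : SchemeOver ℂ) (hS : IsK3Surface S) (p : complexBetti S (2 * 2)), Gen[S, p] →
        InHKNikulinSector S →
        ∃ (Sg : SchemeOver ℂ) (hSg : IsK3Surface Sg) (pg : complexBetti Sg (2 * 2)), Gen[Sg, pg] ∧
          ∃ γ ∈ algebraicClasses (MonoidalCategoryStruct.tensorObj Sg S) 2,
            IsPartialTwinClass μ S Sg hS hSg p pg γ :=
  -- r2/r3: the heart is ASSEMBLED from the registered sub-stubs (no `sorry` here)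
  fun h₀ hC hL hN => stub_hkTwinClassAssembly stub_hkLatticeWitt h₀ hC hL hN

/-- Stub 2 (registered, new in r1; LANDED p97661): see `DivisorCorrections`. -/
theorem stub_divisorCorrections :
    ∀ (μ : OrientationFamily), μ.HasPoincareDuality →
      ∀ (S Sg : SchemeOver ℂ) (hS : IsK3Surface S) (hSg : IsK3Surface Sg)
        (p : complexBetti S (2 * 2)), p ≠ 0 →
        ∀ a ∈ algebraicClasses S 1, ∀ b ∈ algebraicClasses Sg 1,
          ∃ γ ∈ algebraicClasses (MonoidalCategoryStruct.tensorObj Sg S) 2,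
            ∀ (x : complexBetti S (2 * 1)) (t : ℂ),
              cupProduct (rfl : 2 * 1 + 2 * 1 = 2 * 2) x a = t • p →
                Corr[μ, Sg, S, hSg, hS ; γ, x] = t • b :=
  -- LANDED (p97661, `…Theorems.NikulinTwinTransportTwinSimilitudeAlgebraicStubDivisorCorrections`)
  Summit.HodgeConjecture.HodgeConjecture.Theorems.NikulinTwinTransport.stub_divisorCorrections

/-- Stub 3 (registered, new in r1; LANDED p104519): see `WittCompletion`. -/
theorem stub_wittCompletion :
    Huybrechts_K3_marking_exists → (∀ (S : SchemeOver ℂ), IsK3Surface S → hodgeIndex_surface S) →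
    LefschetzOneOneK3 → AlgebraicClassesOneOneK3 →
      ∀ (S Sg : SchemeOver ℂ) (hS : IsK3Surface S) (hSg : IsK3Surface Sg)
        (p : complexBetti S (2 * 2)) (pg : complexBetti Sg (2 * 2)), Gen[S, p] → Gen[Sg, pg] →
        ∀ (Φ : complexBetti S (2 * 1) →ₗ[ℂ] complexBetti Sg (2 * 1)),
          (∀ x, IsRationalClass x → IsRationalClass (Φ x)) →
          (∀ (i j : ℕ) x, IsOfHodgeType 2 S (2 * 1) i j x → IsOfHodgeType 2 Sg (2 * 1) i j (Φ x)) →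
          (∀ x, Perp[S ; x] → Perp[Sg ; Φ x]) →
          (∀ y, Perp[Sg ; y] → ∃ x, Perp[S ; x] ∧ Φ x = y) →
          (∀ x, Perp[S ; x] → ∀ y, Perp[S ; y] → ∀ a : ℂ,
            cupProduct (rfl : 2 * 1 + 2 * 1 = 2 * 2) x y = a • p →
              cupProduct (rfl : 2 * 1 + 2 * 1 = 2 * 2) (Φ x) (Φ y) = ((2 : ℂ) * a) • pg) →
          ∃ (m : ℕ) (a : Fin m → complexBetti S (2 * 1)) (b : Fin m → complexBetti Sg (2 * 1)),
            (∀ i, a i ∈ algebraicClasses S 1) ∧ (∀ i, b i ∈ algebraicClasses Sg 1) ∧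
            ∀ (ν : Fin m → (complexBetti S (2 * 1) →ₗ[ℂ] complexBetti Sg (2 * 1))),
              (∀ i (x : complexBetti S (2 * 1)) (t : ℂ),
                cupProduct (rfl : 2 * 1 + 2 * 1 = 2 * 2) x (a i) = t • p → ν i x = t • b i) →
              (∀ x, IsRationalClass x → IsRationalClass ((Φ + ∑ i, ν i) x)) ∧
              (∀ (i j : ℕ) x, IsOfHodgeType 2 S (2 * 1) i j x →
                IsOfHodgeType 2 Sg (2 * 1) i j ((Φ + ∑ i, ν i) x)) ∧
              (∀ (x y : complexBetti S (2 * 1)) (c : ℂ),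
                cupProduct (rfl : 2 * 1 + 2 * 1 = 2 * 2) x y = c • p →
                  cupProduct (rfl : 2 * 1 + 2 * 1 = 2 * 2) ((Φ + ∑ i, ν i) x)
                    ((Φ + ∑ i, ν i) y) = ((2 : ℂ) * c) • pg) :=
  -- LANDED (p104519, `…Theorems.NikulinTwinTransportTwinSimilitudeAlgebraicStubWittCompletion`)
  Summit.HodgeConjecture.HodgeConjecture.Theorems.NikulinTwinTransport.stub_wittCompletion

/-- Stub 4 (registered, new in r1; LANDED p106118): see `OutAnchorOfSimilitude`. -/
theorem stub_outAnchorOfSimilitude :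
    Huybrechts_K3_marking_exists →
    ∀ (μ : OrientationFamily), μ.HasPoincareDuality →
      ∀ (S Sg : SchemeOver ℂ) (hS : IsK3Surface S) (hSg : IsK3Surface Sg)
        (p : complexBetti S (2 * 2)) (pg : complexBetti Sg (2 * 2)), Gen[S, p] → Gen[Sg, pg] →
        ∀ (Ψ₀ : complexBetti S (2 * 1) →ₗ[ℂ] complexBetti Sg (2 * 1)),
          (∀ x, IsRationalClass x → IsRationalClass (Ψ₀ x)) →
          (∀ (i j : ℕ) x, IsOfHodgeType 2 S (2 * 1) i j x →
            IsOfHodgeType 2 Sg (2 * 1) i j (Ψ₀ x)) →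
          (∀ (x y : complexBetti S (2 * 1)) (c : ℂ),
            cupProduct (rfl : 2 * 1 + 2 * 1 = 2 * 2) x y = c • p →
              cupProduct (rfl : 2 * 1 + 2 * 1 = 2 * 2) (Ψ₀ x) (Ψ₀ y) = ((2 : ℂ) * c) • pg) →
          (∃ γ ∈ algebraicClasses (MonoidalCategoryStruct.tensorObj Sg S) 2,
            ∀ x : complexBetti S (2 * 1), Ψ₀ x = Corr[μ, Sg, S, hSg, hS ; γ, x]) →
          OutAnchor[μ, S, Sg, hS, hSg, p, pg] :=
  -- LANDED (p106118, `…Theorems.NikulinTwinTransportTwinSimilitudeAlgebraicStubOutAnchorOfSimilitude`)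
  Summit.HodgeConjecture.HodgeConjecture.Theorems.NikulinTwinTransport.stub_outAnchorOfSimilitude

/-- Stub 5′ (registered, RESHAPE r8 by lead c3): see `CupProductFacts` — BY NAME the Literature named
fact `span_holomorphicBundleChernCharacter_eq_algebraicClasses` (Voisin I Thm. 11.32 ⊗ ℂ; literature
debt, not worker-provable). [cite: VoisinHodgeI2002, Thm. 11.32] [cite: Deligne2000, §2 Remark (ii)] -/
theorem stub_cupProductFacts : span_holomorphicBundleChernCharacter_eq_algebraicClasses := by
  sorry

/-- Stub 5 (registered r2, CLOSED r8 — literally the support item `CupProductAlgebraic` of route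
EndoscopicMiddleDegree, stmt-HodgeConjecture-14350): see `CupProductAlgebraicInput`.  Wave 2 worker D
(2026-08-16T15:32Z): `stub-blocked: hstep` (the Chow–Roberts cone step) of
`Literature.AlgebraicGeometry.HodgeTheory.cupProduct_mem_algebraicClasses_of_coneStep` = item 14350 as
filed (XL: Roberts' Main Lemma — generic linear projections — and the Thom-line transport; three prior
assessments agree); nothing of it is restated here.  RESHAPE r8 (lead c3): no longer a `sorry` — it is
DERIVED from the registered named-fact stub `stub_cupProductFacts` (Voisin I Thm. 11.32 ⊗ ℂ) by the
tree's `cupProductAlgebraic_of_span_chernCharacter` (p83634) and `nonempty_hodgeModel_holds`.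
[cite: VoisinHodgeI2002, Thm. 11.32] [cite: VoisinHodgeII2003, §9.2.4 Prop. 9.20] -/
theorem stub_cupProductAlgebraic :
    Summit.HodgeConjecture.HodgeConjecture.Theses.EndoscopicMiddleDegree.CupProductAlgebraic :=
  Summit.HodgeConjecture.HodgeConjecture.Theorems.EndoscopicMiddleDegree.cupProductAlgebraic_of_span_chernCharacter
    stub_cupProductFacts (fun _ _ => nonempty_hodgeModel_holds)

/-- Stub T1 (registered r6; LANDED p119716): see `TopPushProportional`. -/
theorem stub_topPushProportional :
    ∀ (μ : OrientationFamily), μ.HasPoincareDuality →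
      ∀ (S Sg : SchemeOver ℂ) (hS : IsK3Surface S) (hSg : IsK3Surface Sg)
        (p : complexBetti S (2 * 2)) (pg : complexBetti Sg (2 * 2)), p ≠ 0 → pg ≠ 0 →
        ∃ κ : ℂ, κ ≠ 0 ∧
          ∀ (W : complexBetti (MonoidalCategoryStruct.tensorObj Sg S) (2 * (2 + 2))) (a : ℂ),
            complexGysin μ
                (IsSmoothProjective.tensor_holds (IsK3Surface.isSmoothProjective hSg)
                  (IsK3Surface.isSmoothProjective hS))
                (IsK3Surface.isSmoothProjective hSg) (SemiCartesianMonoidalCategory.fst Sg S)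
                (rfl : 2 * (2 + 2) + 2 * 2 = 2 * 2 + 2 * (2 + 2)) W = a • pg →
              complexGysin μ
                (IsSmoothProjective.tensor_holds (IsK3Surface.isSmoothProjective hSg)
                  (IsK3Surface.isSmoothProjective hS))
                (IsK3Surface.isSmoothProjective hS) (SemiCartesianMonoidalCategory.snd Sg S)
                (rfl : 2 * (2 + 2) + 2 * 2 = 2 * 2 + 2 * (2 + 2)) W = (κ * a) • p :=
  -- LANDED (p119716, `…Theorems.NikulinTwinTransportTwinSimilitudeAlgebraicStubTopPushProportional`)
  Summit.HodgeConjecture.HodgeConjecture.Theorems.NikulinTwinTransport.stub_topPushProportional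

/-- Stub T2 (registered r6; LANDED p119770): see `CorrTranspose`. -/
theorem stub_corrTranspose :
    ∀ (μ : OrientationFamily), μ.HasPoincareDuality →
      ∀ (S Sg : SchemeOver ℂ) (hS : IsK3Surface S) (hSg : IsK3Surface Sg),
        ∀ γ ∈ algebraicClasses (MonoidalCategoryStruct.tensorObj Sg S) 2,
          ∃ γ' ∈ algebraicClasses (MonoidalCategoryStruct.tensorObj S Sg) 2,
            ∀ u : complexBetti Sg (2 * 1),
              Corr[μ, S, Sg, hS, hSg ; γ', u] =
                complexGysin μ
                  (IsSmoothProjective.tensor_holds (IsK3Surface.isSmoothProjective hSg)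
                    (IsK3Surface.isSmoothProjective hS))
                  (IsK3Surface.isSmoothProjective hS) (SemiCartesianMonoidalCategory.snd Sg S)
                  (rfl : 2 * 1 + 2 * 2 + 2 * 2 = 2 * 1 + 2 * (2 + 2))
                  (cupProduct (rfl : 2 * 1 + 2 * 2 = 2 * 1 + 2 * 2)
                    (complexBetti.map (SemiCartesianMonoidalCategory.fst Sg S) (2 * 1) u) γ) :=
  -- LANDED (p119770, `…Theorems.NikulinTwinTransportTwinSimilitudeAlgebraicStubCorrTranspose`)
  Summit.HodgeConjecture.HodgeConjecture.Theorems.NikulinTwinTransport.stub_corrTranspose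

/-- Stub T3 (registered r6; LANDED p119852): see `InverseAnchorAlgebraic` — the hypotheses T1
`TopPushProportional` and T2 `CorrTranspose` are SPELLED OUT verbatim (so that the landed theorem needs no
statements file and lands independently of T1, T2; `inverseAnchorAlgebraic_holds` recovers the named form by
unfolding). -/
theorem stub_inverseAnchorAlgebraic :
    (∀ (μ : OrientationFamily), μ.HasPoincareDuality →
      ∀ (S Sg : SchemeOver ℂ) (hS : IsK3Surface S) (hSg : IsK3Surface Sg)
        (p : complexBetti S (2 * 2)) (pg : complexBetti Sg (2 * 2)), p ≠ 0 → pg ≠ 0 →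
        ∃ κ : ℂ, κ ≠ 0 ∧
          ∀ (W : complexBetti (MonoidalCategoryStruct.tensorObj Sg S) (2 * (2 + 2))) (a : ℂ),
            complexGysin μ
                (IsSmoothProjective.tensor_holds (IsK3Surface.isSmoothProjective hSg)
                  (IsK3Surface.isSmoothProjective hS))
                (IsK3Surface.isSmoothProjective hSg) (SemiCartesianMonoidalCategory.fst Sg S)
                (rfl : 2 * (2 + 2) + 2 * 2 = 2 * 2 + 2 * (2 + 2)) W = a • pg →
              complexGysin μ
                (IsSmoothProjective.tensor_holds (IsK3Surface.isSmoothProjective hSg)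
                  (IsK3Surface.isSmoothProjective hS))
                (IsK3Surface.isSmoothProjective hS) (SemiCartesianMonoidalCategory.snd Sg S)
                (rfl : 2 * (2 + 2) + 2 * 2 = 2 * 2 + 2 * (2 + 2)) W = (κ * a) • p) →
    (∀ (μ : OrientationFamily), μ.HasPoincareDuality →
      ∀ (S Sg : SchemeOver ℂ) (hS : IsK3Surface S) (hSg : IsK3Surface Sg),
        ∀ γ ∈ algebraicClasses (MonoidalCategoryStruct.tensorObj Sg S) 2,
          ∃ γ' ∈ algebraicClasses (MonoidalCategoryStruct.tensorObj S Sg) 2,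
            ∀ u : complexBetti Sg (2 * 1),
              Corr[μ, S, Sg, hS, hSg ; γ', u] =
                complexGysin μ
                  (IsSmoothProjective.tensor_holds (IsK3Surface.isSmoothProjective hSg)
                    (IsK3Surface.isSmoothProjective hS))
                  (IsK3Surface.isSmoothProjective hS) (SemiCartesianMonoidalCategory.snd Sg S)
                  (rfl : 2 * 1 + 2 * 2 + 2 * 2 = 2 * 1 + 2 * (2 + 2))
                  (cupProduct (rfl : 2 * 1 + 2 * 2 = 2 * 1 + 2 * 2)
                    (complexBetti.map (SemiCartesianMonoidalCategory.fst Sg S) (2 * 1) u) γ)) →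
    Huybrechts_K3_marking_exists →
    ∀ (μ : OrientationFamily), μ.HasPoincareDuality →
      ∀ (S Sg : SchemeOver ℂ) (hS : IsK3Surface S) (hSg : IsK3Surface Sg)
        (p : complexBetti S (2 * 2)) (pg : complexBetti Sg (2 * 2)), Gen[S, p] → Gen[Sg, pg] →
        ∀ (Ψ : complexBetti S (2 * 1) ≃ₗ[ℂ] complexBetti Sg (2 * 1)),
          (∀ (u v : complexBetti Sg (2 * 1)) (b : ℂ),
            cupProduct (rfl : 2 * 1 + 2 * 1 = 2 * 2) u v = ((2 : ℂ) * b) • pg →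
              cupProduct (rfl : 2 * 1 + 2 * 1 = 2 * 2) (Ψ.symm u) (Ψ.symm v) = b • p) →
          (∃ γ ∈ algebraicClasses (MonoidalCategoryStruct.tensorObj Sg S) 2,
            ∀ x : complexBetti S (2 * 1), Ψ x = Corr[μ, Sg, S, hSg, hS ; γ, x]) →
          ∃ γ' ∈ algebraicClasses (MonoidalCategoryStruct.tensorObj S Sg) 2,
            ∀ u : complexBetti Sg (2 * 1), Ψ.symm u = Corr[μ, S, Sg, hS, hSg ; γ', u] :=
  -- LANDED (p119852, `…Theorems.NikulinTwinTransportTwinSimilitudeAlgebraicStubInverseAnchorAlgebraic`)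
  Summit.HodgeConjecture.HodgeConjecture.Theorems.NikulinTwinTransport.stub_inverseAnchorAlgebraic

/-- Stub T4 (registered r6; LANDED p119877): see `AnchorForward`. -/
theorem stub_anchorForward :
    Huybrechts_K3_marking_exists →
      ∀ (S Sg : SchemeOver ℂ) (hS : IsK3Surface S) (hSg : IsK3Surface Sg)
        (p : complexBetti S (2 * 2)) (pg : complexBetti Sg (2 * 2)), Gen[S, p] → Gen[Sg, pg] →
        ∀ (Ψ : complexBetti S (2 * 1) ≃ₗ[ℂ] complexBetti Sg (2 * 1)),
          (∀ y, IsRationalClass y → IsRationalClass (Ψ.symm y)) →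
          (∀ (i j : ℕ) y, IsOfHodgeType 2 Sg (2 * 1) i j y →
            IsOfHodgeType 2 S (2 * 1) i j (Ψ.symm y)) →
          (∀ (u v : complexBetti Sg (2 * 1)) (b : ℂ),
            cupProduct (rfl : 2 * 1 + 2 * 1 = 2 * 2) u v = ((2 : ℂ) * b) • pg →
              cupProduct (rfl : 2 * 1 + 2 * 1 = 2 * 2) (Ψ.symm u) (Ψ.symm v) = b • p) →
          (∀ x, IsRationalClass x → IsRationalClass (Ψ x)) ∧
          (∀ (i j : ℕ) x, IsOfHodgeType 2 S (2 * 1) i j x →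
            IsOfHodgeType 2 Sg (2 * 1) i j (Ψ x)) ∧
          (∀ (x y : complexBetti S (2 * 1)) (c : ℂ),
            cupProduct (rfl : 2 * 1 + 2 * 1 = 2 * 2) x y = c • p →
              cupProduct (rfl : 2 * 1 + 2 * 1 = 2 * 2) (Ψ x) (Ψ y) = ((2 : ℂ) * c) • pg) :=
  -- LANDED (p119877, `…Theorems.NikulinTwinTransportTwinSimilitudeAlgebraicStubAnchorForward`)
  Summit.HodgeConjecture.HodgeConjecture.Theorems.NikulinTwinTransport.stub_anchorForward

/-- Stub 10 (registered r11; LANDED by wave-1 worker A, p126263 —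
`Theorems/…TwinSimilitudeAlgebraicStubCMCayleyDecomposition.lean`): see `CMCayleyDecomposition`. -/
theorem stub_cmCayleyDecomposition :
    ∀ (V : Type) [AddCommGroup V] [Module ℚ V] [FiniteDimensional ℚ V]
      (B : LinearMap.BilinForm ℚ V), B.IsSymm → B.Nondegenerate →
      ∀ (J : V ≃ₗ[ℚ] V), (∀ x y, B (J x) (J y) = 2 * B x y) →
      ∀ (N : Submodule ℚ V), (B.restrict N).Nondegenerate → (∀ u ∈ N, J u ∈ N) →
      (∀ w ∈ B.orthogonal N, J (J w) = (2 : ℚ) • w → w = 0) →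
      ∃ (m : ℕ) (c : Fin m → ℚ) (q : Fin m → Polynomial ℚ) (k : ℕ) (a b : Fin k → V),
        (∀ i x y, B (Polynomial.aeval J.toLinearMap (q i) x) (Polynomial.aeval J.toLinearMap (q i) y) = B x y) ∧
        (∀ l, a l ∈ N) ∧ (∀ l, b l ∈ N) ∧
        ∀ x, J x = ∑ i, c i • Polynomial.aeval J.toLinearMap (q i) x + ∑ l, B x (a l) • b l :=
  Summit.HodgeConjecture.HodgeConjecture.Theorems.NikulinTwinTransport.stub_cmCayleyDecomposition

/-- Stub 11 (registered r11; LANDED by wave-1 worker B, p126334 —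
`Theorems/…TwinSimilitudeAlgebraicStubCMPolyComplexify.lean`): see `CMPolyComplexify`. -/
theorem stub_cmPolyComplexify :
    ∀ (J : Module.End ℂ (K3Index → ℂ)) (Jq : Module.End ℚ (K3Index → ℚ)),
      (∀ u : K3Index → ℚ, J (fun i => (u i : ℂ)) = fun i => (Jq u i : ℂ)) →
      ∀ q : Polynomial ℚ,
        (∀ u : K3Index → ℚ,
          Polynomial.aeval J (q.map (algebraMap ℚ ℂ)) (fun i => (u i : ℂ)) =
            fun i => (Polynomial.aeval Jq q u i : ℂ)) ∧
        ((∀ v w, k3FormRat (Polynomial.aeval Jq q v) (Polynomial.aeval Jq q w) = k3FormRat v w) →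
          ∀ a b, k3Form (Polynomial.aeval J (q.map (algebraMap ℚ ℂ)) a)
            (Polynomial.aeval J (q.map (algebraMap ℚ ℂ)) b) = k3Form a b) :=
  Summit.HodgeConjecture.HodgeConjecture.Theorems.NikulinTwinTransport.stub_cmPolyComplexify

/-- Stub 12 (registered r11; LANDED by wave-1 worker C, p126486 —
`Theorems/…TwinSimilitudeAlgebraicStubCMRationalForm.lean`): see `CMRationalForm`. -/
theorem stub_cmRationalForm :
    Huybrechts_K3_marking_exists → LefschetzOneOneK3 → AlgebraicClassesOneOneK3 →
    (∀ (S : SchemeOver ℂ), IsK3Surface S → hodgeIndex_surface S) →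
      ∀ (S : SchemeOver ℂ) (hS : IsK3Surface S) (p : complexBetti S (2 * 2)), Gen[S, p] →
      ∀ (e : complexBetti S (2 * 1) →ₗ[ℂ] complexBetti S (2 * 1)),
        (∀ x, IsRationalClass x → IsRationalClass (e x)) →
        (∀ (x y : complexBetti S (2 * 1)) (a : ℂ),
          cupProduct (rfl : 2 * 1 + 2 * 1 = 2 * 2) x y = a • p →
            cupProduct (rfl : 2 * 1 + 2 * 1 = 2 * 2) (e x) (e y) = ((2 : ℂ) * a) • p) →
        ∀ (σ : complexBetti S (2 * 1)) (t : ℂ), IsOfHodgeType 2 S (2 * 1) 2 0 σ → σ ≠ 0 → t.im ≠ 0 →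
          e σ = t • σ →
        ∀ (η : complexBetti S (2 * 1) ≃ₗ[ℂ] (K3Index → ℂ)) (p₀ : complexBetti S (2 * 2)) (x₀ : K3Index → ℂ),
          MarkedK3[S, η, p₀, x₀] →
          ∃ (Jq : (K3Index → ℚ) ≃ₗ[ℚ] (K3Index → ℚ)) (NQ : Submodule ℚ (K3Index → ℚ)),
            (∀ u : K3Index → ℚ, η (e (η.symm fun i => (u i : ℂ))) = fun i => (Jq u i : ℂ)) ∧
            (∀ v w, k3FormRat (Jq v) (Jq w) = 2 * k3FormRat v w) ∧
            (∀ u, u ∈ NQ ↔ η.symm (fun j => (u j : ℂ)) ∈ algebraicClasses S 1) ∧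
            (k3FormRat.restrict NQ).Nondegenerate ∧
            (∀ u ∈ NQ, Jq u ∈ NQ) ∧
            (∀ w ∈ k3FormRat.orthogonal NQ, Jq (Jq w) = (2 : ℚ) • w → w = 0) :=
  Summit.HodgeConjecture.HodgeConjecture.Theorems.NikulinTwinTransport.stub_cmRationalForm

/-- Stub 13 (registered r11; THE ASSEMBLY — LANDED by wave-1 worker D, p126672 —
`Theorems/…TwinSimilitudeAlgebraicStubCMSelfSimilitudeFromIsometries.lean`): see `CMSelfSimilitudeFromIsometries`. -/
theorem stub_cmSelfSimilitudeFromIsometries :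
    CMCayleyDecomposition → CMPolyComplexify → CMRationalForm →
    Huybrechts_K3_marking_exists → HodgeIsometryAlgebraic → LefschetzOneOneK3 → AlgebraicClassesOneOneK3 →
    (∀ (S : SchemeOver ℂ), IsK3Surface S → hodgeIndex_surface S) → DivisorCorrections →
    ∀ (μ : OrientationFamily), μ.HasPoincareDuality →
      ∀ (S : SchemeOver ℂ) (hS : IsK3Surface S) (p : complexBetti S (2 * 2)), Gen[S, p] →
      ∀ (e : complexBetti S (2 * 1) →ₗ[ℂ] complexBetti S (2 * 1)),
        (∀ x, IsRationalClass x → IsRationalClass (e x)) →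
        (∀ (x y : complexBetti S (2 * 1)) (a : ℂ),
          cupProduct (rfl : 2 * 1 + 2 * 1 = 2 * 2) x y = a • p →
            cupProduct (rfl : 2 * 1 + 2 * 1 = 2 * 2) (e x) (e y) = ((2 : ℂ) * a) • p) →
        ∀ (σ : complexBetti S (2 * 1)) (t : ℂ), IsOfHodgeType 2 S (2 * 1) 2 0 σ → σ ≠ 0 → t.im ≠ 0 →
          e σ = t • σ →
        ∃ γ ∈ algebraicClasses (MonoidalCategoryStruct.tensorObj S S) 2,
          ∀ x : complexBetti S (2 * 1), e x = Corr[μ, S, S, hS, hS ; γ, x] :=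
  Summit.HodgeConjecture.HodgeConjecture.Theorems.NikulinTwinTransport.stub_cmSelfSimilitudeFromIsometries

/-- Stub 8 (registered r9; LANDED by the lead — `Theorems/…TwinSimilitudeAlgebraicCMNormSelfAnchor.lean` p123920 +
`Theorems/…TwinSimilitudeAlgebraicCMNormTwins.lean`; r10: discharged by import): see `CMNormTwins`. -/
theorem stub_cmNormTwins :
    Huybrechts_K3_marking_exists → Buskin2019_hodgeConjectureFor_square_of_CM →
      Summit.HodgeConjecture.HodgeConjecture.Theses.EndoscopicMiddleDegree.CupProductAlgebraic →
      HodgeIsometryAlgebraic →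
      ∀ (μ : OrientationFamily), μ.HasPoincareDuality →
        ∀ (S S' : SchemeOver ℂ) (hS : IsK3Surface S) (hS' : IsK3Surface S')
          (p : complexBetti S (2 * 2)) (p' : complexBetti S' (2 * 2)), Gen[S, p] → Gen[S', p'] →
          (CMNorm2[S', p'] ∨ CMNorm2[S, p]) →
          ∀ (ψ : complexBetti S' (2 * 1) →ₗ[ℂ] complexBetti S (2 * 1)),
            (∀ x, IsRationalClass x → IsRationalClass (ψ x)) →
            (∀ (i j : ℕ) x, IsOfHodgeType 2 S' (2 * 1) i j x → IsOfHodgeType 2 S (2 * 1) i j (ψ x)) →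
            (∀ (x y : complexBetti S' (2 * 1)) (a : ℂ),
              cupProduct (rfl : 2 * 1 + 2 * 1 = 2 * 2) x y = a • p' →
                cupProduct (rfl : 2 * 1 + 2 * 1 = 2 * 2) (ψ x) (ψ y) = ((2 : ℂ) * a) • p) →
            ∃ γ ∈ algebraicClasses (MonoidalCategoryStruct.tensorObj S S') 2,
              ∀ x : complexBetti S' (2 * 1), ψ x = Corr[μ, S, S', hS, hS' ; γ, x] :=
  -- LANDED (r10, `…Theorems.NikulinTwinTransportTwinSimilitudeAlgebraicCMNormTwins`)
  Summit.HodgeConjecture.HodgeConjecture.Theorems.NikulinTwinTransport.stub_cmNormTwins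

/-- Stub 9 (registered r9, the residual — not claimed): see `OffSectorNonCMPairs`. -/
theorem stub_offSectorNonCMPairs :
    ∀ (μ : OrientationFamily), μ.HasPoincareDuality →
      ∀ (S S' : SchemeOver ℂ) (hS : IsK3Surface S) (hS' : IsK3Surface S')
        (p : complexBetti S (2 * 2)) (p' : complexBetti S' (2 * 2)), Gen[S, p] → Gen[S', p'] →
        ∀ (ψ : complexBetti S' (2 * 1) →ₗ[ℂ] complexBetti S (2 * 1)),
          (∀ x, IsRationalClass x → IsRationalClass (ψ x)) →
          (∀ (i j : ℕ) x, IsOfHodgeType 2 S' (2 * 1) i j x → IsOfHodgeType 2 S (2 * 1) i j (ψ x)) →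
          (∀ (x y : complexBetti S' (2 * 1)) (a : ℂ),
            cupProduct (rfl : 2 * 1 + 2 * 1 = 2 * 2) x y = a • p' →
              cupProduct (rfl : 2 * 1 + 2 * 1 = 2 * 2) (ψ x) (ψ y) = ((2 : ℂ) * a) • p) →
          ¬ InHKNikulinSector S' → ¬ InHKNikulinSector S → ¬ CMNorm2[S', p'] → ¬ CMNorm2[S, p] →
          ∃ γ ∈ algebraicClasses (MonoidalCategoryStruct.tensorObj S S') 2,
            ∀ x : complexBetti S' (2 * 1), ψ x = Corr[μ, S, S', hS, hS' ; γ, x] := by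
  sorry

/-! ### Consistency: each named statement IS its registered stub (definitional unfolding only) -/

theorem hodgeK3Facts_holds : HodgeK3Facts := stub_hodgeK3Facts
theorem hkLatticeWitt_holds : HKLatticeWitt := stub_hkLatticeWitt
theorem corrCalculus_holds : CorrCalculus := stub_corrCalculus
theorem markingPeriodPt_holds : MarkingPeriodPt := stub_markingPeriodPt
theorem hkTwinClassAssembly_holds : HKTwinClassAssembly := fun hA => stub_hkTwinClassAssembly hA
theorem hkNikulinTwinClass_holds : HKNikulinTwinClass := stub_hkNikulinTwinClass
theorem divisorCorrections_holds : DivisorCorrections := stub_divisorCorrections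
theorem wittCompletion_holds : WittCompletion := stub_wittCompletion
theorem outAnchorOfSimilitude_holds : OutAnchorOfSimilitude := stub_outAnchorOfSimilitude
theorem cupProductAlgebraicInput_holds : CupProductAlgebraicInput := stub_cupProductAlgebraic
theorem cupProductFacts_holds : CupProductFacts := stub_cupProductFacts

/-- RESHAPE r8: the cup-product input of the line from its named fact (Voisin I Thm. 11.32 ⊗ ℂ), by the
tree's `cupProductAlgebraic_of_span_chernCharacter` and `nonempty_hodgeModel_holds`.
[cite: VoisinHodgeI2002, Thm. 11.32] [cite: VoisinHodgeII2003, §9.2.4 Prop. 9.20] -/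
theorem cupProductAlgebraicInput_of_facts (h : CupProductFacts) : CupProductAlgebraicInput :=
  Summit.HodgeConjecture.HodgeConjecture.Theorems.EndoscopicMiddleDegree.cupProductAlgebraic_of_span_chernCharacter
    h (fun _ _ => nonempty_hodgeModel_holds)
theorem topPushProportional_holds : TopPushProportional := stub_topPushProportional
theorem corrTranspose_holds : CorrTranspose := stub_corrTranspose
theorem inverseAnchorAlgebraic_holds : InverseAnchorAlgebraic := stub_inverseAnchorAlgebraic
theorem anchorForward_holds : AnchorForward := stub_anchorForward
theorem cmCayleyDecomposition_holds : CMCayleyDecomposition := stub_cmCayleyDecomposition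
theorem cmPolyComplexify_holds : CMPolyComplexify := stub_cmPolyComplexify
theorem cmRationalForm_holds : CMRationalForm := stub_cmRationalForm
theorem cmSelfSimilitudeFromIsometries_holds : CMSelfSimilitudeFromIsometries :=
  stub_cmSelfSimilitudeFromIsometries
theorem cmNormTwins_holds : CMNormTwins := stub_cmNormTwins
theorem offSectorNonCMPairs_holds : OffSectorNonCMPairs := stub_offSectorNonCMPairs

/-! ### Name-keyed aliases (the skeleton audit admits a hypothesis of `_of` whose head constant's last
name component is a registered stub name; `@[stub]` tags are gate-reserved) -/
namespace Registered

/-- Alias of `HodgeK3Facts` keyed by the registered stub name. -/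
abbrev stub_hodgeK3Facts : Prop := HodgeK3Facts
/-- Alias of `HKNikulinTwinClass` keyed by the r1 stub name (r2: assembled, see sub-stubs A–D). -/
abbrev stub_hkNikulinTwinClass : Prop := HKNikulinTwinClass
/-- Alias of `HKLatticeWitt` keyed by the registered stub name. -/
abbrev stub_hkLatticeWitt : Prop := HKLatticeWitt
/-- Alias of `CorrCalculus` keyed by the registered stub name. -/
abbrev stub_corrCalculus : Prop := CorrCalculus
/-- Alias of `MarkingPeriodPt` keyed by the registered stub name. -/
abbrev stub_markingPeriodPt : Prop := MarkingPeriodPt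
/-- Alias of `HKTwinClassAssembly` keyed by the registered stub name. -/
abbrev stub_hkTwinClassAssembly : Prop := HKTwinClassAssembly
/-- Alias of `DivisorCorrections` keyed by the registered stub name. -/
abbrev stub_divisorCorrections : Prop := DivisorCorrections
/-- Alias of `WittCompletion` keyed by the registered stub name. -/
abbrev stub_wittCompletion : Prop := WittCompletion
/-- Alias of `OutAnchorOfSimilitude` keyed by the registered stub name. -/
abbrev stub_outAnchorOfSimilitude : Prop := OutAnchorOfSimilitude
/-- Alias of `CupProductAlgebraicInput` keyed by the r2 stub name (r8: derived, see
`cupProductAlgebraicInput_of_facts`). -/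
abbrev stub_cupProductAlgebraic : Prop := CupProductAlgebraicInput
/-- Alias of `CupProductFacts` keyed by the registered stub name (r8). -/
abbrev stub_cupProductFacts : Prop := CupProductFacts
/-- Alias of `OffSectorSources` keyed by the r1–r5 stub name (r6: derived, see
`offSectorSources_of_offSectorPairs`). -/
abbrev stub_offSectorSources : Prop := OffSectorSources
/-- Alias of `TopPushProportional` keyed by the registered stub name (r6). -/
abbrev stub_topPushProportional : Prop := TopPushProportional
/-- Alias of `CorrTranspose` keyed by the registered stub name (r6). -/
abbrev stub_corrTranspose : Prop := CorrTranspose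
/-- Alias of `InverseAnchorAlgebraic` keyed by the registered stub name (r6). -/
abbrev stub_inverseAnchorAlgebraic : Prop := InverseAnchorAlgebraic
/-- Alias of `AnchorForward` keyed by the registered stub name (r6). -/
abbrev stub_anchorForward : Prop := AnchorForward
/-- Alias of `OffSectorPairs` keyed by the r6 stub name (r9: derived, see `offSectorPairs_of_cmNorm`). -/
abbrev stub_offSectorPairs : Prop := OffSectorPairs
/-- Alias of `CMCayleyDecomposition` keyed by the registered stub name (r11). -/
abbrev stub_cmCayleyDecomposition : Prop := CMCayleyDecomposition
/-- Alias of `CMPolyComplexify` keyed by the registered stub name (r11). -/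
abbrev stub_cmPolyComplexify : Prop := CMPolyComplexify
/-- Alias of `CMRationalForm` keyed by the registered stub name (r11). -/
abbrev stub_cmRationalForm : Prop := CMRationalForm
/-- Alias of `CMSelfSimilitudeFromIsometries` keyed by the registered stub name (r11). -/
abbrev stub_cmSelfSimilitudeFromIsometries : Prop := CMSelfSimilitudeFromIsometries
/-- Alias of `CMNormTwins` keyed by the registered stub name (r9). -/
abbrev stub_cmNormTwins : Prop := CMNormTwins
/-- Alias of `OffSectorNonCMPairs` keyed by the registered stub name (r9 residual). -/
abbrev stub_offSectorNonCMPairs : Prop := OffSectorNonCMPairs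

end Registered

/-! ## Proved glue (no `sorry` below this line) -/

/-- **The residual is weaker than X** (drop the negated sector hypothesis). [folklore] -/
theorem offSectorSources_of_twinSimilitudeAlgebraic (h : TwinSimilitudeAlgebraic) :
    OffSectorSources :=
  fun μ hμ S S' hS hS' p p' hp hp' ψ hψr hψt hψs _ => h μ hμ S S' hS hS' p p' hp hp' ψ hψr hψt hψs

/-- **The residual closes the day the transport crux closes**: Buskin (`HodgeIsometryAlgebraic`,
13675) + the route glue `TwinAnchorGlue` (14394) + `TwinTwistorTransport` (14393) give X, hence the
residual. [folklore] -/
theorem offSectorSources_of_twinTwistorTransport (hB : HodgeIsometryAlgebraic) (hG : TwinAnchorGlue)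
    (hT : TwinTwistorTransport) : OffSectorSources :=
  offSectorSources_of_twinSimilitudeAlgebraic (hG hB hT)

/-- The planner's (in-)anchor residual also implies nothing LESS than before: kept for the record,
`TwinTwistorTransport` gives in-anchors everywhere. [folklore] -/
theorem anchorData_of_twinTwistorTransport (h : TwinTwistorTransport) {μ : OrientationFamily}
    (hμ : μ.HasPoincareDuality) {S : SchemeOver ℂ} (hS : IsK3Surface S) {p : complexBetti S (2 * 2)}
    (hp : Gen[S, p]) : AnchorData[μ, S, hS, p] :=
  h μ hμ S hS p hp

/-- The marking's generator `p₀ ≠ 0` is an integral multiple of any integral generator `p`, so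
`p ≠ 0`. [folklore] -/
theorem gen_ne_zero (h₀ : HodgeK3Facts) {S : SchemeOver ℂ} (hS : IsK3Surface S)
    {p : complexBetti S (2 * 2)} (hp : Gen[S, p]) : p ≠ 0 := by
  obtain ⟨η, p₀, x, hp₀, ⟨hp₀int, -, -, -, -, -⟩, -⟩ := h₀.1 S hS
  obtain ⟨n, hn⟩ := hp.2 p₀ hp₀int
  rintro rfl
  exact hp₀ (by rw [hn, smul_zero])

/-- **`CompCorr` (r1's stub 5: composition of degree-`2` algebraic correspondences between smooth
projective surfaces, Buskin Lemma 6.3 / Fulton Prop. 16.1.1) from `CupProductAlgebraic`**: the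
tree's `corrComp_surfaces_of_cup'` (Fulton's composition `corr_comp_of_baseChange` with the PROVED
Gysin base change) needs only `N² ∪ N² ⊆ N⁴` on the sixfolds `A ⊗ (B ⊗ C)`, an instance of the
item. [cite: Fulton1998, §16.1 Prop. 16.1.1] [cite: Buskin2019, Lemma 6.3]
[cite: VoisinHodgeII2003, §9.2.4 Prop. 9.20] -/
theorem compCorr_of_cupProductAlgebraic (h : CupProductAlgebraicInput) : CompCorr :=
  corrComp_surfaces_of_cup' fun _ _ _ hA hB hC a ha b hb =>
    h (IsSmoothProjective.tensor_holds hA (IsSmoothProjective.tensor_holds hB hC)) 2 2 a b ha hb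

/-- **OUT-ANCHORS ON THE SECTOR from the heart, the divisor corrections, the Witt completion and the
out-anchor criterion** (the line's mechanism; facts and the two `(1,1)` route items granted): every
projective K3 surface in the HK-Nikulin sector has an algebraic out-anchor `2`-similitude into some
projective K3 surface.  Glue: `Ψ₀ := [γ]_* + Σᵢ [γᵢ]_*` with `γ` the partial twin class (heart) and
`γᵢ` the divisor correspondences realising the Witt correction `x ↦ (x.aᵢ) bᵢ`; `Ψ₀` is the action of
the algebraic class `γ + Σᵢ γᵢ` (`induced_add`, `induced_sum`), rational, type-preserving and doubling
(Witt completion), hence an out-anchor (criterion). [cite: CamereEtAl2026, Thm. 5.12]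
[cite: Markman2024, Thm. 1.1] [cite: Varesco2023, §2] -/
theorem outAnchor_onSector (h₀ : HodgeK3Facts) (h₁ : HKNikulinTwinClass) (h₂ : DivisorCorrections)
    (h₃ : WittCompletion) (h₄ : OutAnchorOfSimilitude) (h₅ : CupProductAlgebraicInput)
    (hL : LefschetzOneOneK3) (hN : AlgebraicClassesOneOneK3) {μ : OrientationFamily}
    (hμ : μ.HasPoincareDuality) {S : SchemeOver ℂ} (hS : IsK3Surface S) {p : complexBetti S (2 * 2)}
    (hp : Gen[S, p]) (hsec : InHKNikulinSector S) :
    ∃ (Sg : SchemeOver ℂ) (hSg : IsK3Surface Sg) (pg : complexBetti Sg (2 * 2)), Gen[Sg, pg] ∧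
      OutAnchor[μ, S, Sg, hS, hSg, p, pg] := by
  obtain ⟨Sg, hSg, pg, hpg, γ, hγ, hP1, hP2, hP3, hP4, hP5⟩ := h₁ h₀ h₅ hL hN μ hμ S hS p hp hsec
  -- the action of the partial twin class as a linear map
  let Φ : complexBetti S (2 * 1) →ₗ[ℂ] complexBetti Sg (2 * 1) :=
    corrAction μ (IsK3Surface.isSmoothProjective hSg) (IsK3Surface.isSmoothProjective hS)
      (rfl : 2 * 1 + 2 * 2 = 2 * 1 + 2 * 2) γ
  have hΦ : ∀ x, Φ x = Corr[μ, Sg, S, hSg, hS ; γ, x] := fun x => rfl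
  obtain ⟨m, a, b, ha, hb, hW⟩ := h₃ h₀.1 (hodgeIndex_K3_of_marking h₀.1 hL) hL hN S Sg hS hSg p pg
    hp hpg Φ hP1 hP2 hP3 hP4 hP5
  have hp0 : p ≠ 0 := gen_ne_zero h₀ hS hp
  -- the divisor correspondences `γᵢ` acting as `x ↦ (x.aᵢ) bᵢ`, as linear maps
  choose γc hγc hact using fun i => h₂ μ hμ S Sg hS hSg p hp0 (a i) (ha i) (b i) (hb i)
  let ν : Fin m → (complexBetti S (2 * 1) →ₗ[ℂ] complexBetti Sg (2 * 1)) := fun i =>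
    corrAction μ (IsK3Surface.isSmoothProjective hSg) (IsK3Surface.isSmoothProjective hS)
      (rfl : 2 * 1 + 2 * 2 = 2 * 1 + 2 * 2) (γc i)
  have hν : ∀ i (x : complexBetti S (2 * 1)) (t : ℂ),
      cupProduct (rfl : 2 * 1 + 2 * 1 = 2 * 2) x (a i) = t • p → ν i x = t • b i :=
    fun i x t hxt => hact i x t hxt
  obtain ⟨hR, hT, hS2⟩ := hW ν hν
  -- `Ψ₀ = Φ + Σ νᵢ` is the action of an algebraic class
  have halg : ∃ γ₀ ∈ algebraicClasses (MonoidalCategoryStruct.tensorObj Sg S) 2,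
      ∀ x : complexBetti S (2 * 1), (Φ + ∑ i, ν i) x = Corr[μ, Sg, S, hSg, hS ; γ₀, x] := by
    refine induced_add (IsSmoothProjective.tensor_holds (IsK3Surface.isSmoothProjective hSg)
      (IsK3Surface.isSmoothProjective hS)) (IsK3Surface.isSmoothProjective hSg)
      (rfl : 2 * 1 + 2 * 2 = 2 * 1 + 2 * 2) (rfl : 2 * 1 + 2 * 2 + 2 * 2 = 2 * 1 + 2 * (2 + 2))
      ⟨γ, hγ, fun x => rfl⟩ ?_
    exact induced_sum (IsSmoothProjective.tensor_holds (IsK3Surface.isSmoothProjective hSg)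
      (IsK3Surface.isSmoothProjective hS)) (IsK3Surface.isSmoothProjective hSg)
      (rfl : 2 * 1 + 2 * 2 = 2 * 1 + 2 * 2) (rfl : 2 * 1 + 2 * 2 + 2 * 2 = 2 * 1 + 2 * (2 + 2))
      Finset.univ ν (fun i _ => ⟨γc i, hγc i, fun x => rfl⟩)
  exact ⟨Sg, hSg, pg, hpg, h₄ h₀.1 μ hμ S Sg hS hSg p pg hp hpg (Φ + ∑ i, ν i) hR hT hS2 halg⟩

/-- **X at one pair from one OUT-anchor at the SOURCE** (the transpose-free form of the landed
`similitudeAlgebraic_of_anchor`, `r = 2`): Buskin's theorem (`HodgeIsometryAlgebraic`, item 13675),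
the composition of degree-`2` correspondences between smooth projective surfaces, and an algebraic
out-anchor `Ψ : H²(S′) ⥲ H²(Σ)` at the source make every rational, type-preserving `2`-similitude
`ψ : H²(S′) → H²(S)` into any projective K3 `S` algebraic: `ψ ∘ Ψ⁻¹ : H²(Σ) → H²(S)` is a rational
Hodge ISOMETRY (`(u.v) = a·pΣ = 2(a/2)·pΣ ⟹ (Ψ⁻¹u.Ψ⁻¹v) = (a/2)·p′ ⟹ (ψΨ⁻¹u.ψΨ⁻¹v) = a·p`), algebraic
by Buskin; compose with `Ψ = [γ]_*` (`S′ ⊢ Σ ⊢ S`). [cite: Varesco2023, §2]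
[cite: Buskin2019, Thm. 1.1 and Lemma 6.3] -/
theorem simAlg_at_of_outAnchor (hB : HodgeIsometryAlgebraic) (hC : CompCorr)
    {μ : OrientationFamily} (hμ : μ.HasPoincareDuality)
    {S' : SchemeOver ℂ} (hS' : IsK3Surface S') {p' : complexBetti S' (2 * 2)}
    {Sg : SchemeOver ℂ} (hSg : IsK3Surface Sg) {pg : complexBetti Sg (2 * 2)} (hpg : Gen[Sg, pg])
    (hA : OutAnchor[μ, S', Sg, hS', hSg, p', pg])
    (S : SchemeOver ℂ) (hS : IsK3Surface S) (p : complexBetti S (2 * 2)) (hp : Gen[S, p])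
    (ψ : complexBetti S' (2 * 1) →ₗ[ℂ] complexBetti S (2 * 1))
    (hψr : ∀ x, IsRationalClass x → IsRationalClass (ψ x))
    (hψt : ∀ (i j : ℕ) x, IsOfHodgeType 2 S' (2 * 1) i j x → IsOfHodgeType 2 S (2 * 1) i j (ψ x))
    (hψs : ∀ (x y : complexBetti S' (2 * 1)) (a : ℂ),
      cupProduct (rfl : 2 * 1 + 2 * 1 = 2 * 2) x y = a • p' →
        cupProduct (rfl : 2 * 1 + 2 * 1 = 2 * 2) (ψ x) (ψ y) = ((2 : ℂ) * a) • p) :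
    ∃ γ ∈ algebraicClasses (MonoidalCategoryStruct.tensorObj S S') 2,
      ∀ x : complexBetti S' (2 * 1), ψ x = Corr[μ, S, S', hS, hS' ; γ, x] := by
  obtain ⟨Ψ, hΨr, hΨt, hΨs, γ, hγ, hΨγ⟩ := hA
  -- `φ := ψ ∘ Ψ⁻¹ : H²(Σ) → H²(S)` is a rational Hodge isometry.
  have hφr : ∀ u, IsRationalClass u → IsRationalClass ((ψ ∘ₗ Ψ.symm.toLinearMap) u) :=
    fun u hu => hψr _ (hΨr u hu)
  have hφt : ∀ (i j : ℕ) u, IsOfHodgeType 2 Sg (2 * 1) i j u →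
      IsOfHodgeType 2 S (2 * 1) i j ((ψ ∘ₗ Ψ.symm.toLinearMap) u) :=
    fun i j u hu => hψt i j _ (hΨt i j u hu)
  have hφs : ∀ (u v : complexBetti Sg (2 * 1)) (a : ℂ),
      cupProduct (rfl : 2 * 1 + 2 * 1 = 2 * 2) u v = a • pg →
        cupProduct (rfl : 2 * 1 + 2 * 1 = 2 * 2) ((ψ ∘ₗ Ψ.symm.toLinearMap) u)
          ((ψ ∘ₗ Ψ.symm.toLinearMap) v) = a • p := by
    intro u v a huv
    have ha : (2 : ℂ) * (a / 2) = a := by ring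
    have h2 : cupProduct (rfl : 2 * 1 + 2 * 1 = 2 * 2) u v = ((2 : ℂ) * (a / 2)) • pg := by
      rw [huv, ha]
    have h3 := hψs _ _ (a / 2) (hΨs u v (a / 2) h2)
    rw [ha] at h3
    simpa only [LinearMap.coe_comp, LinearEquiv.coe_coe, Function.comp_apply] using h3
  -- Buskin for the K3 pair `(S, Σ)`, then compose `S′ ⊢ Σ ⊢ S`.
  obtain ⟨β, hβ, hφβ⟩ :=
    hB μ hμ S Sg hS hSg p pg hp hpg (ψ ∘ₗ Ψ.symm.toLinearMap) hφr hφt hφs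
  obtain ⟨γ₂, hγ₂, hcomp⟩ := hC μ hμ S Sg S' (IsK3Surface.isSmoothProjective hS)
    (IsK3Surface.isSmoothProjective hSg) (IsK3Surface.isSmoothProjective hS') β hβ γ hγ
  refine ⟨γ₂, hγ₂, fun x => ?_⟩
  rw [hcomp x, ← hΨγ x, ← hφβ (Ψ x)]
  simp

/-- **THE SECTOR THEOREM (the line's deliverable, reshaped to sources): X for every pair whose SOURCE
lies in the HK-Nikulin sector** — granted the facts, the heart, the three completion stubs, Buskin, the
composition of correspondences and the two `(1,1)` route items: for projective K3 surfaces `S, S′`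
with `S′` in the sector, every rational, type-preserving `2`-similitude `ψ : H²(S′(ℂ); ℂ) → H²(S(ℂ); ℂ)`
is `fst_*(snd^* – ∪ γ)` for an algebraic `γ` on `S × S′`.  NEW CASES OF X: rank `T(S′) = 14` sources
(`ρ = 8`, e.g. `T ≅ T_d = ⟨−2d⟩ ⊕ U² ⊕ ⟨−2⟩ ⊕ E₈(−1)`), off the Nikulin / Kummer / CM loci; target
coverage follows on paper by `ψ ↦ ψᵗ = 2ψ⁻¹`. [cite: CamereEtAl2026, Thm. 1.2 and Thm. 5.12]
[cite: Markman2024, Thm. 1.1] [cite: Varesco2023, Thm. 2.1 and Prop. 2.5] [cite: Buskin2019, Thm. 1.1] -/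
theorem twinSimilitudeAlgebraic_onSectorSources (h₀ : HodgeK3Facts) (h₁ : HKNikulinTwinClass)
    (h₂ : DivisorCorrections) (h₃ : WittCompletion) (h₄ : OutAnchorOfSimilitude)
    (h₅ : CupProductAlgebraicInput)
    (hB : HodgeIsometryAlgebraic) (hL : LefschetzOneOneK3) (hN : AlgebraicClassesOneOneK3)
    {μ : OrientationFamily} (hμ : μ.HasPoincareDuality)
    (S S' : SchemeOver ℂ) (hS : IsK3Surface S) (hS' : IsK3Surface S')
    (p : complexBetti S (2 * 2)) (p' : complexBetti S' (2 * 2)) (hp : Gen[S, p]) (hp' : Gen[S', p'])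
    (hsec : InHKNikulinSector S')
    (ψ : complexBetti S' (2 * 1) →ₗ[ℂ] complexBetti S (2 * 1))
    (hψr : ∀ x, IsRationalClass x → IsRationalClass (ψ x))
    (hψt : ∀ (i j : ℕ) x, IsOfHodgeType 2 S' (2 * 1) i j x → IsOfHodgeType 2 S (2 * 1) i j (ψ x))
    (hψs : ∀ (x y : complexBetti S' (2 * 1)) (a : ℂ),
      cupProduct (rfl : 2 * 1 + 2 * 1 = 2 * 2) x y = a • p' →
        cupProduct (rfl : 2 * 1 + 2 * 1 = 2 * 2) (ψ x) (ψ y) = ((2 : ℂ) * a) • p) :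
    ∃ γ ∈ algebraicClasses (MonoidalCategoryStruct.tensorObj S S') 2,
      ∀ x : complexBetti S' (2 * 1), ψ x = Corr[μ, S, S', hS, hS' ; γ, x] := by
  obtain ⟨Sg, hSg, pg, hpg, hA⟩ := outAnchor_onSector h₀ h₁ h₂ h₃ h₄ h₅ hL hN hμ hS' hp' hsec
  exact simAlg_at_of_outAnchor hB (compCorr_of_cupProductAlgebraic h₅) hμ hS' hSg hpg hA S hS p hp ψ
    hψr hψt hψs

/-! ### Reshape r6: X at pairs whose TARGET is in the sector -/

/-- **X at one pair from one out-anchor at the TARGET** (r6, the transpose form): for a projective K3 `S`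
with an algebraic out-anchor `Ψ : H²(S) ⥲ H²(Σ)` (inverse rational, type-preserving, halving) and ANY
rational, type-preserving `2`-similitude `ψ : H²(S′) → H²(S)` from a projective K3 `S′`, the map
`φ := ½ · (Ψ ∘ ψ) : H²(S′) → H²(Σ)` is rational, type-preserving (T4 makes `Ψ` rational, type-preserving,
doubling) and an ISOMETRY (`(x.y) = a·p′ ⟹ (ψx.ψy) = 2a·p ⟹ (Ψψx.Ψψy) = 4a·pΣ ⟹ (φx.φy) = a·pΣ`), hence
`[β]_*` for an algebraic `β` on `Σ ⊗ S′` by Buskin (`HodgeIsometryAlgebraic` at `(Σ, S′)`); `Ψ ∘ ψ = [2β]_*`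
(`induced_smul`), `Ψ⁻¹ = [γ′]_*` is algebraic (T3 from T1, T2), and `ψ = Ψ⁻¹ ∘ (Ψ ∘ ψ)` is the composition
`S′ ⊢ Σ ⊢ S` of algebraic correspondences (`CompCorr`). [cite: Varesco2023, §2 (proof of Thm. 2.1)]
[cite: Buskin2019, Thm. 1.1 and Lemma 6.3] -/
theorem simAlg_at_of_outAnchor_target (hmk : Huybrechts_K3_marking_exists)
    (hT : TopPushProportional) (hC' : CorrTranspose) (hI : InverseAnchorAlgebraic) (hF : AnchorForward)
    (hB : HodgeIsometryAlgebraic) (hC : CompCorr)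
    {μ : OrientationFamily} (hμ : μ.HasPoincareDuality)
    {S : SchemeOver ℂ} (hS : IsK3Surface S) {p : complexBetti S (2 * 2)} (hp : Gen[S, p])
    {Sg : SchemeOver ℂ} (hSg : IsK3Surface Sg) {pg : complexBetti Sg (2 * 2)} (hpg : Gen[Sg, pg])
    (hA : OutAnchor[μ, S, Sg, hS, hSg, p, pg])
    (S' : SchemeOver ℂ) (hS' : IsK3Surface S') (p' : complexBetti S' (2 * 2)) (hp' : Gen[S', p'])
    (ψ : complexBetti S' (2 * 1) →ₗ[ℂ] complexBetti S (2 * 1))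
    (hψr : ∀ x, IsRationalClass x → IsRationalClass (ψ x))
    (hψt : ∀ (i j : ℕ) x, IsOfHodgeType 2 S' (2 * 1) i j x → IsOfHodgeType 2 S (2 * 1) i j (ψ x))
    (hψs : ∀ (x y : complexBetti S' (2 * 1)) (a : ℂ),
      cupProduct (rfl : 2 * 1 + 2 * 1 = 2 * 2) x y = a • p' →
        cupProduct (rfl : 2 * 1 + 2 * 1 = 2 * 2) (ψ x) (ψ y) = ((2 : ℂ) * a) • p) :
    ∃ γ ∈ algebraicClasses (MonoidalCategoryStruct.tensorObj S S') 2,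
      ∀ x : complexBetti S' (2 * 1), ψ x = Corr[μ, S, S', hS, hS' ; γ, x] := by
  obtain ⟨Ψ, hΨr, hΨt, hΨs, γ, hγ, hΨγ⟩ := hA
  obtain ⟨hΨr', hΨt', hΨs'⟩ := hF hmk S Sg hS hSg p pg hp hpg Ψ hΨr hΨt hΨs
  -- `φ := ½ · (Ψ ∘ ψ) : H²(S′) → H²(Σ)` is a rational Hodge isometry
  set φ : complexBetti S' (2 * 1) →ₗ[ℂ] complexBetti Sg (2 * 1) :=
    (((1 / 2 : ℚ) : ℂ)) • (Ψ.toLinearMap ∘ₗ ψ) with hφdef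
  have hφ : ∀ x, φ x = ((1 / 2 : ℚ) : ℂ) • Ψ (ψ x) := fun x => rfl
  have hφr : ∀ x, IsRationalClass x → IsRationalClass (φ x) := fun x hx => by
    rw [hφ]
    exact (hΨr' _ (hψr x hx)).smul (1 / 2 : ℚ)
  have hφt : ∀ (i j : ℕ) x, IsOfHodgeType 2 S' (2 * 1) i j x →
      IsOfHodgeType 2 Sg (2 * 1) i j (φ x) := fun i j x hx => by
    rw [hφ]
    exact (hΨt' i j _ (hψt i j x hx)).smul _
  have hhalf : (((1 / 2 : ℚ) : ℂ)) = (2 : ℂ)⁻¹ := by push_cast; ring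
  have hφs : ∀ (x y : complexBetti S' (2 * 1)) (a : ℂ),
      cupProduct (rfl : 2 * 1 + 2 * 1 = 2 * 2) x y = a • p' →
        cupProduct (rfl : 2 * 1 + 2 * 1 = 2 * 2) (φ x) (φ y) = a • pg := by
    intro x y a hxy
    have h4 := hΨs' (ψ x) (ψ y) ((2 : ℂ) * a) (hψs x y a hxy)
    rw [hφ, hφ]
    simp only [map_smul, LinearMap.smul_apply]
    rw [h4, smul_smul, smul_smul, hhalf]
    congr 1
    ring
  -- Buskin at `(Σ, S′)`: `φ = [β]_*`; hence `Ψ ∘ ψ = 2 • φ = [2 • β]_*`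
  obtain ⟨β, hβ, hφβ⟩ := hB μ hμ Sg S' hSg hS' pg p' hpg hp' φ hφr hφt hφs
  obtain ⟨β₂, hβ₂, h2φ⟩ := induced_smul
    (IsSmoothProjective.tensor_holds (IsK3Surface.isSmoothProjective hSg)
      (IsK3Surface.isSmoothProjective hS')) (IsK3Surface.isSmoothProjective hSg)
    (rfl : 2 * 1 + 2 * 2 = 2 * 1 + 2 * 2) (rfl : 2 * 1 + 2 * 2 + 2 * 2 = 2 * 1 + 2 * (2 + 2))
    (2 : ℂ) ⟨β, hβ, hφβ⟩
  have hΨψ : ∀ x, Ψ (ψ x) = ((2 : ℂ) • φ) x := fun x => by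
    rw [LinearMap.smul_apply, hφ, smul_smul, hhalf, mul_inv_cancel₀ (two_ne_zero' ℂ), one_smul]
  -- the inverse of the out-anchor is algebraic
  obtain ⟨γ', hγ', hΨ'⟩ := hI hT hC' hmk μ hμ S Sg hS hSg p pg hp hpg Ψ hΨs ⟨γ, hγ, hΨγ⟩
  -- compose `S′ ⊢ Σ ⊢ S`
  obtain ⟨γ₂, hγ₂, hcomp⟩ := hC μ hμ S Sg S' (IsK3Surface.isSmoothProjective hS)
    (IsK3Surface.isSmoothProjective hSg) (IsK3Surface.isSmoothProjective hS') γ' hγ' β₂ hβ₂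
  refine ⟨γ₂, hγ₂, fun x => ?_⟩
  rw [hcomp x, ← h2φ x, ← hΨψ x, ← hΨ' (Ψ (ψ x)), LinearEquiv.symm_apply_apply]

/-- **THE TARGET THEOREM (r6): X for every pair whose TARGET `S` lies in the HK-Nikulin sector** —
granted the facts, the heart, the three completion stubs (out-anchor at `S`, `outAnchor_onSector`), the
r6 stubs T1–T4, Buskin, the composition of correspondences and the two `(1,1)` route items.
[cite: CamereEtAl2026, Thm. 1.2 and Thm. 5.12] [cite: Markman2024, Thm. 1.1] [cite: Varesco2023, Thm. 2.1]
[cite: Buskin2019, Thm. 1.1] -/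
theorem twinSimilitudeAlgebraic_onSectorTargets (h₀ : HodgeK3Facts) (h₁ : HKNikulinTwinClass)
    (h₂ : DivisorCorrections) (h₃ : WittCompletion) (h₄ : OutAnchorOfSimilitude)
    (h₅ : CupProductAlgebraicInput)
    (hT : TopPushProportional) (hC' : CorrTranspose) (hI : InverseAnchorAlgebraic) (hF : AnchorForward)
    (hB : HodgeIsometryAlgebraic) (hL : LefschetzOneOneK3) (hN : AlgebraicClassesOneOneK3)
    {μ : OrientationFamily} (hμ : μ.HasPoincareDuality)
    (S S' : SchemeOver ℂ) (hS : IsK3Surface S) (hS' : IsK3Surface S')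
    (p : complexBetti S (2 * 2)) (p' : complexBetti S' (2 * 2)) (hp : Gen[S, p]) (hp' : Gen[S', p'])
    (hsec : InHKNikulinSector S)
    (ψ : complexBetti S' (2 * 1) →ₗ[ℂ] complexBetti S (2 * 1))
    (hψr : ∀ x, IsRationalClass x → IsRationalClass (ψ x))
    (hψt : ∀ (i j : ℕ) x, IsOfHodgeType 2 S' (2 * 1) i j x → IsOfHodgeType 2 S (2 * 1) i j (ψ x))
    (hψs : ∀ (x y : complexBetti S' (2 * 1)) (a : ℂ),
      cupProduct (rfl : 2 * 1 + 2 * 1 = 2 * 2) x y = a • p' →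
        cupProduct (rfl : 2 * 1 + 2 * 1 = 2 * 2) (ψ x) (ψ y) = ((2 : ℂ) * a) • p) :
    ∃ γ ∈ algebraicClasses (MonoidalCategoryStruct.tensorObj S S') 2,
      ∀ x : complexBetti S' (2 * 1), ψ x = Corr[μ, S, S', hS, hS' ; γ, x] := by
  obtain ⟨Sg, hSg, pg, hpg, hA⟩ := outAnchor_onSector h₀ h₁ h₂ h₃ h₄ h₅ hL hN hμ hS hp hsec
  exact simAlg_at_of_outAnchor_target h₀.1 hT hC' hI hF hB (compCorr_of_cupProductAlgebraic h₅) hμ hS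
    hp hSg hpg hA S' hS' p' hp' ψ hψr hψt hψs

/-- **The r6 residual is weaker than X** (drop the two negated sector hypotheses). [folklore] -/
theorem offSectorPairs_of_twinSimilitudeAlgebraic (h : TwinSimilitudeAlgebraic) : OffSectorPairs :=
  fun μ hμ S S' hS hS' p p' hp hp' ψ hψr hψt hψs _ _ => h μ hμ S S' hS hS' p p' hp hp' ψ hψr hψt hψs

/-- **The r1–r5 residual from the r6 one**: off the sector at the source, either the target is in the
sector (target theorem) or the pair is in the r6 residual. [folklore] -/
theorem offSectorSources_of_offSectorPairs (h₀ : HodgeK3Facts) (h₁ : HKNikulinTwinClass)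
    (h₂ : DivisorCorrections) (h₃ : WittCompletion) (h₄ : OutAnchorOfSimilitude)
    (h₅ : CupProductAlgebraicInput)
    (hT : TopPushProportional) (hC' : CorrTranspose) (hI : InverseAnchorAlgebraic) (hF : AnchorForward)
    (h₈ : OffSectorPairs)
    (hB : HodgeIsometryAlgebraic) (hL : LefschetzOneOneK3) (hN : AlgebraicClassesOneOneK3) :
    OffSectorSources := by
  intro μ hμ S S' hS hS' p p' hp hp' ψ hψr hψt hψs hsec'
  by_cases hsec : InHKNikulinSector S
  · exact twinSimilitudeAlgebraic_onSectorTargets h₀ h₁ h₂ h₃ h₄ h₅ hT hC' hI hF hB hL hN hμ S S' hS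
      hS' p p' hp hp' hsec ψ hψr hψt hψs
  · exact h₈ μ hμ S S' hS hS' p p' hp hp' ψ hψr hψt hψs hsec' hsec

/-! ### Reshape r9: the old residual from the CM-norm stubs and the new residual -/

/-- **The r9 residual is weaker than X** (drop the four negated hypotheses). [folklore] -/
theorem offSectorNonCMPairs_of_twinSimilitudeAlgebraic (h : TwinSimilitudeAlgebraic) : OffSectorNonCMPairs :=
  fun μ hμ S S' hS hS' p p' hp hp' ψ hψr hψt hψs _ _ _ _ => h μ hμ S S' hS hS' p p' hp hp' ψ hψr hψt hψs

/-- **The r6 residual `OffSectorPairs` from the r9 stubs** (r9/r10 form, kept for the record): off the sector at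
both twins, either a twin is CM-norm-2 (`CMNormTwins`, granted markings, Buskin's CM corollary, the cup-product input
and Buskin) or the pair is in the r9 residual. [cite: Buskin2019, Thm. 1.1 and Corollary] [cite: Huybrechts2019, Cor. 0.4 (ii)] -/
theorem offSectorPairs_of_cmNorm (hmk : Huybrechts_K3_marking_exists)
    (hcmf : Buskin2019_hodgeConjectureFor_square_of_CM)
    (h₅ : CupProductAlgebraicInput) (hcm : CMNormTwins) (h₉ : OffSectorNonCMPairs)
    (hB : HodgeIsometryAlgebraic) : OffSectorPairs := by
  intro μ hμ S S' hS hS' p p' hp hp' ψ hψr hψt hψs hsec' hsec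
  by_cases hc : CMNorm2[S', p'] ∨ CMNorm2[S, p]
  · exact hcm hmk hcmf h₅ hB μ hμ S S' hS hS' p p' hp hp' hc ψ hψr hψt hψs
  · exact h₉ μ hμ S S' hS hS' p p' hp hp' ψ hψr hψt hψs hsec' hsec (fun h => hc (Or.inl h))
      (fun h => hc (Or.inr h))

/-! ### Reshape r11: the CM-norm self-anchor and the CM-norm twins WITHOUT Buskin's CM corollary -/

/-- **A CM-norm-2 projective K3 surface is its own algebraic `2`-anchor — r11 form, from Buskin's THEOREM.**
Verbatim the landed `outAnchor_self_of_cmNorm` (p123920) except that the algebraicity `e = [γ_e]_*` of the CM-norm-2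
self-similitude comes from the r11 assembly stub `CMSelfSimilitudeFromIsometries` (granted the three r11 worker stubs,
K3 markings, `HodgeIsometryAlgebraic` 13675, the two `(1,1)` items, Hodge index and `DivisorCorrections`) instead of
the named fact `Buskin2019_hodgeConjectureFor_square_of_CM`: `e` is bijective (a `2`-similitude of the non-degenerate
K3 form through a marking), algebraic, and `e⁻¹` is rational, type-preserving and halving (`stub_anchorForward` on the
equivalence with inverse `½e`). [cite: Buskin2019, Thm. 1.1 and Corollary (Introduction)] [cite: Huybrechts2019, Cor. 0.4 (ii)] -/
theorem outAnchor_self_of_cmNorm' (hA : CMCayleyDecomposition) (hP : CMPolyComplexify) (hR : CMRationalForm)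
    (hD : CMSelfSimilitudeFromIsometries) (hmk : Huybrechts_K3_marking_exists) (hB : HodgeIsometryAlgebraic)
    (hL : LefschetzOneOneK3) (hN : AlgebraicClassesOneOneK3)
    (hHI : ∀ (S : SchemeOver ℂ), IsK3Surface S → hodgeIndex_surface S) (hDC : DivisorCorrections)
    {μ : OrientationFamily} (hμ : μ.HasPoincareDuality)
    {S : SchemeOver ℂ} (hS : IsK3Surface S) {p : complexBetti S (2 * 2)} (hp : Gen[S, p])
    (hcm : CMNorm2[S, p]) : OutAnchor[μ, S, S, hS, hS, p, p] := by
  obtain ⟨e, he_rat, he_sim, σ, t, hσ, hσ0, htim, heσ⟩ := hcm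
  obtain ⟨η, p₀, x₀, hp₀0, hm, hx⟩ := hmk S hS
  obtain ⟨hJrat, hJ2, hJx, hJe⟩ := cmNorm_markingConj hS hp η p₀ x₀ hm e he_rat he_sim hσ hσ0 heσ
  have he_typ : ∀ (i j : ℕ) x, IsOfHodgeType 2 S (2 * 1) i j x → IsOfHodgeType 2 S (2 * 1) i j (e x) :=
    cmNorm_typePreserving hmk hS hp e he_rat he_sim hσ hσ0 heσ
  set J : Module.End ℂ (K3Index → ℂ) := η.toLinearMap ∘ₗ e ∘ₗ η.symm.toLinearMap with hJdef
  -- `J`, hence `e`, is bijective (a `2`-similitude of the non-degenerate K3 form)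
  have hJinj : Function.Injective J := by
    refine (injective_iff_map_eq_zero J).2 fun a ha => k3Form_eq_zero_of_forall fun b => ?_
    have h := hJ2 a b
    rw [ha, k3Form_zero_left] at h
    exact (mul_eq_zero.1 h.symm).resolve_left two_ne_zero
  have hJsurj : Function.Surjective J := LinearMap.surjective_of_injective hJinj
  let Je : (K3Index → ℂ) ≃ₗ[ℂ] (K3Index → ℂ) := LinearEquiv.ofBijective J ⟨hJinj, hJsurj⟩
  let E : complexBetti S (2 * 1) ≃ₗ[ℂ] complexBetti S (2 * 1) := η.trans (Je.trans η.symm)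
  have hE : ∀ y, E y = e y := fun y => by
    show η.symm (Je (η y)) = e y
    rw [LinearEquiv.ofBijective_apply, hJe]
  -- `Φ := 2 · e⁻¹`, the equivalence with inverse `½ e`
  have hhalf : (((1 / 2 : ℚ) : ℂ)) = (2 : ℂ)⁻¹ := by push_cast; ring
  let f : complexBetti S (2 * 1) →ₗ[ℂ] complexBetti S (2 * 1) :=
    (2 : ℂ) • (E.symm : complexBetti S (2 * 1) →ₗ[ℂ] complexBetti S (2 * 1))
  let g : complexBetti S (2 * 1) →ₗ[ℂ] complexBetti S (2 * 1) :=
    (((1 / 2 : ℚ) : ℂ)) • (E : complexBetti S (2 * 1) →ₗ[ℂ] complexBetti S (2 * 1))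
  have hfg : ∀ y, f (g y) = y := fun y => by
    simp only [f, g, LinearMap.smul_apply, LinearEquiv.coe_coe, map_smul, LinearEquiv.symm_apply_apply,
      smul_smul, hhalf, inv_mul_cancel₀ (two_ne_zero' ℂ), one_smul]
  have hgf : ∀ x, g (f x) = x := fun x => by
    simp only [f, g, LinearMap.smul_apply, LinearEquiv.coe_coe, map_smul, LinearEquiv.apply_symm_apply,
      smul_smul, hhalf, mul_inv_cancel₀ (two_ne_zero' ℂ), one_smul]
  let Φ : complexBetti S (2 * 1) ≃ₗ[ℂ] complexBetti S (2 * 1) :=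
    LinearEquiv.ofLinear f g (LinearMap.ext hfg) (LinearMap.ext hgf)
  have hΦ : ∀ y, Φ y = (2 : ℂ) • E.symm y := fun y => rfl
  have hΦ' : ∀ y, Φ.symm y = (((1 / 2 : ℚ) : ℂ)) • e y := fun y => by
    show g y = _
    simp only [g, LinearMap.smul_apply, LinearEquiv.coe_coe, hE]
  have hr : ∀ y, IsRationalClass y → IsRationalClass (Φ.symm y) := fun y hy => by
    rw [hΦ']
    exact (he_rat y hy).smul (1 / 2 : ℚ)
  have ht : ∀ (i j : ℕ) y, IsOfHodgeType 2 S (2 * 1) i j y →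
      IsOfHodgeType 2 S (2 * 1) i j (Φ.symm y) := fun i j y hy => by
    rw [hΦ']
    exact (he_typ i j y hy).smul _
  have hs : ∀ (u v : complexBetti S (2 * 1)) (b : ℂ),
      cupProduct (rfl : 2 * 1 + 2 * 1 = 2 * 2) u v = ((2 : ℂ) * b) • p →
        cupProduct (rfl : 2 * 1 + 2 * 1 = 2 * 2) (Φ.symm u) (Φ.symm v) = b • p := by
    intro u v b huv
    rw [hΦ', hΦ']
    simp only [map_smul, LinearMap.smul_apply]
    rw [he_sim u v ((2 : ℂ) * b) huv, smul_smul, smul_smul, hhalf]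
    congr 1
    ring
  obtain ⟨hΦr, hΦt, hΦs⟩ := stub_anchorForward hmk S S hS hS p p hp hp Φ hr ht hs
  have hEs : ∀ z, E.symm z = (((1 / 2 : ℚ) : ℂ)) • Φ z := fun z => by
    rw [hΦ, smul_smul, hhalf, inv_mul_cancel₀ (two_ne_zero' ℂ), one_smul]
  -- `e = [γ_e]_*` is algebraic: the r11 assembly stub (Buskin's THEOREM, not his CM corollary)
  obtain ⟨γ, hγ, heγ⟩ := hD hA hP hR hmk hB hL hN hHI hDC μ hμ S hS p hp e he_rat he_sim σ t hσ hσ0 htim heσ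
  refine ⟨E, ?_, ?_, ?_, γ, hγ, fun x => ?_⟩
  · intro y hy
    rw [hEs]
    exact (hΦr y hy).smul (1 / 2 : ℚ)
  · intro i j y hy
    rw [hEs]
    exact (hΦt i j y hy).smul _
  · intro u v b huv
    rw [hEs, hEs]
    simp only [map_smul, LinearMap.smul_apply]
    rw [hΦs u v ((2 : ℂ) * b) huv, smul_smul, smul_smul, hhalf]
    congr 1
    ring
  · rw [hE]
    exact heγ x

/-- **X whenever EITHER twin is CM-norm-2 — r11 form, WITHOUT Buskin's CM corollary**: the CM-norm-2 twin is its own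
anchor (`outAnchor_self_of_cmNorm'`), then the landed glue — `simAlg_at_of_outAnchor` when the SOURCE is CM-norm-2
(`ψ ∘ e⁻¹` is a rational Hodge isometry, Buskin, compose with `e`), `simAlg_at_of_outAnchor_target` when the TARGET is
(`½e ∘ ψ` is a rational Hodge isometry; `e⁻¹` algebraic by the transpose calculus T1–T4).  Inputs: the four r11 stubs,
markings, 13675, the `(1,1)` items, Hodge index, `DivisorCorrections`, the cup-product input; no sector hypothesis.
[cite: Buskin2019, Thm. 1.1] [cite: Varesco2023, §0.1] -/
theorem twinSimilitudeAlgebraic_at_of_cmNorm_either' (hA : CMCayleyDecomposition) (hP : CMPolyComplexify)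
    (hR : CMRationalForm) (hD : CMSelfSimilitudeFromIsometries) (hmk : Huybrechts_K3_marking_exists)
    (hB : HodgeIsometryAlgebraic) (hL : LefschetzOneOneK3) (hN : AlgebraicClassesOneOneK3)
    (hHI : ∀ (S : SchemeOver ℂ), IsK3Surface S → hodgeIndex_surface S) (hDC : DivisorCorrections)
    (h₅ : CupProductAlgebraicInput)
    (hT : TopPushProportional) (hC' : CorrTranspose) (hI : InverseAnchorAlgebraic) (hF : AnchorForward)
    {μ : OrientationFamily} (hμ : μ.HasPoincareDuality)
    (S S' : SchemeOver ℂ) (hS : IsK3Surface S) (hS' : IsK3Surface S')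
    (p : complexBetti S (2 * 2)) (p' : complexBetti S' (2 * 2)) (hp : Gen[S, p]) (hp' : Gen[S', p'])
    (hcm : CMNorm2[S', p'] ∨ CMNorm2[S, p])
    (ψ : complexBetti S' (2 * 1) →ₗ[ℂ] complexBetti S (2 * 1))
    (hψr : ∀ x, IsRationalClass x → IsRationalClass (ψ x))
    (hψt : ∀ (i j : ℕ) x, IsOfHodgeType 2 S' (2 * 1) i j x → IsOfHodgeType 2 S (2 * 1) i j (ψ x))
    (hψs : ∀ (x y : complexBetti S' (2 * 1)) (a : ℂ),
      cupProduct (rfl : 2 * 1 + 2 * 1 = 2 * 2) x y = a • p' →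
        cupProduct (rfl : 2 * 1 + 2 * 1 = 2 * 2) (ψ x) (ψ y) = ((2 : ℂ) * a) • p) :
    ∃ γ ∈ algebraicClasses (MonoidalCategoryStruct.tensorObj S S') 2,
      ∀ x : complexBetti S' (2 * 1), ψ x = Corr[μ, S, S', hS, hS' ; γ, x] := by
  rcases hcm with hcm | hcm
  · exact simAlg_at_of_outAnchor hB (compCorr_of_cupProductAlgebraic h₅) hμ hS' hS' hp'
      (outAnchor_self_of_cmNorm' hA hP hR hD hmk hB hL hN hHI hDC hμ hS' hp' hcm) S hS p hp ψ hψr hψt hψs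
  · exact simAlg_at_of_outAnchor_target hmk hT hC' hI hF hB (compCorr_of_cupProductAlgebraic h₅) hμ hS hp hS hp
      (outAnchor_self_of_cmNorm' hA hP hR hD hmk hB hL hN hHI hDC hμ hS hp hcm) S' hS' p' hp' ψ hψr hψt hψs

/-- **The r6 residual `OffSectorPairs` from the r11 stubs and the r9 residual** (no CM corollary): off the sector at
both twins, either a twin is CM-norm-2 (`twinSimilitudeAlgebraic_at_of_cmNorm_either'`) or the pair is in the r9
residual. [cite: Buskin2019, Thm. 1.1] -/
theorem offSectorPairs_of_cmNorm' (hA : CMCayleyDecomposition) (hP : CMPolyComplexify)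
    (hR : CMRationalForm) (hD : CMSelfSimilitudeFromIsometries) (hmk : Huybrechts_K3_marking_exists)
    (hB : HodgeIsometryAlgebraic) (hL : LefschetzOneOneK3) (hN : AlgebraicClassesOneOneK3)
    (hHI : ∀ (S : SchemeOver ℂ), IsK3Surface S → hodgeIndex_surface S) (hDC : DivisorCorrections)
    (h₅ : CupProductAlgebraicInput)
    (hT : TopPushProportional) (hC' : CorrTranspose) (hI : InverseAnchorAlgebraic) (hF : AnchorForward)
    (h₉ : OffSectorNonCMPairs) : OffSectorPairs := by
  intro μ hμ S S' hS hS' p p' hp hp' ψ hψr hψt hψs hsec' hsec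
  by_cases hc : CMNorm2[S', p'] ∨ CMNorm2[S, p]
  · exact twinSimilitudeAlgebraic_at_of_cmNorm_either' hA hP hR hD hmk hB hL hN hHI hDC h₅ hT hC' hI hF hμ S S'
      hS hS' p p' hp hp' hc ψ hψr hψt hψs
  · exact h₉ μ hμ S S' hS hS' p p' hp hp' ψ hψr hψt hψs hsec' hsec (fun h => hc (Or.inl h))
      (fun h => hc (Or.inr h))

/-- **`TwinSimilitudeAlgebraic_of` — the composition of the line (reshape r11), concluding the route's
crux `Summit.HodgeConjecture.HodgeConjecture.Theses.NikulinTwinTransport.TwinSimilitudeAlgebraic` BY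
NAME.**  Hypotheses (r12): ONLY the OPEN registered stubs by their name-keyed aliases — the named K3 /
hyperkähler facts, the named cup-product fact (Voisin I Thm. 11.32 ⊗ ℂ) and the declared residual `OffSectorNonCMPairs`
(the four r11 CM stubs are LANDED — p126263, p126334, p126486, p126672 — and enter by their proofs) — and ONE route item of
NikulinTwinTransport by name: Buskin's theorem `HodgeIsometryAlgebraic` (13675); `LefschetzOneOneK3` (13678, r12:
`lefschetzOneOneK3_proof`) and `AlgebraicClassesOneOneK3` (15041) are CLOSED and enter by their proofs.  Buskin's CM
corollary is NO LONGER an input.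
Every other stub of r1–r10 is a THEOREM of the tree and enters through its proof.  Proof: by cases — source in the
sector (sector theorem), else target in the sector (target theorem), else a CM-norm-2 twin (r11 CM stubs + Buskin),
else the residual. -/
theorem TwinSimilitudeAlgebraic_of (h₀ : Registered.stub_hodgeK3Facts)
    (h₅' : Registered.stub_cupProductFacts) (h₉ : Registered.stub_offSectorNonCMPairs)
    (hB : HodgeIsometryAlgebraic) :
    Summit.HodgeConjecture.HodgeConjecture.Theses.NikulinTwinTransport.TwinSimilitudeAlgebraic := by
  -- the DISCHARGED stubs (theorems of the tree) enter by their proofs, not as hypotheses — r12: also the four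
  -- r11 CM stubs (wave 1 of lead c6: p126263, p126334, p126486, p126672); so do the CLOSED route items
  -- `AlgebraicClassesOneOneK3` (15041) and — r12 — `LefschetzOneOneK3` (13678, `lefschetzOneOneK3_proof`); the
  -- cup-product input (= item 14350) is derived from the named fact `h₅'`; the old residual `OffSectorPairs` is
  -- derived from the four CM stubs + the r9 residual
  have hL : LefschetzOneOneK3 := lefschetzOneOneK3_proof
  have hA : CMCayleyDecomposition := cmCayleyDecomposition_holds
  have hP : CMPolyComplexify := cmPolyComplexify_holds
  have hR : CMRationalForm := cmRationalForm_holds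
  have hD : CMSelfSimilitudeFromIsometries := cmSelfSimilitudeFromIsometries_holds
  have h₅ : CupProductAlgebraicInput := cupProductAlgebraicInput_of_facts h₅'
  have h₁ : HKNikulinTwinClass := hkTwinClassAssembly_holds hkLatticeWitt_holds
  have hN : AlgebraicClassesOneOneK3 := algebraicClassesOneOneK3_proof
  have hHI : ∀ (S : SchemeOver ℂ), IsK3Surface S → hodgeIndex_surface S := hodgeIndex_K3_of_marking h₀.1 hL
  have hT : TopPushProportional := topPushProportional_holds
  have hC' : CorrTranspose := corrTranspose_holds
  have hI : InverseAnchorAlgebraic := inverseAnchorAlgebraic_holds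
  have hF : AnchorForward := anchorForward_holds
  have h₈ : OffSectorPairs :=
    offSectorPairs_of_cmNorm' hA hP hR hD h₀.1 hB hL hN hHI divisorCorrections_holds h₅ hT hC' hI hF h₉
  intro μ hμ S S' hS hS' p p' hp hp' ψ hψr hψt hψs
  by_cases hsec' : InHKNikulinSector S'
  · exact twinSimilitudeAlgebraic_onSectorSources h₀ h₁ divisorCorrections_holds wittCompletion_holds
      outAnchorOfSimilitude_holds h₅ hB hL hN hμ S S' hS hS' p p' hp hp' hsec' ψ hψr hψt hψs
  · by_cases hsec : InHKNikulinSector S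
    · exact twinSimilitudeAlgebraic_onSectorTargets h₀ h₁ divisorCorrections_holds wittCompletion_holds
        outAnchorOfSimilitude_holds h₅ hT hC' hI hF hB hL hN hμ S S' hS hS' p p' hp hp' hsec ψ hψr
        hψt hψs
    · exact h₈ μ hμ S S' hS hS' p p' hp hp' ψ hψr hψt hψs hsec' hsec

/-- Wiring check: the registered stubs feed `TwinSimilitudeAlgebraic_of` as stated (modulo the one open
route item `HodgeIsometryAlgebraic`). -/
example (hB : HodgeIsometryAlgebraic) :
    Summit.HodgeConjecture.HodgeConjecture.Theses.NikulinTwinTransport.TwinSimilitudeAlgebraic :=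
  TwinSimilitudeAlgebraic_of stub_hodgeK3Facts stub_cupProductFacts stub_offSectorNonCMPairs hB

end Summit.HodgeConjecture.HodgeConjecture.Cruxes.TwinSimilitudeAlgebraic.HyperkaehlerNikulinAnchors

end
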